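import Summits.RiemannHypothesis.RiemannHypothesis.Theorems.TiltedLandingLaw421StubAnalyticHeredity

import Literature.NumberTheory.LFunctions.RiemannHypothesisUpTo1000X
import Literature.NumberTheory.LFunctions.ZetaZeroFreeRegion
import Literature.NumberTheory.LFunctions.ZetaRealAxis
import Literature.NumberTheory.LFunctions.GeneralizedRH
import Literature.NumberTheory.LFunctions.HardyZExtremaCriterion
import Literature.NumberTheory.LFunctions.DeuringZeroSpacingPhenomenon
import Literature.NumberTheory.LFunctions.ZetaZeros
import Literature.NumberTheory.LFunctions.ZeroCounting
import Literature.NumberTheory.LFunctions.ExplicitZeroFreeRegionRoundsProofs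
import Literature.NumberTheory.DiophantineGeometry.NamedHypotheses
import Literature.NumberTheory.LFunctions.DeBruijnNewmanConstProofs


import Literature.NumberTheory.LFunctions.RiemannXiProofs
import Literature.Analysis.Complex.LaguerrePolyaClass
import Literature.NumberTheory.LFunctions.XiLaguerreSeparationRH
import Mathlib.Analysis.Calculus.DerivativeTest
import Mathlib.Analysis.Complex.RealDeriv
import Summits.RiemannHypothesis.RiemannHypothesis.Theorems.Splittings.JensenX4HereditaryLaguerreRH
import Summits.RiemannHypothesis.RiemannHypothesis.Theses.HardyZLehmerSplit
import Summits.RiemannHypothesis.RiemannHypothesis.Theses.EarlyAppointments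
import Summits.RiemannHypothesis.RiemannHypothesis.Theorems.Splittings.EarlyAppointmentsLocalFourierPolya
import Literature.Analysis.Complex.JensenCircles
import Mathlib.Analysis.Real.Pi.Bounds
import Mathlib.Analysis.SpecialFunctions.Trigonometric.Complex

/-! c12 FieldSplit registration (CA217)/(CA221)/(CA225) R3-prime image of the v1b tail variant; declarations token-identical to reg/fieldsplit_v1b.lean f85a65ec82d7e31d (node rev c e5335abe, seam 899418f2) minus comments, #print/#guard_msgs diagnostics and anonymous examples (gate content cap 200 000 B); full source pub/ideators/rh-idea-6/g20/w07c12/reg/ ; script pub/rh-split/rh-tenure-earlyapp/g3/minify_lean3.py -/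






























set_option linter.unusedVariables false

noncomputable section

open Complex

namespace RhIdea6.G17.W07C7

open Literature.NumberTheory.LFunctions Literature.NumberTheory.DiophantineGeometry
open Summit.RiemannHypothesis.RiemannHypothesis.Theses




def OffLineZeroAt (γ δ : ℝ) : Prop :=
 riemannZeta ⟨1 / 2 + δ, γ⟩ = 0 ∧ 0 < δ


def SeenClean (S : Set (ℝ × ℝ)) : Prop :=
 ∀ γ' δ' : ℝ, (γ', δ') ∈ S → ¬ OffLineZeroAt γ' δ'


def seenHeight (T₀ : ℝ) : Set (ℝ × ℝ) := {p | 0 < p.1 ∧ p.1 ≤ T₀}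


theorem seenClean_height_of_upTo {T₀ : ℝ} (h : RiemannHypothesisUpTo T₀) :
   SeenClean (seenHeight T₀) := by
 intro γ' δ' hS hz
 obtain ⟨hγ0, hγT⟩ := hS
 obtain ⟨hzero, hδ⟩ := hz
 have hre := h ⟨1 / 2 + δ', γ'⟩ hzero (by simpa using hγ0) (by simpa using hγT)
 simp at hre
 linarith


def seenOneLine : Set (ℝ × ℝ) := {p | 1 / 2 ≤ p.2}

theorem seenClean_oneLine : SeenClean seenOneLine := by
 intro γ' δ' hS hz
 obtain ⟨hzero, _⟩ := hz
 have h1 : (1 : ℝ) ≤ (⟨1 / 2 + δ', γ'⟩ : ℂ).re := by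
   show (1 : ℝ) ≤ 1 / 2 + δ'
   have : 1 / 2 ≤ δ' := hS
   linarith
 exact riemannZeta_ne_zero_of_one_le_re h1 hzero


theorem OffLineZeroAt.lt_half {γ δ : ℝ} (h : OffLineZeroAt γ δ) : δ < 1 / 2 := by
 by_contra hge
 exact seenClean_oneLine γ δ (show 1 / 2 ≤ δ from not_lt.1 hge) h


theorem allClean_of_height {T₀ : ℝ} (hH : RiemannHypothesisUpTo T₀) (h : SeenClean {p | T₀ < p.1}) :
   SeenClean {p | 0 < p.1} := by
 intro γ δ hγ hz
 rcases le_or_gt γ T₀ with hle | hgt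
 · exact seenClean_height_of_upTo hH γ δ ⟨hγ, hle⟩ hz
 · exact h γ δ hgt hz


theorem zero_conj {s : ℂ} (hs : riemannZeta s = 0) : riemannZeta (starRingEnd ℂ s) = 0 := by
 rw [riemannZeta_conj, hs, map_zero]


theorem zero_one_sub {s : ℂ} (hs : riemannZeta s = 0) (h0 : 0 < s.re) (h1 : s.re < 1) :
   riemannZeta (1 - s) = 0 := by
 have hn : ∀ n : ℕ, s ≠ -n := by
   intro n h
   have := congrArg Complex.re h
   simp at this
   have : (0 : ℝ) ≤ n := Nat.cast_nonneg n
   linarith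
 have h1' : s ≠ 1 := by
   intro h; rw [h] at h1; simp at h1
 rw [riemannZeta_one_sub hn h1', hs, mul_zero]




theorem rh_of_allClean (h : SeenClean {p | 0 < p.1}) : RiemannHypothesis := by
 refine riemannHypothesis_iff_strip_holds.2 fun s hs h0 h1 ↦ ?_

 have key : ∀ s : ℂ, riemannZeta s = 0 → 0 < s.re → s.re < 1 → 0 < s.im → s.re = 1 / 2 := by
   intro s hs h0 h1 him
   by_contra hne
   rcases lt_or_gt_of_ne hne with hlt | hgt
   ·
     have hz : riemannZeta ⟨1 / 2 + (1 / 2 - s.re), s.im⟩ = 0 := by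
       have h' := zero_conj (zero_one_sub hs h0 h1)
       have e : starRingEnd ℂ (1 - s) = ⟨1 / 2 + (1 / 2 - s.re), s.im⟩ := by
         apply Complex.ext
         · simp; ring
         · simp
       rwa [e] at h'
     exact h s.im (1 / 2 - s.re) him ⟨hz, by linarith⟩
   · have hz : riemannZeta ⟨1 / 2 + (s.re - 1 / 2), s.im⟩ = 0 := by
       have e : (⟨1 / 2 + (s.re - 1 / 2), s.im⟩ : ℂ) = s := by
         apply Complex.ext <;> simp
       rw [e]; exact hs
     exact h s.im (s.re - 1 / 2) him ⟨hz, by linarith⟩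
 have him : s.im ≠ 0 := im_ne_zero_of_riemannZeta_eq_zero hs h0 h1
 rcases lt_or_gt_of_ne him with hneg | hpos
 · have := key (starRingEnd ℂ s) (zero_conj hs) (by simpa using h0) (by simpa using h1)
     (by simpa using hneg)
   simpa using this
 · exact key s hs h0 h1 hpos



theorem seenClean_of_rh (hRH : RiemannHypothesis) (S : Set (ℝ × ℝ)) : SeenClean S := by
 intro γ δ _ hz
 have hlt : δ < 1 / 2 := hz.lt_half
 obtain ⟨hzero, hδ⟩ := hz
 have htriv : ¬∃ n : ℕ, (⟨1 / 2 + δ, γ⟩ : ℂ) = -2 * (n + 1) := by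
   rintro ⟨n, hn⟩
   have := congrArg Complex.re hn
   simp at this
   have : (0 : ℝ) ≤ n := Nat.cast_nonneg n
   linarith
 have hne : (⟨1 / 2 + δ, γ⟩ : ℂ) ≠ 1 := by
   intro h1
   have := congrArg Complex.re h1
   simp at this
   linarith
 have := hRH _ hzero htriv hne
 simp at this
 linarith

namespace C3


def verifiedHeight : ℝ := 3000175332800

end C3


theorem upTo_of_PT (h : platt_trudgian_numerical_rh) : RiemannHypothesisUpTo C3.verifiedHeight :=
 fun s hs h0 hT ↦ h s hs h0 hT


def xiDerivLine (m : ℕ) (t : ℝ) : ℝ := (iteratedDeriv m riemannXiUpper (t : ℂ)).re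



def WindowedLaguerreToDepth (E : ℕ → ℝ → Prop) (K : ℝ → ℕ) (T₀ : ℝ) : Prop :=
 ∀ t : ℝ, T₀ < t → ∀ m : ℕ, m ≤ K t → ¬ E m t




def LandingLawToDepth (E : ℕ → ℝ → Prop) (K : ℝ → ℕ) (T₀ T₁ : ℝ) : Prop :=
 ∀ γ δ : ℝ, T₁ < γ → OffLineZeroAt γ δ → ∃ t : ℝ, T₀ < t ∧ ∃ m : ℕ, m ≤ K t ∧ E m t



theorem rh_of_ladderSplit {E : ℕ → ℝ → Prop} {K : ℝ → ℕ} {T₀ T₁ T' : ℝ}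
   (hH : RiemannHypothesisUpTo T') (hT₁ : T₁ ≤ T')
   (hS : WindowedLaguerreToDepth E K T₀) (hD : LandingLawToDepth E K T₀ T₁) : RiemannHypothesis := by
 refine rh_of_allClean (allClean_of_height hH ?_)
 intro γ δ hTγ hz
 have hTγ' : T' < γ := hTγ
 obtain ⟨t, ht, m, hm, hE⟩ := hD γ δ (lt_of_le_of_lt hT₁ hTγ') hz
 exact hS t ht m hm hE


def xiNLEvent (k : ℕ) (x : ℝ) : Prop :=
 xiDerivLine (k + 1) x = 0 ∧ xiDerivLine k x ≠ 0 ∧ 0 ≤ xiDerivLine k x * xiDerivLine (k + 2) x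


def LandingLawOnBand (E : ℕ → ℝ → Prop) (K : ℝ → ℕ) (T₀ T₁ : ℝ) (P : ℝ → ℝ → Prop) : Prop :=
 ∀ γ δ : ℝ, T₁ < γ → OffLineZeroAt γ δ → P γ δ → ∃ t : ℝ, T₀ < t ∧ ∃ m : ℕ, m ≤ K t ∧ E m t

theorem LandingLawOnBand.mono_event {E E' : ℕ → ℝ → Prop} {K : ℝ → ℕ} {T₀ T₁ : ℝ} {P : ℝ → ℝ → Prop}
   (hEE : ∀ m t, E m t → E' m t) (h : LandingLawOnBand E K T₀ T₁ P) : LandingLawOnBand E' K T₀ T₁ P := by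
 intro γ δ hγ hz hP
 obtain ⟨t, ht, m, hm, hE⟩ := h γ δ hγ hz hP
 exact ⟨t, ht, m, hm, hEE m t hE⟩


def thinBandL (a : ℝ → ℝ) (γ δ : ℝ) : Prop := δ ≤ a γ
def middleBandL (a b : ℝ → ℝ) (γ δ : ℝ) : Prop := a γ < δ ∧ δ < b γ
def thickBandL (b : ℝ → ℝ) (γ δ : ℝ) : Prop := b γ ≤ δ



def thinEdge (cthin : ℝ) (γ : ℝ) : ℝ := cthin / Real.log γ ^ 2
def thickEdge (Cthick : ℝ) (γ : ℝ) : ℝ := Cthick * (2 * Real.pi / Real.log (γ / (2 * Real.pi)))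

def lowBandL (a l : ℝ → ℝ) (γ δ : ℝ) : Prop := a γ < δ ∧ δ ≤ l γ
def seamBandL (l b : ℝ → ℝ) (γ δ : ℝ) : Prop := l γ < δ ∧ δ < b γ

theorem bands4_cover (a l b : ℝ → ℝ) (γ δ : ℝ) :
   thinBandL a γ δ ∨ lowBandL a l γ δ ∨ seamBandL l b γ δ ∨ thickBandL b γ δ := by
 unfold thinBandL lowBandL seamBandL thickBandL
 rcases le_or_gt δ (a γ) with h | h
 · exact Or.inl h
 · rcases le_or_gt δ (l γ) with h' | h'
   · exact Or.inr (Or.inl ⟨h, h'⟩)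
   · rcases lt_or_ge δ (b γ) with h'' | h''
     · exact Or.inr (Or.inr (Or.inl ⟨h', h''⟩))
     · exact Or.inr (Or.inr (Or.inr h''))


theorem landingLawOnBand_of_empty {E : ℕ → ℝ → Prop} {K : ℝ → ℕ} {T₀ T₁ : ℝ} {P : ℝ → ℝ → Prop}
   (h : ∀ γ δ : ℝ, T₁ < γ → OffLineZeroAt γ δ → ¬ P γ δ) : LandingLawOnBand E K T₀ T₁ P :=
 fun γ δ hγ hz hP ↦ absurd hP (h γ δ hγ hz)


theorem rh_of_bandJoin4 {E E₁ E₂ E₃ E₄ : ℕ → ℝ → Prop} {K : ℝ → ℕ} {T₀ T₁ T' : ℝ} {a l b : ℝ → ℝ}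
   (hH : RiemannHypothesisUpTo T') (hT₁ : T₁ ≤ T') (hS : WindowedLaguerreToDepth E K T₀)
   (h₁ : LandingLawOnBand E₁ K T₀ T₁ (thinBandL a)) (h₂ : LandingLawOnBand E₂ K T₀ T₁ (lowBandL a l))
   (h₃ : LandingLawOnBand E₃ K T₀ T₁ (seamBandL l b)) (h₄ : LandingLawOnBand E₄ K T₀ T₁ (thickBandL b))
   (hE₁ : ∀ m t, E₁ m t → E m t) (hE₂ : ∀ m t, E₂ m t → E m t) (hE₃ : ∀ m t, E₃ m t → E m t)
   (hE₄ : ∀ m t, E₄ m t → E m t) : RiemannHypothesis := by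
 refine rh_of_ladderSplit hH hT₁ hS fun γ δ hγ hz ↦ ?_
 rcases bands4_cover a l b γ δ with hP | hP | hP | hP
 · exact (h₁.mono_event hE₁) γ δ hγ hz hP
 · exact (h₂.mono_event hE₂) γ δ hγ hz hP
 · exact (h₃.mono_event hE₃) γ δ hγ hz hP
 · exact (h₄.mono_event hE₄) γ δ hγ hz hP


def SeamClosed (c C T₁ : ℝ) : Prop := ∀ γ : ℝ, T₁ < γ → thickEdge C γ ≤ thickEdge c γ

theorem seamClosed_of_le {c C T₁ : ℝ} (hcC : C ≤ c) (hT₁ : 2 * Real.pi ≤ T₁) : SeamClosed c C T₁ := by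
 intro γ hγ
 unfold thickEdge
 have h2pi : 0 < 2 * Real.pi := by positivity
 have hlog : 0 < Real.log (γ / (2 * Real.pi)) :=
   Real.log_pos ((one_lt_div h2pi).2 (lt_of_le_of_lt hT₁ hγ))
 exact mul_le_mul_of_nonneg_right hcC (div_nonneg h2pi.le hlog.le)

theorem seam_empty_of_closed {c C T₁ : ℝ} (h : SeamClosed c C T₁) (γ δ : ℝ) (hγ : T₁ < γ) :
   ¬ seamBandL (thickEdge c) (thickEdge C) γ δ := by
 rintro ⟨h1, h2⟩
 exact absurd (h1.trans h2) (not_lt.2 (h γ hγ))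


def xiNLEventLow (m : ℕ) (x : ℝ) : Prop := m ≤ 1 ∧ xiNLEvent m x


def NLEventOf (f : ℂ → ℂ) (k : ℕ) (x : ℝ) : Prop :=
 (iteratedDeriv (k + 1) f (x : ℂ)).re = 0 ∧ (iteratedDeriv k f (x : ℂ)).re ≠ 0 ∧
   0 ≤ (iteratedDeriv k f (x : ℂ)).re * (iteratedDeriv (k + 2) f (x : ℂ)).re

theorem nlEventOf_xi_iff (k : ℕ) (x : ℝ) : NLEventOf riemannXiUpper k x ↔ xiNLEvent k x := Iff.rfl


def EventConcl (C : ℝ) (f : ℂ → ℂ) (x₀ s hmax R : ℝ) (B : ℕ) : Prop :=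
 ∃ k : ℕ, (k : ℝ) ≤ C * hmax / s + B + 1 ∧ ∃ x : ℝ, |x - x₀| < R / 2 + Real.sqrt k * hmax ∧ NLEventOf f k x




def RemainderBox (η : ℝ) (f : ℂ → ℂ) (x₀ s hmax R : ℝ) : Prop :=
 ∀ w : ℂ, |w.re - x₀| ≤ R / 2 → |w.im| ≤ hmax → f w ≠ 0 →
   ‖deriv f w / f w
       - ∑ᶠ u ∈ {u : ℂ | f u = 0 ∧ |u.re - w.re| < R / 2}, ((analyticOrderAt f u).toNat : ℂ) * (w - u)⁻¹‖ ≤ η / s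



def ColumnBudgetMult (B : ℕ) (f : ℂ → ℂ) (x₀ s R : ℝ) : Prop :=
 ∀ r : ℝ, s ≤ r → r ≤ R →
   (∑ᶠ u ∈ {u : ℂ | f u = 0 ∧ |u.re - x₀| ≤ r}, ((analyticOrderAt f u).toNat : ℝ)) - 2 * r / s ≤ B



def HalfSlabBudget (B : ℕ) (f : ℂ → ℂ) (x₀ s R : ℝ) : Prop :=
 ∀ r : ℝ, s ≤ r → r ≤ R →
   |(∑ᶠ u ∈ {u : ℂ | f u = 0 ∧ x₀ < u.re ∧ u.re ≤ x₀ + r}, ((analyticOrderAt f u).toNat : ℝ)) - r / s| ≤ 1 + B ∧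
   |(∑ᶠ u ∈ {u : ℂ | f u = 0 ∧ x₀ - r ≤ u.re ∧ u.re < x₀}, ((analyticOrderAt f u).toNat : ℝ)) - r / s| ≤ 1 + B





def TiltedLandingEventAt3 (A C η : ℝ) (f : ℂ → ℂ) (x₀ s hmax R Hs : ℝ) (B : ℕ) : Prop :=
 Differentiable ℂ f → (∀ x : ℝ, (f (x : ℂ)).im = 0) →
   (∃ A' B' ρ : ℝ, ρ < 2 ∧ ∀ z : ℂ, ‖f z‖ ≤ A' * Real.exp (B' * ‖z‖ ^ ρ)) →
   0 < s → C * s ≤ hmax → C * hmax ≤ R → 0 ≤ Hs → (∀ w : ℂ, f w = 0 → |w.im| ≤ Hs) → C * Hs ≤ R →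
   (∃ w₀ : ℂ, f w₀ = 0 ∧ w₀.im ≠ 0 ∧ w₀.re = x₀ ∧ |w₀.im| ≤ hmax) →
   ColumnBudgetMult B f x₀ s R →
   0 ≤ η → C * η ≤ 1 → RemainderBox η f x₀ s hmax R →
   EventConcl A f x₀ s hmax R B


def TiltedLandingEvent3 : Prop :=
 ∃ A C : ℝ, 0 < A ∧ 0 < C ∧ ∀ (η : ℝ) (f : ℂ → ℂ) (x₀ s hmax R Hs : ℝ) (B : ℕ), TiltedLandingEventAt3 A C η f x₀ s hmax R Hs B




def XiEventFeed3 (Band : ℝ → ℝ → Prop) (K : ℝ → ℕ) (T₀ T₁ : ℝ) : Prop :=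
 ∀ A C : ℝ, 0 < A → 0 < C → ∀ γ δ : ℝ, T₁ < γ → OffLineZeroAt γ δ → Band γ δ →
   ∃ (η s hmax R Hs : ℝ) (B : ℕ),
     (TiltedLandingEventAt3 A C η riemannXiUpper γ s hmax R Hs B → EventConcl A riemannXiUpper γ s hmax R B) ∧
     (∀ (k : ℕ) (x : ℝ), (k : ℝ) ≤ A * hmax / s + B + 1 → |x - γ| < R / 2 + Real.sqrt k * hmax → T₀ < x ∧ k ≤ K x)


theorem landingLawOnBand_of_event3 {Band : ℝ → ℝ → Prop} {K : ℝ → ℕ} {T₀ T₁ : ℝ}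
   (hE : TiltedLandingEvent3) (hfeed : XiEventFeed3 Band K T₀ T₁) : LandingLawOnBand xiNLEvent K T₀ T₁ Band := by
 obtain ⟨A, C, hA, hC, H⟩ := hE
 intro γ δ hγ hz hband
 obtain ⟨η, s, hmax, R, Hs, B, hmet, hbk⟩ := hfeed A C hA hC γ δ hγ hz hband
 obtain ⟨k, hk, x, hx, hev⟩ := hmet (H η riemannXiUpper γ s hmax R Hs B)
 exact ⟨x, (hbk k x hk hx).1, k, (hbk k x hk hx).2, (nlEventOf_xi_iff k x).1 hev⟩



def TiltedLandingEventAt4 (A C η : ℝ) (f : ℂ → ℂ) (x₀ s hmax R Hs : ℝ) (B : ℕ) : Prop :=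
 Differentiable ℂ f → (∀ x : ℝ, (f (x : ℂ)).im = 0) →
   (∃ A' B' ρ : ℝ, ρ < 2 ∧ ∀ z : ℂ, ‖f z‖ ≤ A' * Real.exp (B' * ‖z‖ ^ ρ)) →
   0 < s → C * s ≤ hmax → C * hmax ≤ R → 0 ≤ Hs → (∀ w : ℂ, f w = 0 → |w.im| ≤ Hs) → C * Hs ≤ R →
   (∃ w₀ : ℂ, f w₀ = 0 ∧ w₀.im ≠ 0 ∧ w₀.re = x₀ ∧ |w₀.im| ≤ hmax) →
   ColumnBudgetMult B f x₀ s R → HalfSlabBudget B f x₀ s R →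
   0 ≤ η → C * η ≤ 1 → RemainderBox η f x₀ s hmax R →
   EventConcl A f x₀ s hmax R B


def TiltedLandingEvent4 : Prop :=
 ∃ A C : ℝ, 0 < A ∧ 0 < C ∧ ∀ (η : ℝ) (f : ℂ → ℂ) (x₀ s hmax R Hs : ℝ) (B : ℕ), TiltedLandingEventAt4 A C η f x₀ s hmax R Hs B


theorem tiltedLandingEvent4_of_event3 (h : TiltedLandingEvent3) : TiltedLandingEvent4 := by
 obtain ⟨A, C, hA, hC, H⟩ := h
 exact ⟨A, C, hA, hC, fun η f x₀ s hmax R Hs B hd hr ho hs h1 h2 h3 h4 h5 h6 hB _ hη hCη hRB ↦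
   H η f x₀ s hmax R Hs B hd hr ho hs h1 h2 h3 h4 h5 h6 hB hη hCη hRB⟩





def ThinBandLaw (Ethin : ℕ → ℝ → Prop) (K : ℝ → ℕ) (T₀ T₁ cthin : ℝ) : Prop :=
 LandingLawOnBand Ethin K T₀ T₁ (thinBandL (thinEdge cthin))


def LowPairLaw (K : ℝ → ℕ) (T₀ T₁ cthin c : ℝ) : Prop :=
 LandingLawOnBand xiNLEventLow K T₀ T₁ (lowBandL (thinEdge cthin) (thickEdge c))


def xiSpacing (γ : ℝ) : ℝ := 2 * Real.pi / Real.log (γ / (2 * Real.pi))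



def Remainder0Xi (η : ℝ) (R : ℝ → ℝ) (T₁ : ℝ) : Prop :=
 ∀ γ : ℝ, T₁ < γ → RemainderBox η riemannXiUpper γ (xiSpacing γ) (1 / 2) (R γ)



def XiColumnBudget (B : ℕ) (R : ℝ → ℝ) (T₁ : ℝ) : Prop :=
 ∀ γ : ℝ, T₁ < γ → ColumnBudgetMult B riemannXiUpper γ (xiSpacing γ) (R γ)




def XiFeedGlue (A C η : ℝ) (B : ℕ) (K : ℝ → ℕ) (T₀ T₁ : ℝ) (R : ℝ → ℝ) : Prop :=
 EarlyAppointments.XiInLogCombClass → Remainder0Xi η R T₁ → XiColumnBudget B R T₁ →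
   XiEventFeed3 (thickBandL (thickEdge C)) K T₀ T₁







theorem closes_v3 {K : ℝ → ℕ} {T₀ T₁ cthin c C A η : ℝ} {B : ℕ} {R : ℝ → ℝ} {Ethin : ℕ → ℝ → Prop}
   (hH : HardyZLehmerSplit.HeightPT) (hT₁ : T₁ ≤ C3.verifiedHeight) (hcC : C ≤ c) (h2π : 2 * Real.pi ≤ T₁)
   (hRes : WindowedLaguerreToDepth xiNLEvent K T₀)
   (hThin : ThinBandLaw Ethin K T₀ T₁ cthin) (hEthin : ∀ m t, Ethin m t → xiNLEvent m t)
   (hLow : LowPairLaw K T₀ T₁ cthin c)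
   (hLaw : TiltedLandingEvent3)
   (hXi : EarlyAppointments.XiInLogCombClass)
   (hρ2 : Remainder0Xi η R T₁) (hBud : XiColumnBudget B R T₁)
   (hGlue : XiFeedGlue A C η B K T₀ T₁ R) : RiemannHypothesis :=
 rh_of_bandJoin4 (E := xiNLEvent) (upTo_of_PT hH) hT₁ hRes hThin hLow
   (landingLawOnBand_of_empty (E := xiNLEvent) fun γ δ hγ _ ↦ seam_empty_of_closed (seamClosed_of_le hcC h2π) γ δ hγ)
   (landingLawOnBand_of_event3 hLaw (hGlue hXi hρ2 hBud))
   hEthin (fun _ _ h ↦ h.2) (fun _ _ (h : xiNLEvent _ _) ↦ h) (fun _ _ h ↦ h)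


theorem bandLaw_of_rh (hRH : RiemannHypothesis) (E : ℕ → ℝ → Prop) (K : ℝ → ℕ) (T₀ T₁ : ℝ) (P : ℝ → ℝ → Prop) :
   LandingLawOnBand E K T₀ T₁ P :=
 fun γ δ _ hz _ ↦ absurd hz (seenClean_of_rh hRH Set.univ γ δ (Set.mem_univ _))

theorem thinBandLaw_of_rh (hRH : RiemannHypothesis) (Ethin : ℕ → ℝ → Prop) (K : ℝ → ℕ) (T₀ T₁ cthin : ℝ) :
   ThinBandLaw Ethin K T₀ T₁ cthin := bandLaw_of_rh hRH _ K T₀ T₁ _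

theorem lowPairLaw_of_rh (hRH : RiemannHypothesis) (K : ℝ → ℕ) (T₀ T₁ cthin c : ℝ) : LowPairLaw K T₀ T₁ cthin c :=
 bandLaw_of_rh hRH _ K T₀ T₁ _

theorem xiFeedGlue_of_rh (hRH : RiemannHypothesis) (A C η : ℝ) (B : ℕ) (K : ℝ → ℕ) (T₀ T₁ : ℝ) (R : ℝ → ℝ) :
   XiFeedGlue A C η B K T₀ T₁ R :=
 fun _ _ _ _ _ _ _ γ δ _ hz _ ↦ absurd hz (seenClean_of_rh hRH Set.univ γ δ (Set.mem_univ _))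



namespace Annex



def ExplicitDerivativeZeroCountingXi : Prop :=
 ∃ A₀ A₁ T₀ : ℝ, ∀ (k : ℕ) (T H : ℝ), T₀ ≤ T → 1 ≤ H → H ≤ T →
   |(∑ᶠ u ∈ {u : ℂ | iteratedDeriv k riemannXiUpper u = 0 ∧ T < u.re ∧ u.re ≤ T + H},
       ((analyticOrderAt (iteratedDeriv k riemannXiUpper) u).toNat : ℝ)) - H / (2 * Real.pi) * Real.log (T / (2 * Real.pi))|
     ≤ (A₀ + A₁ * k) * Real.log T


def nonRealCount (g : ℂ → ℂ) (x₀ r : ℝ) : ℝ :=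
 ∑ᶠ u ∈ {u : ℂ | g u = 0 ∧ u.im ≠ 0 ∧ |u.re - x₀| ≤ r}, ((analyticOrderAt g u).toNat : ℝ)




def CountDropCertificate : Prop :=
 ∀ (f : ℂ → ℂ) (x₀ r hmax Hs : ℝ), Differentiable ℂ f → (∀ x : ℝ, (f (x : ℂ)).im = 0) →
   (∃ A' B' ρ : ℝ, ρ < 2 ∧ ∀ z : ℂ, ‖f z‖ ≤ A' * Real.exp (B' * ‖z‖ ^ ρ)) →
   (∀ w : ℂ, f w = 0 → |w.im| ≤ Hs) → 0 ≤ hmax → Hs ≤ hmax →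
   nonRealCount (deriv f) x₀ r ≤ nonRealCount f x₀ (r + hmax)



def LevelKDriftXi (η : ℝ) (R : ℝ → ℝ) (K : ℝ → ℕ) (T₁ : ℝ) : Prop :=
 ∀ γ : ℝ, T₁ < γ → ∀ k : ℕ, k ≤ K γ → RemainderBox η (iteratedDeriv k riemannXiUpper) γ (xiSpacing γ) (1 / 2) (R γ)

end Annex









def XiHalfSlabBudget (B : ℕ) (R : ℝ → ℝ) (T₁ : ℝ) : Prop :=
 ∀ γ : ℝ, T₁ < γ → HalfSlabBudget B riemannXiUpper γ (xiSpacing γ) (R γ)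


def XiFeedGlue4 (A C η : ℝ) (B : ℕ) (K : ℝ → ℕ) (T₀ T₁ : ℝ) (R : ℝ → ℝ) : Prop :=
 EarlyAppointments.XiInLogCombClass → Remainder0Xi η R T₁ → XiColumnBudget B R T₁ → XiHalfSlabBudget B R T₁ →
   ∀ A' C' : ℝ, 0 < A' → 0 < C' → ∀ γ δ : ℝ, T₁ < γ → OffLineZeroAt γ δ → thickBandL (thickEdge C) γ δ →
     ∃ (η' s hmax R' Hs : ℝ) (B' : ℕ),
       (TiltedLandingEventAt4 A' C' η' riemannXiUpper γ s hmax R' Hs B' → EventConcl A' riemannXiUpper γ s hmax R' B') ∧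
       (∀ (k : ℕ) (x : ℝ), (k : ℝ) ≤ A' * hmax / s + B' + 1 → |x - γ| < R' / 2 + Real.sqrt k * hmax → T₀ < x ∧ k ≤ K x)

theorem closes_v3_sibling {K : ℝ → ℕ} {T₀ T₁ cthin c C A η : ℝ} {B : ℕ} {R : ℝ → ℝ} {Ethin : ℕ → ℝ → Prop}
   (hH : HardyZLehmerSplit.HeightPT) (hT₁ : T₁ ≤ C3.verifiedHeight) (hcC : C ≤ c) (h2π : 2 * Real.pi ≤ T₁)
   (hRes : WindowedLaguerreToDepth xiNLEvent K T₀)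
   (hThin : ThinBandLaw Ethin K T₀ T₁ cthin) (hEthin : ∀ m t, Ethin m t → xiNLEvent m t)
   (hLow : LowPairLaw K T₀ T₁ cthin c)
   (hLaw : TiltedLandingEvent4)
   (hXi : EarlyAppointments.XiInLogCombClass)
   (hρ2 : Remainder0Xi η R T₁) (hBud : XiColumnBudget B R T₁) (hHalf : XiHalfSlabBudget B R T₁)
   (hGlue : XiFeedGlue4 A C η B K T₀ T₁ R) : RiemannHypothesis := by
 refine rh_of_bandJoin4 (E := xiNLEvent) (upTo_of_PT hH) hT₁ hRes hThin hLow
   (landingLawOnBand_of_empty (E := xiNLEvent) fun γ δ hγ _ ↦ seam_empty_of_closed (seamClosed_of_le hcC h2π) γ δ hγ)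
   ?_ hEthin (fun _ _ h ↦ h.2) (fun _ _ (h : xiNLEvent _ _) ↦ h) (fun _ _ h ↦ h)
 obtain ⟨A', C', hA', hC', H⟩ := hLaw
 intro γ δ hγ hz hband
 obtain ⟨η', s, hmax, R', Hs, B', hmet, hbk⟩ := hGlue hXi hρ2 hBud hHalf A' C' hA' hC' γ δ hγ hz hband
 obtain ⟨k, hk, x, hx, hev⟩ := hmet (H η' riemannXiUpper γ s hmax R' Hs B')
 exact ⟨x, (hbk k x hk hx).1, k, (hbk k x hk hx).2, (nlEventOf_xi_iff k x).1 hev⟩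

end RhIdea6.G17.W07C7

end











namespace RhIdea6.G17.W07C7.Rev2

open Literature.NumberTheory.LFunctions Literature.NumberTheory.DiophantineGeometry
open Summit.RiemannHypothesis.RiemannHypothesis.Theses


def WindowedSignPatternAllBands (Ethin : ℕ → ℝ → Prop) (K : ℝ → ℕ) (T₀ T₁ cthin c : ℝ) : Prop :=
 ThinBandLaw Ethin K T₀ T₁ cthin ∧ LowPairLaw K T₀ T₁ cthin c ∧ WindowedLaguerreToDepth xiNLEvent K T₀


def XiColumnBudget (B : ℝ → ℕ) (R : ℝ → ℝ) (T₁ : ℝ) : Prop :=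
 ∀ γ : ℝ, T₁ < γ → ColumnBudgetMult (B γ) riemannXiUpper γ (xiSpacing γ) (R γ)


def XiHalfSlabBudget (B : ℝ → ℕ) (R : ℝ → ℝ) (T₁ : ℝ) : Prop :=
 ∀ γ : ℝ, T₁ < γ → HalfSlabBudget (B γ) riemannXiUpper γ (xiSpacing γ) (R γ)


def XiLevel0Inputs (B : ℝ → ℕ) (R : ℝ → ℝ) (T₁ : ℝ) : Prop :=
 EarlyAppointments.XiInLogCombClass ∧ XiColumnBudget B R T₁


def XiLevel0Inputs4 (B : ℝ → ℕ) (R : ℝ → ℝ) (T₁ : ℝ) : Prop :=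
 EarlyAppointments.XiInLogCombClass ∧ XiColumnBudget B R T₁ ∧ XiHalfSlabBudget B R T₁


def XiFeedGlue (A C η : ℝ) (B : ℝ → ℕ) (K : ℝ → ℕ) (T₀ T₁ : ℝ) (R : ℝ → ℝ) : Prop :=
 XiLevel0Inputs B R T₁ → Remainder0Xi η R T₁ → XiEventFeed3 (thickBandL (thickEdge C)) K T₀ T₁


def XiFeedGlue4 (A C η : ℝ) (B : ℝ → ℕ) (K : ℝ → ℕ) (T₀ T₁ : ℝ) (R : ℝ → ℝ) : Prop :=
 XiLevel0Inputs4 B R T₁ → Remainder0Xi η R T₁ →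
   ∀ A' C' : ℝ, 0 < A' → 0 < C' → ∀ γ δ : ℝ, T₁ < γ → OffLineZeroAt γ δ → thickBandL (thickEdge C) γ δ →
     ∃ (η' s hmax R' Hs : ℝ) (B' : ℕ),
       (TiltedLandingEventAt4 A' C' η' riemannXiUpper γ s hmax R' Hs B' → EventConcl A' riemannXiUpper γ s hmax R' B') ∧
       (∀ (k : ℕ) (x : ℝ), (k : ℝ) ≤ A' * hmax / s + B' + 1 → |x - γ| < R' / 2 + Real.sqrt k * hmax → T₀ < x ∧ k ≤ K x)


theorem closes_v4 {K : ℝ → ℕ} {T₀ T₁ cthin c C A η : ℝ} {B : ℝ → ℕ} {R : ℝ → ℝ} {Ethin : ℕ → ℝ → Prop}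
   (hH : HardyZLehmerSplit.HeightPT) (hT₁ : T₁ ≤ C3.verifiedHeight) (hcC : C ≤ c) (h2π : 2 * Real.pi ≤ T₁)
   (hEthin : ∀ m t, Ethin m t → xiNLEvent m t)
   (hRes : WindowedSignPatternAllBands Ethin K T₀ T₁ cthin c)
   (hLaw : TiltedLandingEvent3) (hρ2 : Remainder0Xi η R T₁) (hIn : XiLevel0Inputs B R T₁)
   (hGlue : XiFeedGlue A C η B K T₀ T₁ R) : RiemannHypothesis :=
 rh_of_bandJoin4 (E := xiNLEvent) (upTo_of_PT hH) hT₁ hRes.2.2 hRes.1 hRes.2.1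
   (landingLawOnBand_of_empty (E := xiNLEvent) fun γ δ hγ _ ↦ seam_empty_of_closed (seamClosed_of_le hcC h2π) γ δ hγ)
   (landingLawOnBand_of_event3 hLaw (hGlue hIn hρ2))
   hEthin (fun _ _ h ↦ h.2) (fun _ _ (h : xiNLEvent _ _) ↦ h) (fun _ _ h ↦ h)


theorem closes_v4_sibling {K : ℝ → ℕ} {T₀ T₁ cthin c C A η : ℝ} {B : ℝ → ℕ} {R : ℝ → ℝ} {Ethin : ℕ → ℝ → Prop}
   (hH : HardyZLehmerSplit.HeightPT) (hT₁ : T₁ ≤ C3.verifiedHeight) (hcC : C ≤ c) (h2π : 2 * Real.pi ≤ T₁)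
   (hEthin : ∀ m t, Ethin m t → xiNLEvent m t)
   (hRes : WindowedSignPatternAllBands Ethin K T₀ T₁ cthin c)
   (hLaw : TiltedLandingEvent4) (hρ2 : Remainder0Xi η R T₁) (hIn : XiLevel0Inputs4 B R T₁)
   (hGlue : XiFeedGlue4 A C η B K T₀ T₁ R) : RiemannHypothesis := by
 refine rh_of_bandJoin4 (E := xiNLEvent) (upTo_of_PT hH) hT₁ hRes.2.2 hRes.1 hRes.2.1
   (landingLawOnBand_of_empty (E := xiNLEvent) fun γ δ hγ _ ↦ seam_empty_of_closed (seamClosed_of_le hcC h2π) γ δ hγ)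
   ?_ hEthin (fun _ _ h ↦ h.2) (fun _ _ (h : xiNLEvent _ _) ↦ h) (fun _ _ h ↦ h)
 obtain ⟨A', C', hA', hC', H⟩ := hLaw
 intro γ δ hγ hz hband
 obtain ⟨η', s, hmax, R', Hs, B', hmet, hbk⟩ := hGlue hIn hρ2 A' C' hA' hC' γ δ hγ hz hband
 obtain ⟨k, hk, x, hx, hev⟩ := hmet (H η' riemannXiUpper γ s hmax R' Hs B')
 exact ⟨x, (hbk k x hk hx).1, k, (hbk k x hk hx).2, (nlEventOf_xi_iff k x).1 hev⟩


theorem windowedSignPatternAllBands_of_rh_of_rows (hRH : RiemannHypothesis) {Ethin : ℕ → ℝ → Prop} {K : ℝ → ℕ} {T₀ T₁ cthin c : ℝ}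
   (hRows : WindowedLaguerreToDepth xiNLEvent K T₀) : WindowedSignPatternAllBands Ethin K T₀ T₁ cthin c :=
 ⟨thinBandLaw_of_rh hRH Ethin K T₀ T₁ cthin, lowPairLaw_of_rh hRH K T₀ T₁ cthin c, hRows⟩

theorem xiFeedGlue_of_rh (hRH : RiemannHypothesis) (A C η : ℝ) (B : ℝ → ℕ) (K : ℝ → ℕ) (T₀ T₁ : ℝ) (R : ℝ → ℝ) :
   XiFeedGlue A C η B K T₀ T₁ R :=
 fun _ _ _ _ _ _ γ δ _ hz _ ↦ absurd hz (seenClean_of_rh hRH Set.univ γ δ (Set.mem_univ _))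

theorem xiFeedGlue4_of_rh (hRH : RiemannHypothesis) (A C η : ℝ) (B : ℝ → ℕ) (K : ℝ → ℕ) (T₀ T₁ : ℝ) (R : ℝ → ℝ) :
   XiFeedGlue4 A C η B K T₀ T₁ R :=
 fun _ _ _ _ _ _ γ δ _ hz _ ↦ absurd hz (seenClean_of_rh hRH Set.univ γ δ (Set.mem_univ _))

end RhIdea6.G17.W07C7.Rev2











namespace RhIdea6.G17.W07C7.Rev3

open Literature.NumberTheory.LFunctions Literature.NumberTheory.DiophantineGeometry
open Summit.RiemannHypothesis.RiemannHypothesis.Theses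
open RhIdea6.G17.W07C7.Rev2 (WindowedSignPatternAllBands XiColumnBudget XiHalfSlabBudget XiLevel0Inputs4
 windowedSignPatternAllBands_of_rh_of_rows)


def EngineHyps4 (C η : ℝ) (f : ℂ → ℂ) (x₀ s hmax R Hs : ℝ) (B : ℕ) : Prop :=
 Differentiable ℂ f ∧ (∀ x : ℝ, (f (x : ℂ)).im = 0) ∧
   (∃ A' B' ρ : ℝ, ρ < 2 ∧ ∀ z : ℂ, ‖f z‖ ≤ A' * Real.exp (B' * ‖z‖ ^ ρ)) ∧
   0 < s ∧ C * s ≤ hmax ∧ C * hmax ≤ R ∧ 0 ≤ Hs ∧ (∀ w : ℂ, f w = 0 → |w.im| ≤ Hs) ∧ C * Hs ≤ R ∧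
   (∃ w₀ : ℂ, f w₀ = 0 ∧ w₀.im ≠ 0 ∧ w₀.re = x₀ ∧ |w₀.im| ≤ hmax) ∧
   ColumnBudgetMult B f x₀ s R ∧ HalfSlabBudget B f x₀ s R ∧
   0 ≤ η ∧ C * η ≤ 1 ∧ RemainderBox η f x₀ s hmax R




def TiltedLandingLaw4 (A₀ C₀ : ℝ) : Prop :=
 ∀ (η : ℝ) (f : ℂ → ℂ) (x₀ s hmax R Hs : ℝ) (B : ℕ), TiltedLandingEventAt4 A₀ C₀ η f x₀ s hmax R Hs B

theorem tiltedLandingEvent4_iff : TiltedLandingEvent4 ↔ ∃ A₀ C₀ : ℝ, 0 < A₀ ∧ 0 < C₀ ∧ TiltedLandingLaw4 A₀ C₀ := Iff.rfl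


theorem eventConcl_of_law {A₀ C₀ η : ℝ} {f : ℂ → ℂ} {x₀ s hmax R Hs : ℝ} {B : ℕ} (hLaw : TiltedLandingLaw4 A₀ C₀)
   (h : EngineHyps4 C₀ η f x₀ s hmax R Hs B) : EventConcl A₀ f x₀ s hmax R B :=
 hLaw η f x₀ s hmax R Hs B h.1 h.2.1 h.2.2.1 h.2.2.2.1 h.2.2.2.2.1 h.2.2.2.2.2.1 h.2.2.2.2.2.2.1 h.2.2.2.2.2.2.2.1
   h.2.2.2.2.2.2.2.2.1 h.2.2.2.2.2.2.2.2.2.1 h.2.2.2.2.2.2.2.2.2.2.1 h.2.2.2.2.2.2.2.2.2.2.2.1 h.2.2.2.2.2.2.2.2.2.2.2.2.1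
   h.2.2.2.2.2.2.2.2.2.2.2.2.2.1 h.2.2.2.2.2.2.2.2.2.2.2.2.2.2



def XiThickColumnData (A₀ C₀ : ℝ) (K : ℝ → ℕ) (T₀ T₁ : ℝ) : Prop :=
 ∀ γ δ : ℝ, T₁ < γ → OffLineZeroAt γ δ → thickBandL (thickEdge C₀) γ δ →
   ∃ (η s hmax R Hs : ℝ) (B : ℕ), EngineHyps4 C₀ η riemannXiUpper γ s hmax R Hs B ∧
     (∀ (k : ℕ) (x : ℝ), (k : ℝ) ≤ A₀ * hmax / s + B + 1 → |x - γ| < R / 2 + Real.sqrt k * hmax → T₀ < x ∧ k ≤ K x)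




def XiFeedGlue (A₀ C₀ η : ℝ) (B : ℝ → ℕ) (K : ℝ → ℕ) (T₀ T₁ : ℝ) (R : ℝ → ℝ) : Prop :=
 XiLevel0Inputs4 B R T₁ → Remainder0Xi η R T₁ → XiThickColumnData A₀ C₀ K T₀ T₁


theorem landingLawOnBand_of_law_data {A₀ C₀ : ℝ} {K : ℝ → ℕ} {T₀ T₁ : ℝ} (hLaw : TiltedLandingLaw4 A₀ C₀)
   (hD : XiThickColumnData A₀ C₀ K T₀ T₁) : LandingLawOnBand xiNLEvent K T₀ T₁ (thickBandL (thickEdge C₀)) := by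
 intro γ δ hγ hz hband
 obtain ⟨η, s, hmax, R, Hs, B, hE, hbk⟩ := hD γ δ hγ hz hband
 obtain ⟨k, hk, x, hx, hev⟩ := eventConcl_of_law hLaw hE
 exact ⟨x, (hbk k x hk hx).1, k, (hbk k x hk hx).2, (nlEventOf_xi_iff k x).1 hev⟩



theorem closes_v5 {K : ℝ → ℕ} {T₀ T₁ cthin c A₀ C₀ η : ℝ} {B : ℝ → ℕ} {R : ℝ → ℝ} {Ethin : ℕ → ℝ → Prop}
   (hH : HardyZLehmerSplit.HeightPT) (hT₁ : T₁ ≤ C3.verifiedHeight) (hcC : C₀ ≤ c) (h2π : 2 * Real.pi ≤ T₁)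
   (hEthin : ∀ m t, Ethin m t → xiNLEvent m t)
   (hRes : WindowedSignPatternAllBands Ethin K T₀ T₁ cthin c)
   (hLaw : TiltedLandingLaw4 A₀ C₀) (hρ2 : Remainder0Xi η R T₁) (hIn : XiLevel0Inputs4 B R T₁)
   (hGlue : XiFeedGlue A₀ C₀ η B K T₀ T₁ R) : RiemannHypothesis :=
 rh_of_bandJoin4 (E := xiNLEvent) (upTo_of_PT hH) hT₁ hRes.2.2 hRes.1 hRes.2.1
   (landingLawOnBand_of_empty (E := xiNLEvent) fun γ δ hγ _ ↦ seam_empty_of_closed (seamClosed_of_le hcC h2π) γ δ hγ)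
   (landingLawOnBand_of_law_data hLaw (hGlue hIn hρ2))
   hEthin (fun _ _ h ↦ h.2) (fun _ _ (h : xiNLEvent _ _) ↦ h) (fun _ _ h ↦ h)


def TiltedLandingLaw44 : Prop := TiltedLandingLaw4 4 4

theorem closes_v5_44 {K : ℝ → ℕ} {T₀ T₁ cthin c η : ℝ} {B : ℝ → ℕ} {R : ℝ → ℝ} {Ethin : ℕ → ℝ → Prop}
   (hH : HardyZLehmerSplit.HeightPT) (hT₁ : T₁ ≤ C3.verifiedHeight) (hc : 4 ≤ c) (h2π : 2 * Real.pi ≤ T₁)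
   (hEthin : ∀ m t, Ethin m t → xiNLEvent m t)
   (hRes : WindowedSignPatternAllBands Ethin K T₀ T₁ cthin c)
   (hLaw : TiltedLandingLaw44) (hρ2 : Remainder0Xi η R T₁) (hIn : XiLevel0Inputs4 B R T₁)
   (hGlue : XiFeedGlue 4 4 η B K T₀ T₁ R) : RiemannHypothesis :=
 closes_v5 hH hT₁ hc h2π hEthin hRes hLaw hρ2 hIn hGlue


theorem xiThickColumnData_of_rh (hRH : RiemannHypothesis) (A₀ C₀ : ℝ) (K : ℝ → ℕ) (T₀ T₁ : ℝ) : XiThickColumnData A₀ C₀ K T₀ T₁ :=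
 fun γ δ _ hz _ ↦ absurd hz (seenClean_of_rh hRH Set.univ γ δ (Set.mem_univ _))

theorem xiFeedGlue_of_rh (hRH : RiemannHypothesis) (A₀ C₀ η : ℝ) (B : ℝ → ℕ) (K : ℝ → ℕ) (T₀ T₁ : ℝ) (R : ℝ → ℝ) :
   XiFeedGlue A₀ C₀ η B K T₀ T₁ R :=
 fun _ _ ↦ xiThickColumnData_of_rh hRH A₀ C₀ K T₀ T₁

end RhIdea6.G17.W07C7.Rev3



namespace RhIdea6.G17.W07C7.Rev3

open Literature.NumberTheory.LFunctions Literature.NumberTheory.DiophantineGeometry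
open Summit.RiemannHypothesis.RiemannHypothesis.Theses




theorem thickLaw_of_feed3_alone {Band : ℝ → ℝ → Prop} {K : ℝ → ℕ} {T₀ T₁ : ℝ} (hfeed : XiEventFeed3 Band K T₀ T₁) :
   LandingLawOnBand xiNLEvent K T₀ T₁ Band := by
 intro γ δ hγ hz hband
 have hK0 : (0 : ℝ) ≤ (K γ : ℝ) := Nat.cast_nonneg _
 have hNpos : (0 : ℝ) < (K γ : ℝ) + 2 := by linarith
 obtain ⟨η, s, hmax, R, Hs, B, hmet, hbk⟩ := hfeed ((K γ : ℝ) + 2) ((K γ : ℝ) + 2) hNpos hNpos γ δ hγ hz hband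
 have key : 0 < s → ((K γ : ℝ) + 2) * s ≤ hmax → ((K γ : ℝ) + 2) * hmax ≤ R → False := by
   intro hs h1 h2
   have hmaxpos : 0 < hmax := lt_of_lt_of_le (mul_pos hNpos hs) h1
   have hR : 0 < R := lt_of_lt_of_le (mul_pos hNpos hmaxpos) h2
   have hB : (0 : ℝ) ≤ (B : ℝ) := Nat.cast_nonneg _
   have hKs : (K γ : ℝ) * s ≤ ((K γ : ℝ) + 2) * hmax := by nlinarith
   have hKle : (K γ : ℝ) ≤ ((K γ : ℝ) + 2) * hmax / s := by
     rw [le_div_iff₀ hs]; exact hKs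
   have hk1 : (((K γ + 1 : ℕ) : ℝ)) ≤ ((K γ : ℝ) + 2) * hmax / s + B + 1 := by
     push_cast; linarith
   have hx1 : |γ - γ| < R / 2 + Real.sqrt ((K γ + 1 : ℕ) : ℝ) * hmax := by
     simp only [sub_self, abs_zero]
     exact add_pos_of_pos_of_nonneg (half_pos hR) (mul_nonneg (Real.sqrt_nonneg _) hmaxpos.le)
   have := (hbk (K γ + 1) γ hk1 hx1).2
   omega
 have hEC : EventConcl ((K γ : ℝ) + 2) riemannXiUpper γ s hmax R B :=
   hmet fun _ _ _ hs h1 h2 _ _ _ _ _ _ _ _ ↦ (key hs h1 h2).elim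
 obtain ⟨k, hk, x, hx, hev⟩ := hEC
 exact ⟨x, (hbk k x hk hx).1, k, (hbk k x hk hx).2, (nlEventOf_xi_iff k x).1 hev⟩


theorem thickLaw_of_feed4_alone {C : ℝ} {K : ℝ → ℕ} {T₀ T₁ : ℝ}
   (hfeed : ∀ A' C' : ℝ, 0 < A' → 0 < C' → ∀ γ δ : ℝ, T₁ < γ → OffLineZeroAt γ δ → thickBandL (thickEdge C) γ δ →
     ∃ (η' s hmax R' Hs : ℝ) (B' : ℕ),
       (TiltedLandingEventAt4 A' C' η' riemannXiUpper γ s hmax R' Hs B' → EventConcl A' riemannXiUpper γ s hmax R' B') ∧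
       (∀ (k : ℕ) (x : ℝ), (k : ℝ) ≤ A' * hmax / s + B' + 1 → |x - γ| < R' / 2 + Real.sqrt k * hmax → T₀ < x ∧ k ≤ K x)) :
   LandingLawOnBand xiNLEvent K T₀ T₁ (thickBandL (thickEdge C)) := by
 intro γ δ hγ hz hband
 have hK0 : (0 : ℝ) ≤ (K γ : ℝ) := Nat.cast_nonneg _
 have hNpos : (0 : ℝ) < (K γ : ℝ) + 2 := by linarith
 obtain ⟨η, s, hmax, R, Hs, B, hmet, hbk⟩ := hfeed ((K γ : ℝ) + 2) ((K γ : ℝ) + 2) hNpos hNpos γ δ hγ hz hband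
 have key : 0 < s → ((K γ : ℝ) + 2) * s ≤ hmax → ((K γ : ℝ) + 2) * hmax ≤ R → False := by
   intro hs h1 h2
   have hmaxpos : 0 < hmax := lt_of_lt_of_le (mul_pos hNpos hs) h1
   have hR : 0 < R := lt_of_lt_of_le (mul_pos hNpos hmaxpos) h2
   have hB : (0 : ℝ) ≤ (B : ℝ) := Nat.cast_nonneg _
   have hKs : (K γ : ℝ) * s ≤ ((K γ : ℝ) + 2) * hmax := by nlinarith
   have hKle : (K γ : ℝ) ≤ ((K γ : ℝ) + 2) * hmax / s := by
     rw [le_div_iff₀ hs]; exact hKs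
   have hk1 : (((K γ + 1 : ℕ) : ℝ)) ≤ ((K γ : ℝ) + 2) * hmax / s + B + 1 := by
     push_cast; linarith
   have hx1 : |γ - γ| < R / 2 + Real.sqrt ((K γ + 1 : ℕ) : ℝ) * hmax := by
     simp only [sub_self, abs_zero]
     exact add_pos_of_pos_of_nonneg (half_pos hR) (mul_nonneg (Real.sqrt_nonneg _) hmaxpos.le)
   have := (hbk (K γ + 1) γ hk1 hx1).2
   omega
 have hEC : EventConcl ((K γ : ℝ) + 2) riemannXiUpper γ s hmax R B :=
   hmet fun _ _ _ hs h1 h2 _ _ _ _ _ _ _ _ _ ↦ (key hs h1 h2).elim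
 obtain ⟨k, hk, x, hx, hev⟩ := hEC
 exact ⟨x, (hbk k x hk hx).1, k, (hbk k x hk hx).2, (nlEventOf_xi_iff k x).1 hev⟩


theorem closes_v4_without_law {K : ℝ → ℕ} {T₀ T₁ cthin c C A η : ℝ} {B : ℝ → ℕ} {R : ℝ → ℝ} {Ethin : ℕ → ℝ → Prop}
   (hH : HardyZLehmerSplit.HeightPT) (hT₁ : T₁ ≤ C3.verifiedHeight) (hcC : C ≤ c) (h2π : 2 * Real.pi ≤ T₁)
   (hEthin : ∀ m t, Ethin m t → xiNLEvent m t) (hRes : Rev2.WindowedSignPatternAllBands Ethin K T₀ T₁ cthin c)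
   (hρ2 : Remainder0Xi η R T₁) (hIn : Rev2.XiLevel0Inputs B R T₁) (hGlue : Rev2.XiFeedGlue A C η B K T₀ T₁ R) : RiemannHypothesis :=
 rh_of_bandJoin4 (E := xiNLEvent) (upTo_of_PT hH) hT₁ hRes.2.2 hRes.1 hRes.2.1
   (landingLawOnBand_of_empty (E := xiNLEvent) fun γ δ hγ _ ↦ seam_empty_of_closed (seamClosed_of_le hcC h2π) γ δ hγ)
   (thickLaw_of_feed3_alone (hGlue hIn hρ2))
   hEthin (fun _ _ h ↦ h.2) (fun _ _ (h : xiNLEvent _ _) ↦ h) (fun _ _ h ↦ h)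

end RhIdea6.G17.W07C7.Rev3









namespace RhIdea6.G17.W07C7.Rev4

open Literature.NumberTheory.LFunctions Literature.NumberTheory.DiophantineGeometry
open Summit.RiemannHypothesis.RiemannHypothesis.Theses
open RhIdea6.G17.W07C7.Rev2 (WindowedSignPatternAllBands XiLevel0Inputs4)
open RhIdea6.G17.W07C7.Rev3 (EngineHyps4 TiltedLandingLaw4 TiltedLandingLaw44 XiThickColumnData closes_v5)


def RadiusBooked (C₀ T₁ : ℝ) (R : ℝ → ℝ) : Prop := ∀ γ : ℝ, T₁ < γ → C₀ ≤ R γ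



def DepthProfileBooked (A₀ : ℝ) (B : ℝ → ℕ) (K : ℝ → ℕ) (T₀ T₁ : ℝ) (R : ℝ → ℝ) : Prop :=
 ∀ γ : ℝ, T₁ < γ → ∀ (k : ℕ) (x : ℝ), (k : ℝ) ≤ A₀ / (2 * xiSpacing γ) + B γ + 1 →
   |x - γ| < R γ / 2 + Real.sqrt k / 2 → T₀ < x ∧ k ≤ K x

theorem xiSpacing_pos {T₁ γ : ℝ} (h2π : 2 * Real.pi < T₁) (hγ : T₁ < γ) : 0 < xiSpacing γ := by
 have h2 : (0 : ℝ) < 2 * Real.pi := by positivity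
 exact div_pos h2 (Real.log_pos ((one_lt_div h2).2 (h2π.trans hγ)))


theorem xiUpper_zero_of_offLine {γ δ : ℝ} (hz : OffLineZeroAt γ δ) : riemannXiUpper ⟨γ, -δ⟩ = 0 := by
 have hlt : δ < 1 / 2 := hz.lt_half
 obtain ⟨hzero, hδ⟩ := hz
 have hw : (1 / 2 : ℂ) + Complex.I * ⟨γ, -δ⟩ = ⟨1 / 2 + δ, γ⟩ := by
   apply Complex.ext <;> simp
 rw [riemannXiUpper, hw]
 exact (riemannXi_eq_zero_iff_holds _).2 ⟨hzero, by show (0 : ℝ) < 1 / 2 + δ; linarith, by show 1 / 2 + δ < (1 : ℝ); linarith⟩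


theorem xiFeedGlue_holds {A₀ C₀ η T₀ T₁ : ℝ} {B : ℝ → ℕ} {K : ℝ → ℕ} {R : ℝ → ℝ}
   (h2π : 2 * Real.pi < T₁) (hA₀ : 0 ≤ A₀) (hC₀ : 0 ≤ C₀) (hη0 : 0 ≤ η) (hη1 : C₀ * η ≤ 1)
   (hR : RadiusBooked C₀ T₁ R) (hK : DepthProfileBooked A₀ B K T₀ T₁ R) :
   Rev3.XiFeedGlue A₀ C₀ η B K T₀ T₁ R := by
 intro hIn hρ2 γ δ hγ hz hband
 obtain ⟨hXi, hBud, hHalf⟩ := hIn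
 obtain ⟨⟨hdiff, ρ, Cg, hρ, hgrowth⟩, hreal, -, hstrip, -⟩ := hXi
 have hδ : 0 < δ := hz.2
 have hδh : δ < 1 / 2 := hz.lt_half
 have hs : 0 < xiSpacing γ := xiSpacing_pos h2π hγ
 have hRγ : C₀ ≤ R γ := hR γ hγ
 have hband' : C₀ * xiSpacing γ ≤ δ := hband
 refine ⟨η, xiSpacing γ, δ, R γ, 1, B γ, ⟨hdiff, hreal, ⟨Cg, 1, ρ, hρ, fun z ↦ by simpa using hgrowth z⟩,
   hs, hband', by nlinarith, zero_le_one, hstrip, by simpa using hRγ, ?_, hBud γ hγ, hHalf γ hγ, hη0, hη1, ?_⟩, ?_⟩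
 · refine ⟨⟨γ, -δ⟩, xiUpper_zero_of_offLine hz, ?_, rfl, ?_⟩
   · show -δ ≠ 0
     exact neg_ne_zero.2 hδ.ne'
   · show |(-δ)| ≤ δ
     rw [abs_neg, abs_of_pos hδ]
 · exact fun w hw1 hw2 hw3 ↦ hρ2 γ hγ w hw1 (hw2.trans hδh.le) hw3
 · intro k x hk hx
   have h1 : A₀ * δ / xiSpacing γ ≤ A₀ / (2 * xiSpacing γ) := by
     rw [div_le_div_iff₀ hs (by positivity)]
     nlinarith [mul_nonneg hA₀ hs.le]
   have h2 : Real.sqrt k * δ ≤ Real.sqrt k / 2 := by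
     have := mul_le_mul_of_nonneg_left hδh.le (Real.sqrt_nonneg (k : ℝ))
     linarith
   exact hK γ hγ k x (by linarith) (by linarith)



theorem closes_v6 {K : ℝ → ℕ} {T₀ T₁ cthin c A₀ C₀ η : ℝ} {B : ℝ → ℕ} {R : ℝ → ℝ} {Ethin : ℕ → ℝ → Prop}
   (hH : HardyZLehmerSplit.HeightPT) (hT₁ : T₁ ≤ C3.verifiedHeight) (hcC : C₀ ≤ c) (h2π : 2 * Real.pi < T₁)
   (hA₀ : 0 ≤ A₀) (hC₀ : 0 ≤ C₀) (hη0 : 0 ≤ η) (hη1 : C₀ * η ≤ 1) (hR : RadiusBooked C₀ T₁ R) (hK : DepthProfileBooked A₀ B K T₀ T₁ R)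
   (hEthin : ∀ m t, Ethin m t → xiNLEvent m t)
   (hRes : WindowedSignPatternAllBands Ethin K T₀ T₁ cthin c)
   (hLaw : TiltedLandingLaw4 A₀ C₀) (hρ2 : Remainder0Xi η R T₁) (hIn : XiLevel0Inputs4 B R T₁) : RiemannHypothesis :=
 closes_v5 hH hT₁ hcC h2π.le hEthin hRes hLaw hρ2 hIn (xiFeedGlue_holds h2π hA₀ hC₀ hη0 hη1 hR hK)


theorem closes_v6_44 {K : ℝ → ℕ} {T₀ T₁ cthin c η : ℝ} {B : ℝ → ℕ} {R : ℝ → ℝ} {Ethin : ℕ → ℝ → Prop}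
   (hH : HardyZLehmerSplit.HeightPT) (hT₁ : T₁ ≤ C3.verifiedHeight) (hc : 4 ≤ c) (h2π : 2 * Real.pi < T₁)
   (hη0 : 0 ≤ η) (hη1 : 4 * η ≤ 1) (hR : RadiusBooked 4 T₁ R) (hK : DepthProfileBooked 4 B K T₀ T₁ R)
   (hEthin : ∀ m t, Ethin m t → xiNLEvent m t)
   (hRes : WindowedSignPatternAllBands Ethin K T₀ T₁ cthin c)
   (hLaw : TiltedLandingLaw44) (hρ2 : Remainder0Xi η R T₁) (hIn : XiLevel0Inputs4 B R T₁) : RiemannHypothesis :=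
 closes_v6 hH hT₁ hc h2π (by norm_num) (by norm_num) hη0 hη1 hR hK hEthin hRes hLaw hρ2 hIn

end RhIdea6.G17.W07C7.Rev4










namespace RhIdea6.G17.W07C7.Rev5

open Literature.NumberTheory.LFunctions Literature.NumberTheory.DiophantineGeometry
open Summit.RiemannHypothesis.RiemannHypothesis.Theses
open RhIdea6.G17.W07C7.Rev2 (WindowedSignPatternAllBands XiLevel0Inputs4)
open RhIdea6.G17.W07C7.Rev3 (TiltedLandingLaw4 closes_v5)
open RhIdea6.G17.W07C7.Rev4 (RadiusBooked DepthProfileBooked closes_v6)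


def TiltedLandingLaw42 : Prop := TiltedLandingLaw4 4 2


theorem closes_v5_42 {K : ℝ → ℕ} {T₀ T₁ cthin c η : ℝ} {B : ℝ → ℕ} {R : ℝ → ℝ} {Ethin : ℕ → ℝ → Prop}
   (hH : HardyZLehmerSplit.HeightPT) (hT₁ : T₁ ≤ C3.verifiedHeight) (hc : 2 ≤ c) (h2π : 2 * Real.pi ≤ T₁)
   (hEthin : ∀ m t, Ethin m t → xiNLEvent m t)
   (hRes : WindowedSignPatternAllBands Ethin K T₀ T₁ cthin c)
   (hLaw : TiltedLandingLaw42) (hρ2 : Remainder0Xi η R T₁) (hIn : XiLevel0Inputs4 B R T₁)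
   (hGlue : Rev3.XiFeedGlue 4 2 η B K T₀ T₁ R) : RiemannHypothesis :=
 closes_v5 hH hT₁ hc h2π hEthin hRes hLaw hρ2 hIn hGlue



theorem closes_v6_42 {K : ℝ → ℕ} {T₀ T₁ cthin c η : ℝ} {B : ℝ → ℕ} {R : ℝ → ℝ} {Ethin : ℕ → ℝ → Prop}
   (hH : HardyZLehmerSplit.HeightPT) (hT₁ : T₁ ≤ C3.verifiedHeight) (hc : 2 ≤ c) (h2π : 2 * Real.pi < T₁)
   (hη0 : 0 ≤ η) (hη1 : 2 * η ≤ 1) (hR : RadiusBooked 2 T₁ R) (hK : DepthProfileBooked 4 B K T₀ T₁ R)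
   (hEthin : ∀ m t, Ethin m t → xiNLEvent m t)
   (hRes : WindowedSignPatternAllBands Ethin K T₀ T₁ cthin c)
   (hLaw : TiltedLandingLaw42) (hρ2 : Remainder0Xi η R T₁) (hIn : XiLevel0Inputs4 B R T₁) : RiemannHypothesis :=
 closes_v6 hH hT₁ hc h2π (by norm_num) (by norm_num) hη0 hη1 hR hK hEthin hRes hLaw hρ2 hIn


theorem thickCell_live_only_if {C₀ γ δ : ℝ} (hz : OffLineZeroAt γ δ) (hband : thickBandL (thickEdge C₀) γ δ) : C₀ * xiSpacing γ < 1 / 2 :=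
 lt_of_le_of_lt hband hz.lt_half

end RhIdea6.G17.W07C7.Rev5























namespace RhIdea6.G17.W07C7.Rev6

open Literature.NumberTheory.LFunctions Literature.NumberTheory.DiophantineGeometry
open Summit.RiemannHypothesis.RiemannHypothesis.Theses
open RhIdea6.G17.W07C7.Rev2 (WindowedSignPatternAllBands XiLevel0Inputs4)
open RhIdea6.G17.W07C7.Rev4 (RadiusBooked xiSpacing_pos xiUpper_zero_of_offLine)


def EventConcl5 (A D : ℝ) (f : ℂ → ℂ) (x₀ s hmax R Hs : ℝ) (B : ℕ) : Prop :=
 ∃ k : ℕ, (k : ℝ) ≤ A * hmax / s + D * (Hs / s) ^ 2 + B + 1 ∧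
   ∃ x : ℝ, |x - x₀| < (k + 3) * R / 2 ∧ NLEventOf f k x



theorem eventConcl5_of_eventConcl {A D : ℝ} {f : ℂ → ℂ} {x₀ s hmax R Hs : ℝ} {B : ℕ} (hD : 0 ≤ D)
   (hwin : ∀ k : ℕ, R / 2 + Real.sqrt k * hmax ≤ (k + 3) * R / 2)
   (h : EventConcl A f x₀ s hmax R B) : EventConcl5 A D f x₀ s hmax R Hs B := by
 obtain ⟨k, hk, x, hx, hev⟩ := h
 refine ⟨k, ?_, x, ?_, hev⟩
 · have : 0 ≤ D * (Hs / s) ^ 2 := mul_nonneg hD (sq_nonneg _)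
   linarith
 · have := hwin k
   linarith


def EngineHyps5 (C η : ℝ) (f : ℂ → ℂ) (x₀ s hmax R Hs : ℝ) (B : ℕ) : Prop :=
 Differentiable ℂ f ∧ (∀ x : ℝ, (f (x : ℂ)).im = 0) ∧
   (∃ A' B' ρ : ℝ, ρ < 2 ∧ ∀ z : ℂ, ‖f z‖ ≤ A' * Real.exp (B' * ‖z‖ ^ ρ)) ∧
   0 < s ∧ C * s ≤ hmax ∧ C * hmax ≤ R ∧ 3 * hmax < R ∧ 0 ≤ Hs ∧ (∀ w : ℂ, f w = 0 → |w.im| ≤ Hs) ∧ C * Hs ≤ R ∧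
   (∃ w₀ : ℂ, f w₀ = 0 ∧ w₀.im ≠ 0 ∧ w₀.re = x₀ ∧ |w₀.im| ≤ hmax) ∧
   ColumnBudgetMult B f x₀ s R ∧ HalfSlabBudget B f x₀ s R ∧
   0 ≤ η ∧ C * η ≤ 1 ∧ RemainderBox η f x₀ s hmax R


def TiltedLandingEventAt5 (A C D η : ℝ) (f : ℂ → ℂ) (x₀ s hmax R Hs : ℝ) (B : ℕ) : Prop :=
 EngineHyps5 C η f x₀ s hmax R Hs B → EventConcl5 A D f x₀ s hmax R Hs B



def TiltedLandingLaw5 (A₀ C₀ D₀ : ℝ) : Prop :=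
 ∀ (η : ℝ) (f : ℂ → ℂ) (x₀ s hmax R Hs : ℝ) (B : ℕ), TiltedLandingEventAt5 A₀ C₀ D₀ η f x₀ s hmax R Hs B


def TiltedLandingLaw421 : Prop := TiltedLandingLaw5 4 2 1



def XiThickColumnData5 (A₀ C₀ D₀ : ℝ) (K : ℝ → ℕ) (T₀ T₁ : ℝ) : Prop :=
 ∀ γ δ : ℝ, T₁ < γ → OffLineZeroAt γ δ → thickBandL (thickEdge C₀) γ δ →
   ∃ (η s hmax R Hs : ℝ) (B : ℕ), EngineHyps5 C₀ η riemannXiUpper γ s hmax R Hs B ∧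
     (∀ (k : ℕ) (x : ℝ), (k : ℝ) ≤ A₀ * hmax / s + D₀ * (Hs / s) ^ 2 + B + 1 → |x - γ| < (k + 3) * R / 2 → T₀ < x ∧ k ≤ K x)


def XiFeedGlue5 (A₀ C₀ D₀ η : ℝ) (B : ℝ → ℕ) (K : ℝ → ℕ) (T₀ T₁ : ℝ) (R : ℝ → ℝ) : Prop :=
 XiLevel0Inputs4 B R T₁ → Remainder0Xi η R T₁ → XiThickColumnData5 A₀ C₀ D₀ K T₀ T₁


theorem landingLawOnBand_of_law5_data {A₀ C₀ D₀ : ℝ} {K : ℝ → ℕ} {T₀ T₁ : ℝ} (hLaw : TiltedLandingLaw5 A₀ C₀ D₀)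
   (hD : XiThickColumnData5 A₀ C₀ D₀ K T₀ T₁) : LandingLawOnBand xiNLEvent K T₀ T₁ (thickBandL (thickEdge C₀)) := by
 intro γ δ hγ hz hband
 obtain ⟨η, s, hmax, R, Hs, B, hE, hbk⟩ := hD γ δ hγ hz hband
 obtain ⟨k, hk, x, hx, hev⟩ := hLaw η riemannXiUpper γ s hmax R Hs B hE
 exact ⟨x, (hbk k x hk hx).1, k, (hbk k x hk hx).2, (nlEventOf_xi_iff k x).1 hev⟩



def DepthProfileBooked5 (A₀ D₀ : ℝ) (B : ℝ → ℕ) (K : ℝ → ℕ) (T₀ T₁ : ℝ) (R : ℝ → ℝ) : Prop :=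
 ∀ γ : ℝ, T₁ < γ → ∀ (k : ℕ) (x : ℝ), (k : ℝ) ≤ A₀ / (2 * xiSpacing γ) + D₀ * (1 / xiSpacing γ) ^ 2 + B γ + 1 →
   |x - γ| < (k + 3) * R γ / 2 → T₀ < x ∧ k ≤ K x



theorem xiFeedGlue5_holds {A₀ C₀ D₀ η T₀ T₁ : ℝ} {B : ℝ → ℕ} {K : ℝ → ℕ} {R : ℝ → ℝ}
   (h2π : 2 * Real.pi < T₁) (hA₀ : 0 ≤ A₀) (hC₀ : 3 / 2 ≤ C₀) (hη0 : 0 ≤ η) (hη1 : C₀ * η ≤ 1)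
   (hR : RadiusBooked C₀ T₁ R) (hK : DepthProfileBooked5 A₀ D₀ B K T₀ T₁ R) :
   XiFeedGlue5 A₀ C₀ D₀ η B K T₀ T₁ R := by
 intro hIn hρ2 γ δ hγ hz hband
 obtain ⟨hXi, hBud, hHalf⟩ := hIn
 obtain ⟨⟨hdiff, ρ, Cg, hρ, hgrowth⟩, hreal, -, hstrip, -⟩ := hXi
 have hδ : 0 < δ := hz.2
 have hδh : δ < 1 / 2 := hz.lt_half
 have hs : 0 < xiSpacing γ := xiSpacing_pos h2π hγ
 have hRγ : C₀ ≤ R γ := hR γ hγ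
 have hC₀0 : 0 ≤ C₀ := by linarith
 have hband' : C₀ * xiSpacing γ ≤ δ := hband
 refine ⟨η, xiSpacing γ, δ, R γ, 1, B γ, ⟨hdiff, hreal, ⟨Cg, 1, ρ, hρ, fun z ↦ by simpa using hgrowth z⟩,
   hs, hband', by nlinarith, by linarith, zero_le_one, hstrip, by simpa using hRγ, ?_, hBud γ hγ, hHalf γ hγ, hη0, hη1, ?_⟩, ?_⟩
 · refine ⟨⟨γ, -δ⟩, xiUpper_zero_of_offLine hz, ?_, rfl, ?_⟩
   · show -δ ≠ 0
     exact neg_ne_zero.2 hδ.ne'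
   · show |(-δ)| ≤ δ
     rw [abs_neg, abs_of_pos hδ]
 · exact fun w hw1 hw2 hw3 ↦ hρ2 γ hγ w hw1 (hw2.trans hδh.le) hw3
 · intro k x hk hx
   have h1 : A₀ * δ / xiSpacing γ ≤ A₀ / (2 * xiSpacing γ) := by
     rw [div_le_div_iff₀ hs (by positivity)]
     nlinarith [mul_nonneg hA₀ hs.le]
   exact hK γ hγ k x (by linarith) hx



theorem closes_v7 {K : ℝ → ℕ} {T₀ T₁ cthin c A₀ C₀ D₀ η : ℝ} {B : ℝ → ℕ} {R : ℝ → ℝ} {Ethin : ℕ → ℝ → Prop}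
   (hH : HardyZLehmerSplit.HeightPT) (hT₁ : T₁ ≤ C3.verifiedHeight) (hcC : C₀ ≤ c) (h2π : 2 * Real.pi < T₁)
   (hA₀ : 0 ≤ A₀) (hC₀ : 3 / 2 ≤ C₀) (hη0 : 0 ≤ η) (hη1 : C₀ * η ≤ 1) (hR : RadiusBooked C₀ T₁ R) (hK : DepthProfileBooked5 A₀ D₀ B K T₀ T₁ R)
   (hEthin : ∀ m t, Ethin m t → xiNLEvent m t)
   (hRes : WindowedSignPatternAllBands Ethin K T₀ T₁ cthin c)
   (hLaw : TiltedLandingLaw5 A₀ C₀ D₀) (hρ2 : Remainder0Xi η R T₁) (hIn : XiLevel0Inputs4 B R T₁) : RiemannHypothesis :=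
 rh_of_bandJoin4 (E := xiNLEvent) (upTo_of_PT hH) hT₁ hRes.2.2 hRes.1 hRes.2.1
   (landingLawOnBand_of_empty (E := xiNLEvent) fun γ δ hγ _ ↦ seam_empty_of_closed (seamClosed_of_le hcC h2π.le) γ δ hγ)
   (landingLawOnBand_of_law5_data hLaw (xiFeedGlue5_holds h2π hA₀ hC₀ hη0 hη1 hR hK hIn hρ2))
   hEthin (fun _ _ h ↦ h.2) (fun _ _ (h : xiNLEvent _ _) ↦ h) (fun _ _ h ↦ h)


theorem closes_v7_421 {K : ℝ → ℕ} {T₀ T₁ cthin c η : ℝ} {B : ℝ → ℕ} {R : ℝ → ℝ} {Ethin : ℕ → ℝ → Prop}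
   (hH : HardyZLehmerSplit.HeightPT) (hT₁ : T₁ ≤ C3.verifiedHeight) (hc : 2 ≤ c) (h2π : 2 * Real.pi < T₁)
   (hη0 : 0 ≤ η) (hη1 : 2 * η ≤ 1) (hR : RadiusBooked 2 T₁ R) (hK : DepthProfileBooked5 4 1 B K T₀ T₁ R)
   (hEthin : ∀ m t, Ethin m t → xiNLEvent m t)
   (hRes : WindowedSignPatternAllBands Ethin K T₀ T₁ cthin c)
   (hLaw : TiltedLandingLaw421) (hρ2 : Remainder0Xi η R T₁) (hIn : XiLevel0Inputs4 B R T₁) : RiemannHypothesis :=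
 closes_v7 hH hT₁ hc h2π (by norm_num) (by norm_num) hη0 hη1 hR hK hEthin hRes hLaw hρ2 hIn


theorem xiThickColumnData5_of_rh (hRH : RiemannHypothesis) (A₀ C₀ D₀ : ℝ) (K : ℝ → ℕ) (T₀ T₁ : ℝ) :
   XiThickColumnData5 A₀ C₀ D₀ K T₀ T₁ :=
 fun γ δ _ hz _ ↦ absurd hz (seenClean_of_rh hRH Set.univ γ δ (Set.mem_univ _))



theorem tiltedLandingLaw5_of_law4 {A₀ C₀ D₀ : ℝ} (hD : 0 ≤ D₀)
   (hwin : ∀ (k : ℕ) (hmax R : ℝ), 3 * hmax < R → 0 ≤ hmax → R / 2 + Real.sqrt k * hmax ≤ (k + 3) * R / 2)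
   (h : Rev3.TiltedLandingLaw4 A₀ C₀) : TiltedLandingLaw5 A₀ C₀ D₀ := by
 intro η f x₀ s hmax R Hs B hE
 obtain ⟨hd, hr, ho, hs, h1, h2, h3r, h3, h4, h5, h6, hB, hHB, hη, hCη, hRB⟩ := hE
 have hmax0 : 0 ≤ hmax := by
   obtain ⟨w₀, -, -, -, hw⟩ := h6
   exact (abs_nonneg _).trans hw
 exact eventConcl5_of_eventConcl hD (fun k ↦ hwin k hmax R h3r hmax0)
   (h η f x₀ s hmax R Hs B hd hr ho hs h1 h2 h3 h4 h5 h6 hB hHB hη hCη hRB)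

end RhIdea6.G17.W07C7.Rev6
























namespace RhIdea6.G18.W07C8.Law421BirthS

open Set Complex
open Literature.NumberTheory.LFunctions Literature.NumberTheory.DiophantineGeometry
open Summit.RiemannHypothesis.RiemannHypothesis.Theses
open Summit.RiemannHypothesis.RiemannHypothesis.Theorems.Splittings.JensenWindow (LocalA)
open Summit.RiemannHypothesis.RiemannHypothesis.Theorems.Splittings.EarlyAppointmentsLocalFourierPolya
 (exists_nonLaguerre_critical_of_boundary_sign)
open RhIdea6.G17.W07C7 RhIdea6.G17.W07C7.Rev6


def InClass (g : ℂ → ℂ) (Hs : ℝ) : Prop :=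
 Differentiable ℂ g ∧ (∀ t : ℝ, (g (t : ℂ)).im = 0) ∧
   (∃ A' B' ρ : ℝ, ρ < 2 ∧ ∀ z : ℂ, ‖g z‖ ≤ A' * Real.exp (B' * ‖z‖ ^ ρ)) ∧
   (∀ w : ℂ, g w = 0 → |w.im| ≤ Hs)


def OffJensenDiscs (g : ℂ → ℂ) (p : ℂ) : Prop :=
 ∀ u : ℂ, g u = 0 → u.im ≠ 0 → u.im ^ 2 < (p.re - u.re) ^ 2 + p.im ^ 2


def ShadowFreeWindow (g : ℂ → ℂ) (α β H : ℝ) : Prop :=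
 α < β ∧ 0 < H ∧ g α ≠ 0 ∧ g β ≠ 0 ∧ deriv g α ≠ 0 ∧ deriv g β ≠ 0 ∧
   (∀ x ∈ Icc α β, OffJensenDiscs g ((x : ℂ) + (H : ℂ) * I)) ∧
   (∀ y ∈ Ioc (0 : ℝ) H, OffJensenDiscs g ((α : ℂ) + (y : ℂ) * I)) ∧
   (∀ y ∈ Ioc (0 : ℝ) H, OffJensenDiscs g ((β : ℂ) + (y : ℂ) * I)) ∧
   LocalA g α β H ∧ (∃ ρ ∈ Ioo α β ×ℂ Ioo (-H) H, g ρ = 0 ∧ ρ.im ≠ 0)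


def DescentSig : Prop := ∀ (η : ℝ) (f : ℂ → ℂ) (x₀ s hmax R Hs : ℝ) (B : ℕ),
 EngineHyps5 2 η f x₀ s hmax R Hs B →
   ∃ (j : ℕ) (α β H : ℝ), (j : ℝ) ≤ 4 * hmax / s + (Hs / s) ^ 2 + B ∧
     x₀ - (j + 3) * R / 2 ≤ α ∧ β ≤ x₀ + (j + 3) * R / 2 ∧
     iteratedDeriv j f ≠ 0 ∧ ShadowFreeWindow (iteratedDeriv j f) α β H




def SignWindow (g : ℂ → ℂ) (α β H : ℝ) : Prop :=
 α < β ∧ 0 < H ∧ g α ≠ 0 ∧ g β ≠ 0 ∧ deriv g α ≠ 0 ∧ deriv g β ≠ 0 ∧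
   (∀ x ∈ Icc α β, (deriv g ((x : ℂ) + (H : ℂ) * I) / g ((x : ℂ) + (H : ℂ) * I)).im < 0) ∧
   (∀ y ∈ Ioc (0 : ℝ) H, (deriv g ((α : ℂ) + (y : ℂ) * I) / g ((α : ℂ) + (y : ℂ) * I)).im < 0) ∧
   (∀ y ∈ Ioc (0 : ℝ) H, (deriv g ((β : ℂ) + (y : ℂ) * I) / g ((β : ℂ) + (y : ℂ) * I)).im < 0) ∧
   LocalA g α β H ∧ (∃ ρ ∈ Ioo α β ×ℂ Ioo (-H) H, g ρ = 0 ∧ ρ.im ≠ 0)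


def DescentSigS : Prop := ∀ (η : ℝ) (f : ℂ → ℂ) (x₀ s hmax R Hs : ℝ) (B : ℕ),
 EngineHyps5 2 η f x₀ s hmax R Hs B →
   ∃ (j : ℕ) (α β H : ℝ), (j : ℝ) ≤ 4 * hmax / s + (Hs / s) ^ 2 + B ∧
     x₀ - (j + 3) * R / 2 ≤ α ∧ β ≤ x₀ + (j + 3) * R / 2 ∧
     iteratedDeriv j f ≠ 0 ∧ SignWindow (iteratedDeriv j f) α β H



def OffJensenSignSig : Prop := ∀ (g : ℂ → ℂ) (Hs : ℝ) (p : ℂ),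
 InClass g Hs → g ≠ 0 → (∃ u : ℂ, g u = 0) → 0 < p.im → OffJensenDiscs g p → (deriv g p / g p).im < 0


def AnalyticHereditySig : Prop := ∀ (f : ℂ → ℂ) (Hs : ℝ) (j : ℕ),
 0 ≤ Hs → InClass f Hs → iteratedDeriv j f ≠ 0 → InClass (iteratedDeriv j f) Hs








lemma im_ofReal_add_mul_I (a y : ℝ) : ((a : ℂ) + (y : ℂ) * I).im = y := by simp


theorem descentSigS_of_descentSig (hSign : OffJensenSignSig) (hHer : AnalyticHereditySig) (hDesc : DescentSig) : DescentSigS := by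
 intro η f x₀ s hmax R Hs B hE
 have hE' := hE
 obtain ⟨hdiff, hreal, hgrowth, hs, hsh, hhR, h3R, hHs, hstrip, hHsR, hpair, hcol, hhalf, hη0, hη1, hrem⟩ := hE'
 have hC0 : InClass f Hs := ⟨hdiff, hreal, hgrowth, hstrip⟩
 obtain ⟨j, α, β, H, hj, hα, hβ, hnz, hW⟩ := hDesc η f x₀ s hmax R Hs B hE
 obtain ⟨hlt, hH, hgα, hgβ, hdα, hdβ, hTop, hL, hRt, hA, hz⟩ := hW
 have hCj : InClass (iteratedDeriv j f) Hs := hHer f Hs j hHs hC0 hnz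
 have hsome : ∃ u : ℂ, iteratedDeriv j f u = 0 := by
   obtain ⟨ρ, -, hρ, -⟩ := hz
   exact ⟨ρ, hρ⟩
 refine ⟨j, α, β, H, hj, hα, hβ, hnz, hlt, hH, hgα, hgβ, hdα, hdβ, ?_, ?_, ?_, hA, hz⟩
 · exact fun x hx ↦ hSign _ Hs _ hCj hnz hsome (by rw [im_ofReal_add_mul_I]; exact hH) (hTop x hx)
 · exact fun y hy ↦ hSign _ Hs _ hCj hnz hsome (by rw [im_ofReal_add_mul_I]; exact hy.1) (hL y hy)
 · exact fun y hy ↦ hSign _ Hs _ hCj hnz hsome (by rw [im_ofReal_add_mul_I]; exact hy.1) (hRt y hy)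


theorem law421_ofS (hDesc : DescentSigS) (hHer : AnalyticHereditySig) : TiltedLandingLaw421 := by
 intro η f x₀ s hmax R Hs B hE
 have hE' := hE
 obtain ⟨hdiff, hreal, hgrowth, hs, hsh, hhR, h3R, hHs, hstrip, hHsR, hpair, hcol, hhalf, hη0, hη1, hrem⟩ := hE'
 have hC0 : InClass f Hs := ⟨hdiff, hreal, hgrowth, hstrip⟩
 obtain ⟨j, α, β, H, hj, hα, hβ, hnz, hW⟩ := hDesc η f x₀ s hmax R Hs B hE
 obtain ⟨hlt, hH, hgα, hgβ, hdα, hdβ, htop, hleft, hright, hA, hz⟩ := hW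

 have hCj : InClass (iteratedDeriv j f) Hs := hHer f Hs j hHs hC0 hnz

 obtain ⟨x, hxI, hdx, hgx, hsign⟩ :=
   exists_nonLaguerre_critical_of_boundary_sign hCj.1 hCj.2.1 hlt hH hgα hgβ hdα hdβ htop hleft hright hA hz

 have h1 : iteratedDeriv (j + 1) f = deriv (iteratedDeriv j f) := iteratedDeriv_succ
 have h2 : iteratedDeriv (j + 2) f = deriv (deriv (iteratedDeriv j f)) := by
   show iteratedDeriv (j + 1 + 1) f = _
   rw [iteratedDeriv_succ, iteratedDeriv_succ]
 have hgim : (iteratedDeriv j f (x : ℂ)).im = 0 := hCj.2.1 x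
 have hev : NLEventOf f j x := by
   refine ⟨?_, ?_, ?_⟩
   · rw [h1, hdx]; simp
   · intro hre
     exact hgx (Complex.ext (by simpa using hre) (by simpa using hgim))
   · rw [h2]
     have hmul : (iteratedDeriv j f (x : ℂ) * deriv (deriv (iteratedDeriv j f)) (x : ℂ)).re =
         (iteratedDeriv j f (x : ℂ)).re * (deriv (deriv (iteratedDeriv j f)) (x : ℂ)).re := by
       rw [Complex.mul_re, hgim, zero_mul, sub_zero]
     rw [← hmul]; exact hsign
 refine ⟨j, ?_, x, ?_, hev⟩
 · have : (1 : ℝ) * (Hs / s) ^ 2 = (Hs / s) ^ 2 := one_mul _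
   linarith
 · rw [abs_sub_lt_iff]
   constructor <;> linarith [hxI.1, hxI.2]


theorem law421_of (hDesc : DescentSig) (hSign : OffJensenSignSig) (hHer : AnalyticHereditySig) : TiltedLandingLaw421 :=
 law421_ofS (descentSigS_of_descentSig hSign hHer hDesc) hHer







end RhIdea6.G18.W07C8.Law421BirthS












namespace RhIdea6.G18.W07C8.Law421BirthS.Split

open Set Complex
open RhIdea6.G17.W07C7 RhIdea6.G17.W07C7.Rev6 RhIdea6.G18.W07C8.Law421BirthS



def BudgetSig (Iso : (ℂ → ℂ) → ℝ → ℝ → ℂ → Prop) : Prop := ∀ (η : ℝ) (f : ℂ → ℂ) (x₀ s hmax R Hs : ℝ) (B : ℕ),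
 EngineHyps5 2 η f x₀ s hmax R Hs B →
   ∃ (j : ℕ) (u : ℂ), (j : ℝ) ≤ 4 * hmax / s + (Hs / s) ^ 2 + B ∧ |u.re - x₀| ≤ (j + 2) * R / 2 ∧
     iteratedDeriv j f ≠ 0 ∧ iteratedDeriv j f u = 0 ∧ u.im ≠ 0 ∧ Iso (iteratedDeriv j f) Hs R u



def WindowSig (Iso : (ℂ → ℂ) → ℝ → ℝ → ℂ → Prop) : Prop := ∀ (g : ℂ → ℂ) (Hs R : ℝ) (u : ℂ),
 InClass g Hs → g ≠ 0 → g u = 0 → u.im ≠ 0 → Iso g Hs R u →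
   ∃ (α β H : ℝ), u.re - R / 2 ≤ α ∧ β ≤ u.re + R / 2 ∧ SignWindow g α β H


theorem descentSigS_of_budget_window (Iso : (ℂ → ℂ) → ℝ → ℝ → ℂ → Prop)
   (hB : BudgetSig Iso) (hW : WindowSig Iso) (hHer : AnalyticHereditySig) : DescentSigS := by
 intro η f x₀ s hmax R Hs B hE
 have hE' := hE
 obtain ⟨hdiff, hreal, hgrowth, hs, hsh, hhR, h3R, hHs, hstrip, hHsR, hpair, hcol, hhalf, hη0, hη1, hrem⟩ := hE'
 obtain ⟨j, u, hj, hu, hnz, hzu, huim, hiso⟩ := hB η f x₀ s hmax R Hs B hE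
 have hCj : InClass (iteratedDeriv j f) Hs := hHer f Hs j hHs ⟨hdiff, hreal, hgrowth, hstrip⟩ hnz
 obtain ⟨α, β, H, hα, hβ, hSW⟩ := hW _ Hs R u hCj hnz hzu huim hiso
 refine ⟨j, α, β, H, hj, ?_, ?_, hnz, hSW⟩
 · have h1 := (abs_le.1 hu).1
   linarith
 · have h2 := (abs_le.1 hu).2
   linarith


theorem law421_of_budget_window (Iso : (ℂ → ℂ) → ℝ → ℝ → ℂ → Prop)
   (hB : BudgetSig Iso) (hW : WindowSig Iso) (hHer : AnalyticHereditySig) : TiltedLandingLaw421 :=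
 law421_ofS (descentSigS_of_budget_window Iso hB hW hHer) hHer






def ScaleIsolated (K : ℝ) (g : ℂ → ℂ) (Hs R : ℝ) (u : ℂ) : Prop :=
 K * |u.im| ≤ R / 2 ∧
   (∀ v : ℂ, g v = 0 → v ≠ u → v ≠ (starRingEnd ℂ) u → |v.re - u.re| < K * |u.im| → v.im = 0 ∨ K * |u.im| ≤ |v.im|) ∧
   (∀ ρ : ℂ, deriv g ρ = 0 → |ρ.re - u.re| < K * |u.im| → |ρ.im| < K * |u.im| → ρ.im = 0)









end RhIdea6.G18.W07C8.Law421BirthS.Split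


















namespace RhIdea3.G21.W07C9.Iso

open Complex Metric


def IsoDom (g : ℂ → ℂ) (Hs R : ℝ) (u : ℂ) : Prop :=
 0 < u.im ∧ 6 * u.im ≤ R ∧ u.im ≤ Hs ∧
 (∃ (h : ℂ → ℂ) (K K' : ℝ), Differentiable ℂ h ∧ (∀ x : ℝ, (h x).im = 0) ∧
     (∀ w, g w = ((w - u.re) ^ 2 + (u.im : ℂ) ^ 2) * h w) ∧
     (∀ z ∈ closedBall (u.re : ℂ) u.im, h z ≠ 0) ∧
     (∀ z ∈ closedBall (u.re : ℂ) u.im, ‖deriv h z / h z‖ ≤ K) ∧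
     (∀ z ∈ closedBall (u.re : ℂ) u.im, ‖deriv (fun w ↦ deriv h w / h w) z‖ ≤ K') ∧
     K * u.im + K' * u.im ^ 2 < 1) ∧
 (∀ w, deriv g w = 0 → |w.re - u.re| < 3 * u.im → |w.im| < 2 * u.im → w.im ≠ 0 →
     ‖w - u.re‖ ≤ u.im) ∧
 (∃ V : Finset ℂ,
     (∀ v, g v = 0 → 0 < v.im → v ≠ u → |v.re - u.re| < v.im + 3 * u.im →
         v ∈ V ∧ 2 * u.im < v.im) ∧
     ∑ v ∈ V, ((analyticOrderAt g v).toNat : ℝ) * (2 * v.im ^ 2 / (v.im - 2 * u.im) ^ 4)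
       < 1 / (54 * u.im ^ 2))

end RhIdea3.G21.W07C9.Iso

namespace RhIdea6.G18.W07C8.Law421BirthS.Split

open Set Complex Metric
open RhIdea6.G17.W07C7 RhIdea6.G17.W07C7.Rev6 RhIdea6.G18.W07C8.Law421BirthS RhIdea3.G21.W07C9.Iso


theorem budgetSig_mono {Iso₁ Iso₂ : (ℂ → ℂ) → ℝ → ℝ → ℂ → Prop}
   (hI : ∀ g Hs R u, Iso₁ g Hs R u → Iso₂ g Hs R u) (hB : BudgetSig Iso₁) : BudgetSig Iso₂ := by
 intro η f x₀ s hmax R Hs B hE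
 obtain ⟨j, u, hj, hu, hnz, hzu, huim, hiso⟩ := hB η f x₀ s hmax R Hs B hE
 exact ⟨j, u, hj, hu, hnz, hzu, huim, hI _ _ _ _ hiso⟩


theorem windowSig_anti {Iso₁ Iso₂ : (ℂ → ℂ) → ℝ → ℝ → ℂ → Prop}
   (hI : ∀ g Hs R u, Iso₁ g Hs R u → Iso₂ g Hs R u) (hW : WindowSig Iso₂) : WindowSig Iso₁ :=
 fun g Hs R u hC hnz hzu huim hiso => hW g Hs R u hC hnz hzu huim (hI _ _ _ _ hiso)




def IsoDomC (g : ℂ → ℂ) (Hs R : ℝ) (u : ℂ) : Prop :=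
 0 < u.im ∧ 6 * u.im ≤ R ∧ u.im ≤ Hs ∧
 (∃ (h : ℂ → ℂ), Differentiable ℂ h ∧ (∀ x : ℝ, (h x).im = 0) ∧
     (∀ w, g w = ((w - u.re) ^ 2 + (u.im : ℂ) ^ 2) * h w) ∧
     (∀ z ∈ closedBall (u.re : ℂ) u.im, h z ≠ 0)) ∧
 (∀ w, deriv g w = 0 → |w.re - u.re| < 3 * u.im → |w.im| < 2 * u.im → w.im = 0) ∧
 (∃ V : Finset ℂ,
     (∀ v, g v = 0 → 0 < v.im → v ≠ u → |v.re - u.re| < v.im + 3 * u.im →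
         v ∈ V ∧ 2 * u.im < v.im) ∧
     ∑ v ∈ V, ((analyticOrderAt g v).toNat : ℝ) * (2 * v.im ^ 2 / (v.im - 2 * u.im) ^ 4)
       < 1 / (54 * u.im ^ 2))



theorem isoDomC_of_isoDom
   (hL : ∀ (g h : ℂ → ℂ) (a ε K K' : ℝ), 0 < ε → Differentiable ℂ h → (∀ x : ℝ, (h x).im = 0) →
     (∀ w, g w = ((w - a) ^ 2 + (ε : ℂ) ^ 2) * h w) → (∀ z ∈ closedBall (a : ℂ) ε, h z ≠ 0) →
     (∀ z ∈ closedBall (a : ℂ) ε, ‖deriv h z / h z‖ ≤ K) →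
     (∀ z ∈ closedBall (a : ℂ) ε, ‖deriv (fun w ↦ deriv h w / h w) z‖ ≤ K') → K * ε + K' * ε ^ 2 < 1 →
     ∀ w, deriv g w = 0 → ‖w - a‖ ≤ ε → w.im = 0)
   (g : ℂ → ℂ) (Hs R : ℝ) (u : ℂ) (hI : IsoDom g Hs R u) : IsoDomC g Hs R u := by
 obtain ⟨hε, hR, hHs, ⟨h, K, K', hhd, hhr, hfac, hnz, hK, hK', hcrit⟩, hdesc, hdom⟩ := hI
 refine ⟨hε, hR, hHs, ⟨h, hhd, hhr, hfac, hnz⟩, ?_, hdom⟩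
 intro w hw hre him
 by_contra hne
 have hdisc : ‖w - u.re‖ ≤ u.im := hdesc w hw hre him hne
 exact hne (hL g h u.re u.im K K' hε hhd hhr hfac hnz hK hK' hcrit w hw hdisc)



theorem budgetSig_isoDomC_of_isoDom
   (hL : ∀ (g h : ℂ → ℂ) (a ε K K' : ℝ), 0 < ε → Differentiable ℂ h → (∀ x : ℝ, (h x).im = 0) →
     (∀ w, g w = ((w - a) ^ 2 + (ε : ℂ) ^ 2) * h w) → (∀ z ∈ closedBall (a : ℂ) ε, h z ≠ 0) →
     (∀ z ∈ closedBall (a : ℂ) ε, ‖deriv h z / h z‖ ≤ K) →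
     (∀ z ∈ closedBall (a : ℂ) ε, ‖deriv (fun w ↦ deriv h w / h w) z‖ ≤ K') → K * ε + K' * ε ^ 2 < 1 →
     ∀ w, deriv g w = 0 → ‖w - a‖ ≤ ε → w.im = 0)
   (hB : BudgetSig IsoDom) : BudgetSig IsoDomC :=
 budgetSig_mono (fun g Hs R u hI => isoDomC_of_isoDom hL g Hs R u hI) hB








theorem law421_of_splitDomC (hB : BudgetSig IsoDomC) (hW : WindowSig IsoDomC) (hHer : AnalyticHereditySig) : TiltedLandingLaw421 :=
 law421_of_budget_window IsoDomC hB hW hHer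




end RhIdea6.G18.W07C8.Law421BirthS.Split








namespace RhIdea6.G18.W07C8.Law421BirthS

open Set Complex
open RhIdea6.G17.W07C7 RhIdea6.G17.W07C7.Rev6



theorem law421_tree_iff : Summit.RiemannHypothesis.RiemannHypothesis.Theses.EarlyAppointments.TiltedLandingLaw421 ↔ TiltedLandingLaw421 := by
 constructor
 · intro h η f x₀ s hmax R Hs B hE
   obtain ⟨hdiff, hreal, hgrowth, hs, hsh, hhR, h3R, hHs, hstrip, hHsR, hpair, hcol, hhalf, hη0, hη1, hrem⟩ := hE
   obtain ⟨k, hk, x, hx, hNL⟩ := h η f x₀ s hmax R Hs B hdiff hreal hgrowth hs hsh hhR h3R hHs hstrip hHsR hpair hcol hhalf hη0 hη1 hrem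
   exact ⟨k, by linarith, x, hx, hNL⟩
 · intro h η f x₀ s hmax R Hs B hdiff hreal hgrowth hs hsh hhR h3R hHs hstrip hHsR hpair hcol hhalf hη0 hη1 hrem
   obtain ⟨k, hk, x, hx, hNL⟩ := h η f x₀ s hmax R Hs B
     ⟨hdiff, hreal, hgrowth, hs, hsh, hhR, h3R, hHs, hstrip, hHsR, hpair, hcol, hhalf, hη0, hη1, hrem⟩
   exact ⟨k, by linarith, x, hx, hNL⟩



private theorem law421T_ofS (hDesc : DescentSigS) (hHer : AnalyticHereditySig) :
   Summit.RiemannHypothesis.RiemannHypothesis.Theses.EarlyAppointments.TiltedLandingLaw421 :=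
 law421_tree_iff.mpr (law421_ofS hDesc hHer)


private theorem law421T_of_budget_window (Iso : (ℂ → ℂ) → ℝ → ℝ → ℂ → Prop)
   (hB : Split.BudgetSig Iso) (hW : Split.WindowSig Iso) (hHer : AnalyticHereditySig) :
   Summit.RiemannHypothesis.RiemannHypothesis.Theses.EarlyAppointments.TiltedLandingLaw421 :=
 law421_tree_iff.mpr (Split.law421_of_budget_window Iso hB hW hHer)














private theorem law421T_of_splitDomC (hB : Split.BudgetSig Split.IsoDomC) (hW : Split.WindowSig Split.IsoDomC) (hHer : AnalyticHereditySig) :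
   Summit.RiemannHypothesis.RiemannHypothesis.Theses.EarlyAppointments.TiltedLandingLaw421 :=
 law421T_of_budget_window Split.IsoDomC hB hW hHer





end RhIdea6.G18.W07C8.Law421BirthS























































namespace RhIdea5.G17.W07C9.Helpers

open Set Complex
open Summit.RiemannHypothesis.RiemannHypothesis.Theorems.Splittings.JensenWindow (LocalA)




def RemainderBox (η : ℝ) (f : ℂ → ℂ) (x₀ s hmax R : ℝ) : Prop :=
 ∀ w : ℂ, |w.re - x₀| ≤ R / 2 → |w.im| ≤ hmax → f w ≠ 0 →
   ‖deriv f w / f w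
       - ∑ᶠ u ∈ {u : ℂ | f u = 0 ∧ |u.re - w.re| < R / 2}, ((analyticOrderAt f u).toNat : ℂ) * (w - u)⁻¹‖ ≤ η / s


def ColumnBudgetMult (B : ℕ) (f : ℂ → ℂ) (x₀ s R : ℝ) : Prop :=
 ∀ r : ℝ, s ≤ r → r ≤ R →
   (∑ᶠ u ∈ {u : ℂ | f u = 0 ∧ |u.re - x₀| ≤ r}, ((analyticOrderAt f u).toNat : ℝ)) - 2 * r / s ≤ B


def HalfSlabBudget (B : ℕ) (f : ℂ → ℂ) (x₀ s R : ℝ) : Prop :=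
 ∀ r : ℝ, s ≤ r → r ≤ R →
   |(∑ᶠ u ∈ {u : ℂ | f u = 0 ∧ x₀ < u.re ∧ u.re ≤ x₀ + r}, ((analyticOrderAt f u).toNat : ℝ)) - r / s| ≤ 1 + B ∧
   |(∑ᶠ u ∈ {u : ℂ | f u = 0 ∧ x₀ - r ≤ u.re ∧ u.re < x₀}, ((analyticOrderAt f u).toNat : ℝ)) - r / s| ≤ 1 + B


def EngineHyps5 (C η : ℝ) (f : ℂ → ℂ) (x₀ s hmax R Hs : ℝ) (B : ℕ) : Prop :=
 Differentiable ℂ f ∧ (∀ x : ℝ, (f (x : ℂ)).im = 0) ∧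
   (∃ A' B' ρ : ℝ, ρ < 2 ∧ ∀ z : ℂ, ‖f z‖ ≤ A' * Real.exp (B' * ‖z‖ ^ ρ)) ∧
   0 < s ∧ C * s ≤ hmax ∧ C * hmax ≤ R ∧ 3 * hmax < R ∧ 0 ≤ Hs ∧ (∀ w : ℂ, f w = 0 → |w.im| ≤ Hs) ∧ C * Hs ≤ R ∧
   (∃ w₀ : ℂ, f w₀ = 0 ∧ w₀.im ≠ 0 ∧ w₀.re = x₀ ∧ |w₀.im| ≤ hmax) ∧
   ColumnBudgetMult B f x₀ s R ∧ HalfSlabBudget B f x₀ s R ∧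
   0 ≤ η ∧ C * η ≤ 1 ∧ RemainderBox η f x₀ s hmax R


def InClass (g : ℂ → ℂ) (Hs : ℝ) : Prop :=
 Differentiable ℂ g ∧ (∀ t : ℝ, (g (t : ℂ)).im = 0) ∧
   (∃ A' B' ρ : ℝ, ρ < 2 ∧ ∀ z : ℂ, ‖g z‖ ≤ A' * Real.exp (B' * ‖z‖ ^ ρ)) ∧
   (∀ w : ℂ, g w = 0 → |w.im| ≤ Hs)


def OffJensenDiscs (g : ℂ → ℂ) (p : ℂ) : Prop :=
 ∀ u : ℂ, g u = 0 → u.im ≠ 0 → u.im ^ 2 < (p.re - u.re) ^ 2 + p.im ^ 2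


def SignWindow (g : ℂ → ℂ) (α β H : ℝ) : Prop :=
 α < β ∧ 0 < H ∧ g α ≠ 0 ∧ g β ≠ 0 ∧ deriv g α ≠ 0 ∧ deriv g β ≠ 0 ∧
   (∀ x ∈ Icc α β, (deriv g ((x : ℂ) + (H : ℂ) * I) / g ((x : ℂ) + (H : ℂ) * I)).im < 0) ∧
   (∀ y ∈ Ioc (0 : ℝ) H, (deriv g ((α : ℂ) + (y : ℂ) * I) / g ((α : ℂ) + (y : ℂ) * I)).im < 0) ∧
   (∀ y ∈ Ioc (0 : ℝ) H, (deriv g ((β : ℂ) + (y : ℂ) * I) / g ((β : ℂ) + (y : ℂ) * I)).im < 0) ∧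
   LocalA g α β H ∧ (∃ ρ ∈ Ioo α β ×ℂ Ioo (-H) H, g ρ = 0 ∧ ρ.im ≠ 0)


def DescentSigS : Prop := ∀ (η : ℝ) (f : ℂ → ℂ) (x₀ s hmax R Hs : ℝ) (B : ℕ),
 EngineHyps5 2 η f x₀ s hmax R Hs B →
   ∃ (j : ℕ) (α β H : ℝ), (j : ℝ) ≤ 4 * hmax / s + (Hs / s) ^ 2 + B ∧
     x₀ - (j + 3) * R / 2 ≤ α ∧ β ≤ x₀ + (j + 3) * R / 2 ∧
     iteratedDeriv j f ≠ 0 ∧ SignWindow (iteratedDeriv j f) α β H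


def OffJensenSignSig : Prop := ∀ (g : ℂ → ℂ) (Hs : ℝ) (p : ℂ),
 InClass g Hs → g ≠ 0 → (∃ u : ℂ, g u = 0) → 0 < p.im → OffJensenDiscs g p → (deriv g p / g p).im < 0


def AnalyticHereditySig : Prop := ∀ (f : ℂ → ℂ) (Hs : ℝ) (j : ℕ),
 0 ≤ Hs → InClass f Hs → iteratedDeriv j f ≠ 0 → InClass (iteratedDeriv j f) Hs


lemma im_ofReal_add_mul_I (a y : ℝ) : ((a : ℂ) + (y : ℂ) * I).im = y := by simp







noncomputable def pairTerm (m : ℕ) (p u : ℂ) : ℝ :=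
 -2 * (m : ℝ) * p.im * ((p.re - u.re) ^ 2 + p.im ^ 2 - u.im ^ 2) /
   (Complex.normSq (p - u) * Complex.normSq (p - (starRingEnd ℂ) u))




def DominatedAt (g : ℂ → ℂ) (p : ℂ) : Prop :=
 ∃ (u₀ : ℂ) (S : Finset ℂ), g u₀ = 0 ∧ 0 < u₀.im ∧ u₀ ∉ S ∧ (∀ u ∈ S, 0 < u.im) ∧
   (∀ u : ℂ, g u = 0 → 0 < u.im → u ≠ u₀ → (p.re - u.re) ^ 2 + p.im ^ 2 ≤ u.im ^ 2 → u ∈ S) ∧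
   pairTerm (analyticOrderAt g u₀).toNat p u₀ + ∑ u ∈ S, pairTerm (analyticOrderAt g u).toNat p u < 0


def BoundaryOK (g : ℂ → ℂ) (p : ℂ) : Prop :=
 g p ≠ 0 ∧ (OffJensenDiscs g p ∨ DominatedAt g p)





def InDiscDominanceSig : Prop := ∀ (g : ℂ → ℂ) (Hs : ℝ) (p : ℂ),
 InClass g Hs → g ≠ 0 → 0 < p.im → g p ≠ 0 → DominatedAt g p → (deriv g p / g p).im < 0



def BudgetedLandingSig : Prop := ∀ (η : ℝ) (f : ℂ → ℂ) (x₀ s hmax R Hs : ℝ) (B : ℕ),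
 EngineHyps5 2 η f x₀ s hmax R Hs B →
   ∃ (j : ℕ) (α β H : ℝ), (j : ℝ) ≤ 4 * hmax / s + (Hs / s) ^ 2 + B ∧
     x₀ - (j + 3) * R / 2 ≤ α ∧ β ≤ x₀ + (j + 3) * R / 2 ∧
     iteratedDeriv j f ≠ 0 ∧ α < β ∧ 0 < H ∧
     iteratedDeriv j f α ≠ 0 ∧ iteratedDeriv j f β ≠ 0 ∧
     deriv (iteratedDeriv j f) α ≠ 0 ∧ deriv (iteratedDeriv j f) β ≠ 0 ∧
     LocalA (iteratedDeriv j f) α β H ∧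
     (∃ ρ ∈ Ioo α β ×ℂ Ioo (-H) H, iteratedDeriv j f ρ = 0 ∧ ρ.im ≠ 0) ∧
     (∀ x ∈ Icc α β, BoundaryOK (iteratedDeriv j f) ((x : ℂ) + (H : ℂ) * I)) ∧
     (∀ y ∈ Ioc (0 : ℝ) H, BoundaryOK (iteratedDeriv j f) ((α : ℂ) + (y : ℂ) * I)) ∧
     (∀ y ∈ Ioc (0 : ℝ) H, BoundaryOK (iteratedDeriv j f) ((β : ℂ) + (y : ℂ) * I))



def PairTermCanopyBound : Prop := ∀ (m : ℕ) (p u : ℂ), 0 < p.im → 2 * p.im ≤ u.im →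
 pairTerm m p u ≤ 8 * (m : ℝ) * p.im / u.im ^ 2




def PairTermLanderBound : Prop := ∀ (m : ℕ) (p u₀ : ℂ), 0 < p.im → 0 < u₀.im → u₀.im ^ 2 ≤ (p.re - u₀.re) ^ 2 →
 pairTerm m p u₀ ≤ -2 * (m : ℝ) * p.im * ((p.re - u₀.re) ^ 2 - u₀.im ^ 2) / ((p.re - u₀.re) ^ 2 + (p.im + u₀.im) ^ 2) ^ 2




theorem sign_of_boundaryOK (hSign : OffJensenSignSig) (hDom : InDiscDominanceSig) {g : ℂ → ℂ} {Hs : ℝ}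
   (hcl : InClass g Hs) (hg : g ≠ 0) (hex : ∃ u : ℂ, g u = 0) {p : ℂ} (hp : 0 < p.im) (hok : BoundaryOK g p) :
   (deriv g p / g p).im < 0 := by
 rcases hok.2 with h | h
 · exact hSign g Hs p hcl hg hex hp h
 · exact hDom g Hs p hcl hg hp hok.1 h


theorem descentSigS_of_split (hSign : OffJensenSignSig) (hHer : AnalyticHereditySig)
   (hDom : InDiscDominanceSig) (hLand : BudgetedLandingSig) : DescentSigS := by
 intro η f x₀ s hmax R Hs B hE
 have hE' := hE
 obtain ⟨hdiff, hreal, hgrowth, hs, hsh, hhR, h3R, hHs, hstrip, hHsR, hpair, hcol, hhalf, hη0, hη1, hrem⟩ := hE'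
 have hC0 : InClass f Hs := ⟨hdiff, hreal, hgrowth, hstrip⟩
 obtain ⟨j, α, β, H, hj, hα, hβ, hnz, hlt, hH, hgα, hgβ, hdα, hdβ, hA, hz, htop, hleft, hright⟩ :=
   hLand η f x₀ s hmax R Hs B hE
 have hCj : InClass (iteratedDeriv j f) Hs := hHer f Hs j hHs hC0 hnz
 have hex : ∃ u : ℂ, iteratedDeriv j f u = 0 := by
   obtain ⟨ρ, -, hρ, -⟩ := hz
   exact ⟨ρ, hρ⟩
 refine ⟨j, α, β, H, hj, hα, hβ, hnz, hlt, hH, hgα, hgβ, hdα, hdβ, ?_, ?_, ?_, hA, hz⟩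
 · exact fun x hx ↦ sign_of_boundaryOK hSign hDom hCj hnz hex (by rw [im_ofReal_add_mul_I]; exact hH) (htop x hx)
 · exact fun y hy ↦ sign_of_boundaryOK hSign hDom hCj hnz hex (by rw [im_ofReal_add_mul_I]; exact hy.1) (hleft y hy)
 · exact fun y hy ↦ sign_of_boundaryOK hSign hDom hCj hnz hex (by rw [im_ofReal_add_mul_I]; exact hy.1) (hright y hy)











def BudgetSig (Iso : (ℂ → ℂ) → ℝ → ℝ → ℂ → Prop) : Prop := ∀ (η : ℝ) (f : ℂ → ℂ) (x₀ s hmax R Hs : ℝ) (B : ℕ),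
 EngineHyps5 2 η f x₀ s hmax R Hs B →
   ∃ (j : ℕ) (u : ℂ), (j : ℝ) ≤ 4 * hmax / s + (Hs / s) ^ 2 + B ∧ |u.re - x₀| ≤ (j + 2) * R / 2 ∧
     iteratedDeriv j f ≠ 0 ∧ iteratedDeriv j f u = 0 ∧ u.im ≠ 0 ∧ Iso (iteratedDeriv j f) Hs R u


def WindowSig (Iso : (ℂ → ℂ) → ℝ → ℝ → ℂ → Prop) : Prop := ∀ (g : ℂ → ℂ) (Hs R : ℝ) (u : ℂ),
 InClass g Hs → g ≠ 0 → g u = 0 → u.im ≠ 0 → Iso g Hs R u →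
   ∃ (α β H : ℝ), u.re - R / 2 ≤ α ∧ β ≤ u.re + R / 2 ∧ SignWindow g α β H




def OKBox (g : ℂ → ℂ) (_Hs R : ℝ) (u : ℂ) : Prop :=
 ∃ (α β H : ℝ), u.re - R / 2 ≤ α ∧ β ≤ u.re + R / 2 ∧ α < β ∧ 0 < H ∧
   g α ≠ 0 ∧ g β ≠ 0 ∧ deriv g α ≠ 0 ∧ deriv g β ≠ 0 ∧ LocalA g α β H ∧
   (∃ ρ ∈ Ioo α β ×ℂ Ioo (-H) H, g ρ = 0 ∧ ρ.im ≠ 0) ∧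
   (∀ x ∈ Icc α β, BoundaryOK g ((x : ℂ) + (H : ℂ) * I)) ∧
   (∀ y ∈ Ioc (0 : ℝ) H, BoundaryOK g ((α : ℂ) + (y : ℂ) * I)) ∧
   (∀ y ∈ Ioc (0 : ℝ) H, BoundaryOK g ((β : ℂ) + (y : ℂ) * I))


theorem windowSig_OKBox (hSign : OffJensenSignSig) (hDom : InDiscDominanceSig) : WindowSig OKBox := by
 intro g Hs R u hcl hg hzu _huim hiso
 obtain ⟨α, β, H, hα, hβ, hlt, hH, hgα, hgβ, hdα, hdβ, hA, hz, htop, hleft, hright⟩ := hiso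
 have hex : ∃ v : ℂ, g v = 0 := ⟨u, hzu⟩
 refine ⟨α, β, H, hα, hβ, hlt, hH, hgα, hgβ, hdα, hdβ, ?_, ?_, ?_, hA, hz⟩
 · exact fun x hx ↦ sign_of_boundaryOK hSign hDom hcl hg hex (by rw [im_ofReal_add_mul_I]; exact hH) (htop x hx)
 · exact fun y hy ↦ sign_of_boundaryOK hSign hDom hcl hg hex (by rw [im_ofReal_add_mul_I]; exact hy.1) (hleft y hy)
 · exact fun y hy ↦ sign_of_boundaryOK hSign hDom hcl hg hex (by rw [im_ofReal_add_mul_I]; exact hy.1) (hright y hy)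


theorem descentSigS_of_budget_window (Iso : (ℂ → ℂ) → ℝ → ℝ → ℂ → Prop)
   (hB : BudgetSig Iso) (hW : WindowSig Iso) (hHer : AnalyticHereditySig) : DescentSigS := by
 intro η f x₀ s hmax R Hs B hE
 have hE' := hE
 obtain ⟨hdiff, hreal, hgrowth, hs, hsh, hhR, h3R, hHs, hstrip, hHsR, hpair, hcol, hhalf, hη0, hη1, hrem⟩ := hE'
 obtain ⟨j, u, hj, hu, hnz, hzu, huim, hiso⟩ := hB η f x₀ s hmax R Hs B hE
 have hCj : InClass (iteratedDeriv j f) Hs := hHer f Hs j hHs ⟨hdiff, hreal, hgrowth, hstrip⟩ hnz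
 obtain ⟨α, β, H, hα, hβ, hSW⟩ := hW _ Hs R u hCj hnz hzu huim hiso
 refine ⟨j, α, β, H, hj, ?_, ?_, hnz, hSW⟩
 · have h1 := (abs_le.1 hu).1
   linarith
 · have h2 := (abs_le.1 hu).2
   linarith


theorem descentSigS_of_budget_OKBox (hSign : OffJensenSignSig) (hHer : AnalyticHereditySig)
   (hDom : InDiscDominanceSig) (hB : BudgetSig OKBox) : DescentSigS :=
 descentSigS_of_budget_window OKBox hB (windowSig_OKBox hSign hDom) hHer






lemma normSq_sub_eq (p u : ℂ) : Complex.normSq (p - u) = (p.re - u.re) ^ 2 + (p.im - u.im) ^ 2 := by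
 rw [Complex.normSq_apply]; simp [sub_re, sub_im]; ring

lemma normSq_sub_conj_eq (p u : ℂ) :
   Complex.normSq (p - (starRingEnd ℂ) u) = (p.re - u.re) ^ 2 + (p.im + u.im) ^ 2 := by
 rw [Complex.normSq_apply]; simp [sub_re, sub_im, Complex.conj_re, Complex.conj_im]; ring


theorem pairTermLanderBound_holds : PairTermLanderBound := by
 intro m p u₀ hp hε hd
 unfold pairTerm
 rw [normSq_sub_eq, normSq_sub_conj_eq]
 set d2 := (p.re - u₀.re) ^ 2 with hd2
 set y := p.im with hy
 set e := u₀.im with he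
 have hK : 0 ≤ 2 * (m : ℝ) * y := by positivity
 have hN1 : 0 < d2 + (y - e) ^ 2 := by nlinarith [sq_nonneg (y - e), sq_nonneg e]
 have hN2 : 0 < d2 + (y + e) ^ 2 := by positivity
 have hN12 : d2 + (y - e) ^ 2 ≤ d2 + (y + e) ^ 2 := by nlinarith
 have hA : 0 ≤ d2 + y ^ 2 - e ^ 2 := by nlinarith [sq_nonneg y]
 have hB : d2 - e ^ 2 ≤ d2 + y ^ 2 - e ^ 2 := by nlinarith [sq_nonneg y]
 rw [div_le_div_iff₀ (mul_pos hN1 hN2) (pow_pos hN2 2)]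
 have h1 : (d2 - e ^ 2) * (d2 + (y - e) ^ 2) ≤ (d2 + y ^ 2 - e ^ 2) * (d2 + (y + e) ^ 2) :=
   mul_le_mul hB hN12 hN1.le hA
 have h2 : 2 * (m : ℝ) * y * ((d2 + (y + e) ^ 2) * ((d2 - e ^ 2) * (d2 + (y - e) ^ 2))) ≤
     2 * (m : ℝ) * y * ((d2 + (y + e) ^ 2) * ((d2 + y ^ 2 - e ^ 2) * (d2 + (y + e) ^ 2))) :=
   mul_le_mul_of_nonneg_left (mul_le_mul_of_nonneg_left h1 hN2.le) hK
 nlinarith [h2]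


theorem pairTermCanopyBound_holds : PairTermCanopyBound := by
 intro m p u hp hb
 unfold pairTerm
 rw [normSq_sub_eq, normSq_sub_conj_eq]
 set d2 := (p.re - u.re) ^ 2 with hd2
 set y := p.im with hy
 set b := u.im with hb'
 have hbpos : 0 < b := by linarith
 have hd2nn : 0 ≤ d2 := by rw [hd2]; positivity
 have hK : 0 ≤ 2 * (m : ℝ) * y := by positivity
 have hN1 : b ^ 2 / 4 ≤ d2 + (y - b) ^ 2 := by nlinarith [sq_nonneg (y - b)]
 have hN1pos : 0 < d2 + (y - b) ^ 2 := by nlinarith [sq_nonneg b]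
 have hN2 : b ^ 2 ≤ d2 + (y + b) ^ 2 := by nlinarith
 have hN2pos : 0 < d2 + (y + b) ^ 2 := by positivity
 have hprod : b ^ 2 / 4 * b ^ 2 ≤ (d2 + (y - b) ^ 2) * (d2 + (y + b) ^ 2) :=
   mul_le_mul hN1 hN2 (by positivity) hN1pos.le
 rw [div_le_div_iff₀ (mul_pos hN1pos hN2pos) (pow_pos hbpos 2)]
 have h3 : 2 * (m : ℝ) * y * (b ^ 2 / 4 * b ^ 2) ≤ 2 * (m : ℝ) * y * ((d2 + (y - b) ^ 2) * (d2 + (y + b) ^ 2)) :=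
   mul_le_mul_of_nonneg_left hprod hK
 have h4 : 0 ≤ 2 * (m : ℝ) * y * (d2 + y ^ 2) * b ^ 2 := by positivity
 nlinarith [h3, h4]




end RhIdea5.G17.W07C9.Helpers



namespace RhIdea6.G18.W07C8.Law421BirthS.OKBoxLine

open Set Complex
open RhIdea6.G17.W07C7 RhIdea6.G17.W07C7.Rev6 RhIdea6.G18.W07C8.Law421BirthS


theorem windowSig_OKBox (hSign : OffJensenSignSig) (hDom : RhIdea5.G17.W07C9.Helpers.InDiscDominanceSig) :
   Split.WindowSig RhIdea5.G17.W07C9.Helpers.OKBox :=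
 RhIdea5.G17.W07C9.Helpers.windowSig_OKBox hSign hDom




private theorem law421T_of_OKBox (hSign : OffJensenSignSig) (hDom : RhIdea5.G17.W07C9.Helpers.InDiscDominanceSig)
   (hB : Split.BudgetSig RhIdea5.G17.W07C9.Helpers.OKBox) (hHer : AnalyticHereditySig) :
   Summit.RiemannHypothesis.RiemannHypothesis.Theses.EarlyAppointments.TiltedLandingLaw421 :=
 law421T_of_budget_window RhIdea5.G17.W07C9.Helpers.OKBox hB (windowSig_OKBox hSign hDom) hHer





end RhIdea6.G18.W07C8.Law421BirthS.OKBoxLine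








open Complex Metric Set
open scoped ComplexConjugate

namespace RhIdea3.G21.W07C9.Landing

theorem hasDerivAt_quad (a ε : ℝ) (z : ℂ) :
   HasDerivAt (fun w : ℂ ↦ (w - a) ^ 2 + (ε : ℂ) ^ 2) (2 * (z - a)) z := by
 have h0 : HasDerivAt (fun w : ℂ ↦ (w - a) ^ 2) (((2 : ℕ) : ℂ) * (z - a) ^ (2 - 1) * 1) z :=
   ((hasDerivAt_id' z).sub_const (a : ℂ)).pow 2
 have h1 : HasDerivAt (fun w : ℂ ↦ (w - a) ^ 2) (2 * (z - a)) z :=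
   h0.congr_deriv (by norm_num)
 exact h1.add_const _

theorem hasDerivAt_pairMul {h : ℂ → ℂ} (hh : Differentiable ℂ h) (a ε : ℝ) (z : ℂ) :
   HasDerivAt (fun w : ℂ ↦ ((w - a) ^ 2 + (ε : ℂ) ^ 2) * h w)
     (2 * (z - a) * h z + ((z - a) ^ 2 + (ε : ℂ) ^ 2) * deriv h z) z := by
 exact (hasDerivAt_quad a ε z).mul (hh z).hasDerivAt






theorem landing_real {h : ℂ → ℂ} {a ε ρ K K' : ℝ} (hh : Differentiable ℂ h)
   (hreal : ∀ x : ℝ, (h x).im = 0) (hρ : 0 < ρ)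
   (h0 : ∀ z ∈ closedBall (a : ℂ) ρ, h z ≠ 0)
   (hK : ∀ z ∈ closedBall (a : ℂ) ρ, ‖deriv h z / h z‖ ≤ K)
   (hK' : ∀ z ∈ closedBall (a : ℂ) ρ, ‖deriv (fun w ↦ deriv h w / h w) z‖ ≤ K')
   (hε : 0 ≤ ε) (hερ : ε ≤ ρ) (hL : K * ρ + K' * ρ ^ 2 < 1)
   {z : ℂ} (hz : z ∈ closedBall (a : ℂ) ρ)
   (hcrit : deriv (fun w : ℂ ↦ ((w - a) ^ 2 + (ε : ℂ) ^ 2) * h w) z = 0) : z.im = 0 := by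
 classical
 set g : ℂ → ℂ := fun w ↦ ((w - a) ^ 2 + (ε : ℂ) ^ 2) * h w with hg
 set r : ℂ → ℂ := fun w ↦ deriv h w / h w with hr
 set T : ℂ → ℂ := fun w ↦ -(((w - a) ^ 2 + (ε : ℂ) ^ 2) * r w) / 2 with hT

 have hgd : Differentiable ℂ g := fun w ↦ (hasDerivAt_pairMul hh a ε w).differentiableAt
 have hgreal : ∀ x : ℝ, (g x).im = 0 := by
   intro x
   have e : ((x : ℂ) - a) ^ 2 + (ε : ℂ) ^ 2 = (((x - a) ^ 2 + ε ^ 2 : ℝ) : ℂ) := by push_cast; ring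
   show ((((x : ℂ) - a) ^ 2 + (ε : ℂ) ^ 2) * h x).im = 0
   rw [e, Complex.im_ofReal_mul, hreal x, mul_zero]
 have hgd' : Differentiable ℂ (deriv g) := by
   have := Literature.Analysis.Complex.differentiable_iteratedDeriv_of_entire hgd 1
   simpa [iteratedDeriv_one] using this
 have hg'real : ∀ x : ℝ, (deriv g x).im = 0 := fun x ↦
   Literature.Analysis.Complex.im_deriv_ofReal hgd hgreal x

 have hfix : ∀ w ∈ closedBall (a : ℂ) ρ, deriv g w = 0 → w - a = T w := by
   intro w hw hw0
   have hd : deriv g w = 2 * (w - a) * h w + ((w - a) ^ 2 + (ε : ℂ) ^ 2) * deriv h w :=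
     (hasDerivAt_pairMul hh a ε w).deriv
   have hhw : h w ≠ 0 := h0 w hw
   rw [hd] at hw0
   show w - a = -(((w - a) ^ 2 + (ε : ℂ) ^ 2) * (deriv h w / h w)) / 2
   field_simp
   linear_combination hw0

 have hzc : conj z ∈ closedBall (a : ℂ) ρ := by
   rw [mem_closedBall, dist_eq_norm] at hz ⊢
   have : conj z - (a : ℂ) = conj (z - a) := by rw [map_sub, Complex.conj_ofReal]
   rwa [this, Complex.norm_conj]
 have hcrit' : deriv g (conj z) = 0 := by
   rw [Literature.Analysis.Complex.apply_conj_eq_conj hgd' hg'real z, hcrit, map_zero]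

 have hdh : Differentiable ℂ (deriv h) := by
   have := Literature.Analysis.Complex.differentiable_iteratedDeriv_of_entire hh 1
   simpa [iteratedDeriv_one] using this
 have hrd : ∀ w ∈ closedBall (a : ℂ) ρ, HasDerivAt r (deriv r w) w := fun w hw ↦
   ((hdh w).div (hh w) (h0 w hw)).hasDerivAt
 have hTd : ∀ w ∈ closedBall (a : ℂ) ρ,
     HasDerivAt T (-((2 * (w - a)) * r w + ((w - a) ^ 2 + (ε : ℂ) ^ 2) * deriv r w) / 2) w := by
   intro w hw
   exact (((hasDerivAt_quad a ε w).mul (hrd w hw)).neg).div_const 2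
 have hρ0 : 0 ≤ ρ := hρ.le
 have hTb : ∀ w ∈ closedBall (a : ℂ) ρ, ‖deriv T w‖ ≤ K * ρ + K' * ρ ^ 2 := by
   intro w hw
   rw [(hTd w hw).deriv]
   have hwa : ‖w - a‖ ≤ ρ := by rwa [mem_closedBall, dist_eq_norm] at hw
   have hq : ‖(w - a) ^ 2 + (ε : ℂ) ^ 2‖ ≤ 2 * ρ ^ 2 := by
     calc ‖(w - a) ^ 2 + (ε : ℂ) ^ 2‖ ≤ ‖(w - a) ^ 2‖ + ‖(ε : ℂ) ^ 2‖ := norm_add_le _ _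
       _ = ‖w - a‖ ^ 2 + ε ^ 2 := by
           rw [norm_pow, norm_pow, Complex.norm_real, Real.norm_eq_abs, sq_abs]
       _ ≤ ρ ^ 2 + ρ ^ 2 := by gcongr
       _ = 2 * ρ ^ 2 := by ring
   have hrw : ‖r w‖ ≤ K := hK w hw
   have hr'w : ‖deriv r w‖ ≤ K' := hK' w hw
   calc ‖-((2 * (w - a)) * r w + ((w - a) ^ 2 + (ε : ℂ) ^ 2) * deriv r w) / 2‖
       = ‖(2 * (w - a)) * r w + ((w - a) ^ 2 + (ε : ℂ) ^ 2) * deriv r w‖ / 2 := by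
         rw [norm_div, norm_neg]
         norm_num
     _ ≤ (‖(2 * (w - a)) * r w‖ + ‖((w - a) ^ 2 + (ε : ℂ) ^ 2) * deriv r w‖) / 2 := by
         gcongr
         exact norm_add_le _ _
     _ = (2 * ‖w - a‖ * ‖r w‖ + ‖(w - a) ^ 2 + (ε : ℂ) ^ 2‖ * ‖deriv r w‖) / 2 := by
         rw [norm_mul, norm_mul, norm_mul]
         norm_num
     _ ≤ (2 * ρ * K + (2 * ρ ^ 2) * K') / 2 := by gcongr
     _ = K * ρ + K' * ρ ^ 2 := by ring
 have hLip : ‖T (conj z) - T z‖ ≤ (K * ρ + K' * ρ ^ 2) * ‖conj z - z‖ :=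
   (convex_closedBall (a : ℂ) ρ).norm_image_sub_le_of_norm_deriv_le
     (fun w hw ↦ (hTd w hw).differentiableAt) hTb hz hzc

 have e1 : z - a = T z := hfix z hz hcrit
 have e2 : conj z - a = T (conj z) := hfix (conj z) hzc hcrit'
 have e3 : conj z - z = T (conj z) - T z := by linear_combination e2 - e1
 have hn : ‖conj z - z‖ ≤ (K * ρ + K' * ρ ^ 2) * ‖conj z - z‖ := by
   calc ‖conj z - z‖ = ‖T (conj z) - T z‖ := by rw [e3]
     _ ≤ (K * ρ + K' * ρ ^ 2) * ‖conj z - z‖ := hLip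
 have h0n : ‖conj z - z‖ = 0 := by
   nlinarith [norm_nonneg (conj z - z)]
 have hzz : conj z = z := by
   rwa [norm_eq_zero, sub_eq_zero] at h0n
 exact Complex.conj_eq_iff_im.1 hzz

end RhIdea3.G21.W07C9.Landing





namespace RhW07.C11.DescentSplit.C3

open Set Complex Metric
open Summit.RiemannHypothesis.RiemannHypothesis.Theorems.Splittings.JensenWindow (LocalA)
open RhIdea6.G17.W07C7 RhIdea6.G17.W07C7.Rev6 RhIdea6.G18.W07C8.Law421BirthS



def PairFactor (g h : ℂ → ℂ) (a ε : ℝ) : Prop :=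
 Differentiable ℂ h ∧ (∀ x : ℝ, (h x).im = 0) ∧ ∀ z : ℂ, g z = ((z - a) ^ 2 + (ε : ℂ) ^ 2) * h z



def LandingReady (h : ℂ → ℂ) (a ρ K K' : ℝ) : Prop :=
 0 < ρ ∧ (∀ z ∈ closedBall (a : ℂ) ρ, h z ≠ 0) ∧ (∀ z ∈ closedBall (a : ℂ) ρ, ‖deriv h z / h z‖ ≤ K) ∧
   (∀ z ∈ closedBall (a : ℂ) ρ, ‖deriv (fun w ↦ deriv h w / h w) z‖ ≤ K') ∧ K * ρ + K' * ρ ^ 2 < 1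




def JensenClearBox (g : ℂ → ℂ) (α β H a ρ : ℝ) : Prop :=
 ∀ z ∈ Ioo α β ×ℂ Ioo (-H) H, deriv g z = 0 → z.im ≠ 0 → z ∈ closedBall (a : ℂ) ρ




def BoxDominated (g : ℂ → ℂ) (α β H : ℝ) : Prop :=
 α < β ∧ 0 < H ∧ g α ≠ 0 ∧ g β ≠ 0 ∧ deriv g α ≠ 0 ∧ deriv g β ≠ 0 ∧
   (∀ x ∈ Icc α β, (deriv g ((x : ℂ) + (H : ℂ) * I) / g ((x : ℂ) + (H : ℂ) * I)).im < 0) ∧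
   (∀ y ∈ Ioc (0 : ℝ) H, (deriv g ((α : ℂ) + (y : ℂ) * I) / g ((α : ℂ) + (y : ℂ) * I)).im < 0) ∧
   (∀ y ∈ Ioc (0 : ℝ) H, (deriv g ((β : ℂ) + (y : ℂ) * I) / g ((β : ℂ) + (y : ℂ) * I)).im < 0) ∧
   (∃ ρ ∈ Ioo α β ×ℂ Ioo (-H) H, g ρ = 0 ∧ ρ.im ≠ 0)




def PLand : Prop := ∀ (g h : ℂ → ℂ) (a ε α β H ρ K K' : ℝ),
 PairFactor g h a ε → 0 ≤ ε → ε ≤ ρ → LandingReady h a ρ K K' → JensenClearBox g α β H a ρ →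
   BoxDominated g α β H → SignWindow g α β H

theorem pLand_holds : PLand := by
 intro g h a ε α β H ρ K K' hPF hε hερ hL hJ hD
 obtain ⟨hh, hreal, hfac⟩ := hPF
 obtain ⟨hρ, h0, hK, hK', hlt⟩ := hL
 obtain ⟨hab, hH, hgα, hgβ, hdα, hdβ, htop, hleft, hright, hz⟩ := hD
 refine ⟨hab, hH, hgα, hgβ, hdα, hdβ, htop, hleft, hright, ?_, hz⟩
 intro z hzbox hcrit
 by_contra him
 have hzball := hJ z hzbox hcrit him
 have hg : g = fun w : ℂ ↦ ((w - a) ^ 2 + (ε : ℂ) ^ 2) * h w := funext hfac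
 have hcrit' : deriv (fun w : ℂ ↦ ((w - a) ^ 2 + (ε : ℂ) ^ 2) * h w) z = 0 := by rw [← hg]; exact hcrit
 exact him (RhIdea3.G21.W07C9.Landing.landing_real hh hreal hρ h0 hK hK' hε hερ hlt hzball hcrit')








def PDrop : Prop := ∃ c₀ : ℝ, 0 < c₀ ∧ ∀ (g h : ℂ → ℂ) (a ε κ θ : ℝ),
 PairFactor g h a ε → 0 < ε → 0 < κ → 0 ≤ θ → 2 ≤ κ * ε → θ * ε ≤ c₀ →
   (∀ z ∈ closedBall (a : ℂ) (2 * ε), h z ≠ 0 ∧ ‖deriv h z / h z + κ‖ ≤ θ) →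
     ∃ z₁ : ℂ, deriv g z₁ = 0 ∧ ‖z₁ - a‖ ≤ 2 * ε ∧ 0 < z₁.im ∧ z₁.im ^ 2 ≤ ε ^ 2 - 1 / (2 * κ ^ 2)









def PDropC : Prop := ∃ C₀ c₀ : ℝ, 0 < C₀ ∧ 0 < c₀ ∧ ∀ (g h : ℂ → ℂ) (a ε θ : ℝ) (c : ℂ),
 PairFactor g h a ε → 0 < ε → 0 ≤ θ → 2 ≤ ‖c‖ * ε → θ ≤ c₀ * ‖c‖ →
   (∀ z ∈ closedBall (a : ℂ) (2 * ε), h z ≠ 0 ∧ ‖deriv h z / h z - c‖ ≤ θ) →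
     ∃ z₁ : ℂ, deriv g z₁ = 0 ∧ ‖z₁ - ((a : ℂ) + (ε : ℂ) * I - 1 / c)‖ ≤ 1 / (‖c‖ ^ 2 * ε) + C₀ * θ / ‖c‖ ^ 2



def PairAt (f : ℂ → ℂ) (j : ℕ) (x₀ R hmax : ℝ) (u : ℂ) : Prop :=
 iteratedDeriv j f u = 0 ∧ 0 < u.im ∧ |u.re - x₀| ≤ ((j : ℝ) + 2) * R / 2 ∧ u.im ≤ hmax ∧
   ∀ v : ℂ, iteratedDeriv j f v = 0 → v.im ≠ 0 → |v.re - u.re| < u.im → u.im ≤ |v.im|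



def ReadyAt (g : ℂ → ℂ) (u : ℂ) : Prop :=
 ∃ (h : ℂ → ℂ) (ρ K K' : ℝ), PairFactor g h u.re u.im ∧ u.im ≤ ρ ∧ LandingReady h u.re ρ K K'




def FrozenDownAt (c₀ d : ℝ) (g : ℂ → ℂ) (u : ℂ) : Prop :=
 ∃ (h : ℂ → ℂ) (c : ℂ) (θ : ℝ), PairFactor g h u.re u.im ∧ 0 ≤ θ ∧ 2 ≤ ‖c‖ * u.im ∧ θ ≤ c₀ * ‖c‖ ∧
   (-1 / c).im ≤ -d ∧ ∀ z ∈ closedBall (u.re : ℂ) (2 * u.im), h z ≠ 0 ∧ ‖deriv h z / h z - c‖ ≤ θ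







def PSurplus (c₀ μ : ℝ) : Prop := ∀ (η : ℝ) (f : ℂ → ℂ) (x₀ s hmax R Hs : ℝ) (B : ℕ),
 EngineHyps5 2 η f x₀ s hmax R Hs B →
   ∃ E : Finset ℕ, (E.card : ℝ) ≤ (Hs / s) ^ 2 + B ∧
     ∀ (j : ℕ) (u : ℂ), j ∉ E → iteratedDeriv j f ≠ 0 → PairAt f j x₀ R hmax u →
       ReadyAt (iteratedDeriv j f) u ∨ FrozenDownAt c₀ (μ * s) (iteratedDeriv j f) u





abbrev PHeld (c₀ μ : ℝ) : Prop := PSurplus c₀ μ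






def ClearBoxReadyAt (W : ℝ) (g : ℂ → ℂ) (u : ℂ) : Prop :=
 ∃ (h : ℂ → ℂ) (ρ K K' α β H : ℝ), PairFactor g h u.re u.im ∧ u.im ≤ ρ ∧ LandingReady h u.re ρ K K' ∧
   u.re - W ≤ α ∧ β ≤ u.re + W ∧ JensenClearBox g α β H u.re ρ ∧ BoxDominated g α β H

theorem readyAt_of_clearBoxReady {W : ℝ} {g : ℂ → ℂ} {u : ℂ} (hu : ClearBoxReadyAt W g u) : ReadyAt g u := by
 obtain ⟨h, ρ, K, K', α, β, H, hPF, hρ, hL, -, -, -, -⟩ := hu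
 exact ⟨h, ρ, K, K', hPF, hρ, hL⟩


theorem signWindow_of_clearBoxReady {W : ℝ} {g : ℂ → ℂ} {u : ℂ} (hu0 : 0 ≤ u.im) (hu : ClearBoxReadyAt W g u) :
   ∃ α β H : ℝ, u.re - W ≤ α ∧ β ≤ u.re + W ∧ SignWindow g α β H := by
 obtain ⟨h, ρ, K, K', α, β, H, hPF, hρ, hL, hα, hβ, hJ, hD⟩ := hu
 exact ⟨α, β, H, hα, hβ, pLand_holds g h u.re u.im α β H ρ K K' hPF hu0 hρ hL hJ hD⟩



def PSurplusBox (c₀ μ : ℝ) : Prop := ∀ (η : ℝ) (f : ℂ → ℂ) (x₀ s hmax R Hs : ℝ) (B : ℕ),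
 EngineHyps5 2 η f x₀ s hmax R Hs B →
   ∃ E : Finset ℕ, (E.card : ℝ) ≤ (Hs / s) ^ 2 + B ∧
     ∀ (j : ℕ) (u : ℂ), j ∉ E → iteratedDeriv j f ≠ 0 → PairAt f j x₀ R hmax u →
       ClearBoxReadyAt (R / 2) (iteratedDeriv j f) u ∨ FrozenDownAt c₀ (μ * s) (iteratedDeriv j f) u

theorem pSurplus_of_box {c₀ μ : ℝ} (hB : PSurplusBox c₀ μ) : PSurplus c₀ μ := by
 intro η f x₀ s hmax R Hs B hE
 obtain ⟨E, hcard, hEj⟩ := hB η f x₀ s hmax R Hs B hE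
 refine ⟨E, hcard, fun j u hj hne hP ↦ ?_⟩
 rcases hEj j u hj hne hP with hR | hF
 · exact Or.inl (readyAt_of_clearBoxReady hR)
 · exact Or.inr hF



theorem descent_exit_of_clearBoxReady {f : ℂ → ℂ} {j : ℕ} {x₀ R hmax : ℝ} {u : ℂ}
   (hP : PairAt f j x₀ R hmax u) (hu : ClearBoxReadyAt (R / 2) (iteratedDeriv j f) u) :
   ∃ α β H : ℝ, x₀ - ((j : ℝ) + 3) * R / 2 ≤ α ∧ β ≤ x₀ + ((j : ℝ) + 3) * R / 2 ∧
     SignWindow (iteratedDeriv j f) α β H := by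
 obtain ⟨-, hpos, hre, -, -⟩ := hP
 obtain ⟨α, β, H, hα, hβ, hW⟩ := signWindow_of_clearBoxReady hpos.le hu
 have h1 := (abs_le.1 hre).1
 have h2 := (abs_le.1 hre).2
 refine ⟨α, β, H, by linarith, by linarith, hW⟩

end RhW07.C11.DescentSplit.C3









































namespace RhIdea6.G18.W07C8.Law421BirthS

open Set Complex
open Summit.RiemannHypothesis.RiemannHypothesis.Theorems.Splittings.JensenWindow (LocalA)
open Summit.RiemannHypothesis.RiemannHypothesis.Theorems.Splittings.EarlyAppointmentsLocalFourierPolya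
open RhIdea6.G17.W07C7 RhIdea6.G17.W07C7.Rev6





def DescentSigS' : Prop := ∀ (η : ℝ) (f : ℂ → ℂ) (x₀ s hmax R Hs : ℝ) (B : ℕ),
 EngineHyps5 2 η f x₀ s hmax R Hs B →
   ∃ (j : ℕ) (α β H : ℝ), (j : ℝ) ≤ 4 * hmax / s + (Hs / s) ^ 2 + B + 1 ∧
     x₀ - (j + 3) * R / 2 ≤ α ∧ β ≤ x₀ + (j + 3) * R / 2 ∧
     iteratedDeriv j f ≠ 0 ∧ SignWindow (iteratedDeriv j f) α β H


theorem descentSigS'_of_descentSigS (h : DescentSigS) : DescentSigS' := by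
 intro η f x₀ s hmax R Hs B hE
 obtain ⟨j, α, β, H, hj, hα, hβ, hnz, hW⟩ := h η f x₀ s hmax R Hs B hE
 exact ⟨j, α, β, H, by linarith, hα, hβ, hnz, hW⟩



theorem law421_ofS' (hDesc : DescentSigS') (hHer : AnalyticHereditySig) : TiltedLandingLaw421 := by
 intro η f x₀ s hmax R Hs B hE
 have hE' := hE
 obtain ⟨hdiff, hreal, hgrowth, hs, hsh, hhR, h3R, hHs, hstrip, hHsR, hpair, hcol, hhalf, hη0, hη1, hrem⟩ := hE'
 have hC0 : InClass f Hs := ⟨hdiff, hreal, hgrowth, hstrip⟩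
 obtain ⟨j, α, β, H, hj, hα, hβ, hnz, hW⟩ := hDesc η f x₀ s hmax R Hs B hE
 obtain ⟨hlt, hH, hgα, hgβ, hdα, hdβ, htop, hleft, hright, hA, hz⟩ := hW
 have hCj : InClass (iteratedDeriv j f) Hs := hHer f Hs j hHs hC0 hnz
 obtain ⟨x, hxI, hdx, hgx, hsign⟩ :=
   exists_nonLaguerre_critical_of_boundary_sign hCj.1 hCj.2.1 hlt hH hgα hgβ hdα hdβ htop hleft hright hA hz
 have h1 : iteratedDeriv (j + 1) f = deriv (iteratedDeriv j f) := iteratedDeriv_succ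
 have h2 : iteratedDeriv (j + 2) f = deriv (deriv (iteratedDeriv j f)) := by
   show iteratedDeriv (j + 1 + 1) f = _
   rw [iteratedDeriv_succ, iteratedDeriv_succ]
 have hgim : (iteratedDeriv j f (x : ℂ)).im = 0 := hCj.2.1 x
 have hev : NLEventOf f j x := by
   refine ⟨?_, ?_, ?_⟩
   · rw [h1, hdx]; simp
   · intro hre
     exact hgx (Complex.ext (by simpa using hre) (by simpa using hgim))
   · rw [h2]
     have hmul : (iteratedDeriv j f (x : ℂ) * deriv (deriv (iteratedDeriv j f)) (x : ℂ)).re =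
         (iteratedDeriv j f (x : ℂ)).re * (deriv (deriv (iteratedDeriv j f)) (x : ℂ)).re := by
       rw [Complex.mul_re, hgim, zero_mul, sub_zero]
     rw [← hmul]; exact hsign
 refine ⟨j, ?_, x, ?_, hev⟩
 · have : (1 : ℝ) * (Hs / s) ^ 2 = (Hs / s) ^ 2 := one_mul _
   linarith
 · rw [abs_sub_lt_iff]
   constructor <;> linarith [hxI.1, hxI.2]


private theorem law421T_ofS' (hDesc : DescentSigS') (hHer : AnalyticHereditySig) :
   Summit.RiemannHypothesis.RiemannHypothesis.Theses.EarlyAppointments.TiltedLandingLaw421 :=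
 law421_tree_iff.mpr (law421_ofS' hDesc hHer)








end RhIdea6.G18.W07C8.Law421BirthS


namespace RhIdea6.G19.W07C11.Seam

open Set Complex
open Summit.RiemannHypothesis.RiemannHypothesis.Theorems.Splittings.JensenWindow (LocalA)
open RhIdea6.G17.W07C7 RhIdea6.G17.W07C7.Rev6 RhIdea6.G18.W07C8.Law421BirthS




abbrev StatePred : Type := ℝ → (ℂ → ℂ) → ℝ → ℝ → ℝ → ℝ → ℝ → ℕ → ℕ → ℂ → Prop


abbrev Potential : Type := ℝ → (ℂ → ℂ) → ℝ → ℝ → ℝ → ℝ → ℝ → ℕ → ℕ → ℂ → ℝ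


def DescentSigC (c : ℝ) : Prop := ∀ (η : ℝ) (f : ℂ → ℂ) (x₀ s hmax R Hs : ℝ) (B : ℕ),
 EngineHyps5 2 η f x₀ s hmax R Hs B →
   ∃ (j : ℕ) (α β H : ℝ), (j : ℝ) ≤ 4 * hmax / s + (Hs / s) ^ 2 + B + c ∧
     x₀ - (j + 3) * R / 2 ≤ α ∧ β ≤ x₀ + (j + 3) * R / 2 ∧
     iteratedDeriv j f ≠ 0 ∧ SignWindow (iteratedDeriv j f) α β H

theorem descentSigS_of_descentSigC (h : DescentSigC 0) : DescentSigS := by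
 intro η f x₀ s hmax R Hs B hE
 obtain ⟨j, α, β, H, hj, hα, hβ, hnz, hW⟩ := h η f x₀ s hmax R Hs B hE
 exact ⟨j, α, β, H, by linarith, hα, hβ, hnz, hW⟩

theorem descentSigS'_of_descentSigC (h : DescentSigC 1) : DescentSigS' := by
 intro η f x₀ s hmax R Hs B hE
 obtain ⟨j, α, β, H, hj, hα, hβ, hnz, hW⟩ := h η f x₀ s hmax R Hs B hE
 exact ⟨j, α, β, H, by linarith, hα, hβ, hnz, hW⟩



def InitSig (c : ℝ) (St : StatePred) (Φ : Potential) : Prop :=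
 ∀ (η : ℝ) (f : ℂ → ℂ) (x₀ s hmax R Hs : ℝ) (B : ℕ), EngineHyps5 2 η f x₀ s hmax R Hs B →
   ∃ u : ℂ, St η f x₀ s hmax R Hs B 0 u ∧ Φ η f x₀ s hmax R Hs B 0 u ≤ 4 * hmax / s + (Hs / s) ^ 2 + B + c



def StepSig (St : StatePred) (Φ : Potential) (Ready : StatePred) : Prop :=
 ∀ (η : ℝ) (f : ℂ → ℂ) (x₀ s hmax R Hs : ℝ) (B : ℕ), EngineHyps5 2 η f x₀ s hmax R Hs B →
   ∀ (j : ℕ) (u : ℂ), St η f x₀ s hmax R Hs B j u → ¬ Ready η f x₀ s hmax R Hs B j u →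
     ∃ u' : ℂ, St η f x₀ s hmax R Hs B (j + 1) u' ∧ 0 ≤ Φ η f x₀ s hmax R Hs B (j + 1) u' ∧
       Φ η f x₀ s hmax R Hs B (j + 1) u' + 1 ≤ Φ η f x₀ s hmax R Hs B j u


def LandSig (St Ready : StatePred) : Prop :=
 ∀ (η : ℝ) (f : ℂ → ℂ) (x₀ s hmax R Hs : ℝ) (B : ℕ), EngineHyps5 2 η f x₀ s hmax R Hs B →
   ∀ (j : ℕ) (u : ℂ), St η f x₀ s hmax R Hs B j u → Ready η f x₀ s hmax R Hs B j u →
     iteratedDeriv j f ≠ 0 ∧ ∃ (α β H : ℝ), x₀ - (j + 3) * R / 2 ≤ α ∧ β ≤ x₀ + (j + 3) * R / 2 ∧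
       SignWindow (iteratedDeriv j f) α β H




theorem descent_core {St Ready : ℕ → ℂ → Prop} {Φ : ℕ → ℂ → ℝ} {A : ℝ}
   (hS : ∀ (j : ℕ) (u : ℂ), St j u → ¬ Ready j u → ∃ u' : ℂ, St (j + 1) u' ∧ 0 ≤ Φ (j + 1) u' ∧ Φ (j + 1) u' + 1 ≤ Φ j u)
   {u₀ : ℂ} (h0 : St 0 u₀) (hΦ0 : Φ 0 u₀ ≤ A) (hA : 0 ≤ A) :
   ∃ (j : ℕ) (u : ℂ), (j : ℝ) ≤ A ∧ St j u ∧ Ready j u := by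
 have key : ∀ (n : ℕ) (j : ℕ) (u : ℂ), St j u → (j : ℝ) + Φ j u ≤ A → (j : ℝ) ≤ A → Φ j u < n →
     ∃ (j' : ℕ) (u' : ℂ), (j' : ℝ) ≤ A ∧ St j' u' ∧ Ready j' u' := by
   intro n
   induction n with
   | zero =>
     intro j u hSt _ hj hΦ
     by_cases hR : Ready j u
     · exact ⟨j, u, hj, hSt, hR⟩
     · obtain ⟨u', -, h0', h1'⟩ := hS j u hSt hR
       exfalso
       push_cast at hΦ
       linarith
   | succ n ih =>
     intro j u hSt hjΦ hj hΦ
     by_cases hR : Ready j u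
     · exact ⟨j, u, hj, hSt, hR⟩
     · obtain ⟨u', hSt', h0', h1'⟩ := hS j u hSt hR
       refine ih (j + 1) u' hSt' ?_ ?_ ?_
       · push_cast; linarith
       · push_cast; linarith
       · push_cast at hΦ ⊢; linarith
 obtain ⟨n, hn⟩ := exists_nat_gt (Φ 0 u₀)
 exact key n 0 u₀ h0 (by push_cast; linarith) (by push_cast; linarith) hn


theorem allowance_nonneg {s hmax Hs c : ℝ} {B : ℕ} (hs : 0 < s) (hsh : 2 * s ≤ hmax) (hc : 0 ≤ c) :
   0 ≤ 4 * hmax / s + (Hs / s) ^ 2 + B + c := by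
 have h1 : 0 ≤ 4 * hmax / s := by
   have : 0 ≤ hmax := by linarith
   positivity
 have h2 : 0 ≤ (Hs / s) ^ 2 := sq_nonneg _
 have h3 : (0 : ℝ) ≤ B := Nat.cast_nonneg _
 linarith


theorem descentSigC_of_seam (c : ℝ) (hc : 0 ≤ c) (St : StatePred) (Φ : Potential) (Ready : StatePred)
   (hI : InitSig c St Φ) (hS : StepSig St Φ Ready) (hL : LandSig St Ready) : DescentSigC c := by
 intro η f x₀ s hmax R Hs B hE
 have hE' := hE
 obtain ⟨-, -, -, hs, hsh, -, -, -, -, -, -, -, -, -, -, -⟩ := hE'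
 obtain ⟨u₀, hSt0, hΦ0⟩ := hI η f x₀ s hmax R Hs B hE
 obtain ⟨j, u, hj, hSt, hR⟩ :=
   descent_core (hS η f x₀ s hmax R Hs B hE) hSt0 hΦ0 (allowance_nonneg hs hsh hc)
 obtain ⟨hnz, α, β, H, hα, hβ, hW⟩ := hL η f x₀ s hmax R Hs B hE j u hSt hR
 exact ⟨j, α, β, H, hj, hα, hβ, hnz, hW⟩


theorem descentSigS_of_seam (St : StatePred) (Φ : Potential) (Ready : StatePred)
   (hI : InitSig 0 St Φ) (hS : StepSig St Φ Ready) (hL : LandSig St Ready) : DescentSigS :=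
 descentSigS_of_descentSigC (descentSigC_of_seam 0 le_rfl St Φ Ready hI hS hL)


theorem descentSigS'_of_seam (St : StatePred) (Φ : Potential) (Ready : StatePred)
   (hI : InitSig 1 St Φ) (hS : StepSig St Φ Ready) (hL : LandSig St Ready) : DescentSigS' :=
 descentSigS'_of_descentSigC (descentSigC_of_seam 1 zero_le_one St Φ Ready hI hS hL)


private theorem law421T_of_seam (St : StatePred) (Φ : Potential) (Ready : StatePred)
   (hI : InitSig 0 St Φ) (hS : StepSig St Φ Ready) (hL : LandSig St Ready) (hHer : AnalyticHereditySig) :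
   Summit.RiemannHypothesis.RiemannHypothesis.Theses.EarlyAppointments.TiltedLandingLaw421 :=
 law421T_ofS (descentSigS_of_seam St Φ Ready hI hS hL) hHer


private theorem law421T_of_seam' (St : StatePred) (Φ : Potential) (Ready : StatePred)
   (hI : InitSig 1 St Φ) (hS : StepSig St Φ Ready) (hL : LandSig St Ready) (hHer : AnalyticHereditySig) :
   Summit.RiemannHypothesis.RiemannHypothesis.Theses.EarlyAppointments.TiltedLandingLaw421 :=
 law421T_ofS' (descentSigS'_of_seam St Φ Ready hI hS hL) hHer




def Init0Sig (St : StatePred) : Prop :=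
 ∀ (η : ℝ) (f : ℂ → ℂ) (x₀ s hmax R Hs : ℝ) (B : ℕ), EngineHyps5 2 η f x₀ s hmax R Hs B →
   ∃ u : ℂ, St η f x₀ s hmax R Hs B 0 u ∧ |u.im| ≤ hmax



def SurplusSig (cE : ℝ) (St Ready Frozen : StatePred) : Prop :=
 ∀ (η : ℝ) (f : ℂ → ℂ) (x₀ s hmax R Hs : ℝ) (B : ℕ), EngineHyps5 2 η f x₀ s hmax R Hs B →
   ∃ E : Finset ℕ, (E.card : ℝ) ≤ (Hs / s) ^ 2 + B + cE ∧
     ∀ (j : ℕ) (u : ℂ), j ∉ E → St η f x₀ s hmax R Hs B j u →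
       Ready η f x₀ s hmax R Hs B j u ∨ Frozen η f x₀ s hmax R Hs B j u



def FrozenStepSig (μ : ℝ) (St Ready Frozen : StatePred) : Prop :=
 ∀ (η : ℝ) (f : ℂ → ℂ) (x₀ s hmax R Hs : ℝ) (B : ℕ), EngineHyps5 2 η f x₀ s hmax R Hs B →
   ∀ (j : ℕ) (u : ℂ), St η f x₀ s hmax R Hs B j u → Frozen η f x₀ s hmax R Hs B j u → ¬ Ready η f x₀ s hmax R Hs B j u →
     ∃ u' : ℂ, St η f x₀ s hmax R Hs B (j + 1) u' ∧ |u'.im| + μ * s ≤ |u.im|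


def HoldStepSig (St Ready : StatePred) : Prop :=
 ∀ (η : ℝ) (f : ℂ → ℂ) (x₀ s hmax R Hs : ℝ) (B : ℕ), EngineHyps5 2 η f x₀ s hmax R Hs B →
   ∀ (j : ℕ) (u : ℂ), St η f x₀ s hmax R Hs B j u → ¬ Ready η f x₀ s hmax R Hs B j u →
     ∃ u' : ℂ, St η f x₀ s hmax R Hs B (j + 1) u' ∧ |u'.im| ≤ |u.im|




theorem budget_of_quarter_le' {μ cE c : ℝ} (hμ : 1 / 4 ≤ μ) (hc : cE ≤ c) {s hmax : ℝ} (hs : 0 < s) (hsh : 2 * s ≤ hmax) :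
   hmax / (μ * s) + cE ≤ 4 * hmax / s + c := by
 have hμ0 : 0 < μ := by linarith
 have hμs : 0 < μ * s := mul_pos hμ0 hs
 have hh : 0 ≤ hmax := by linarith
 have key : hmax / (μ * s) ≤ 4 * hmax / s := by
   rw [div_le_iff₀ hμs]
   have : 4 * hmax / s * (μ * s) = 4 * hmax * μ := by
     field_simp
   rw [this]
   nlinarith [mul_nonneg hh (by linarith : (0 : ℝ) ≤ 4 * μ - 1)]
 linarith


theorem budget_of_quarter_le {μ c : ℝ} (hμ : 1 / 4 ≤ μ) (hc : 0 ≤ c) {s hmax : ℝ} (hs : 0 < s) (hsh : 2 * s ≤ hmax) :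
   hmax / (μ * s) ≤ 4 * hmax / s + c := by
 have hμ0 : 0 < μ := by linarith
 have hμs : 0 < μ * s := mul_pos hμ0 hs
 have hh : 0 ≤ hmax := by linarith
 rw [div_le_iff₀ hμs]
 have : (4 * hmax / s + c) * (μ * s) = 4 * hmax * μ + c * μ * s := by
   field_simp
 rw [this]
 nlinarith [mul_nonneg hh (by linarith : (0 : ℝ) ≤ 4 * μ - 1), mul_nonneg (mul_nonneg hc hμ0.le) hs.le]



theorem descentSigC_of_surplus_pieces (μ cE c : ℝ) (hμ : 0 < μ) (hc : 0 ≤ c)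
   (hbud : ∀ s hmax : ℝ, 0 < s → 2 * s ≤ hmax → hmax / (μ * s) + cE ≤ 4 * hmax / s + c)
   (St Ready Frozen : StatePred)
   (hI : Init0Sig St) (hSur : SurplusSig cE St Ready Frozen) (hF : FrozenStepSig μ St Ready Frozen)
   (hH : HoldStepSig St Ready) (hL : LandSig St Ready) : DescentSigC c := by
 intro η f x₀ s hmax R Hs B hE
 have hE' := hE
 obtain ⟨-, -, -, hs, hsh, -, -, -, -, -, -, -, -, -, -, -⟩ := hE'
 have hμs : 0 < μ * s := mul_pos hμ hs
 obtain ⟨E, hEcard, hEoff⟩ := hSur η f x₀ s hmax R Hs B hE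
 obtain ⟨u₀, hSt0, hu₀⟩ := hI η f x₀ s hmax R Hs B hE

 let S : ℕ → Finset ℕ := fun j => E.filter (fun e => j ≤ e)
 let Φ : ℕ → ℂ → ℝ := fun j u => |u.im| / (μ * s) + ((S j).card : ℝ)
 have hSmono : ∀ j : ℕ, S (j + 1) ⊆ S j := by
   intro j e he
   simp only [S, Finset.mem_filter] at he ⊢
   exact ⟨he.1, by omega⟩
 have hΦnonneg : ∀ (j : ℕ) (u : ℂ), 0 ≤ Φ j u := by
   intro j u
   have : 0 ≤ |u.im| / (μ * s) := div_nonneg (abs_nonneg _) hμs.le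
   have : (0 : ℝ) ≤ (S j).card := Nat.cast_nonneg _
   simp only [Φ]
   linarith

 have hStep : ∀ (j : ℕ) (u : ℂ), St η f x₀ s hmax R Hs B j u → ¬ Ready η f x₀ s hmax R Hs B j u →
     ∃ u' : ℂ, St η f x₀ s hmax R Hs B (j + 1) u' ∧ 0 ≤ Φ (j + 1) u' ∧ Φ (j + 1) u' + 1 ≤ Φ j u := by
   intro j u hSt hR
   have hcardmono : ((S (j + 1)).card : ℝ) ≤ (S j).card := by
     exact_mod_cast Finset.card_le_card (hSmono j)
   by_cases hjE : j ∈ E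
   ·
     obtain ⟨u', hSt', hle⟩ := hH η f x₀ s hmax R Hs B hE j u hSt hR
     have hjS : j ∈ S j := by
       simp only [S, Finset.mem_filter]
       exact ⟨hjE, le_rfl⟩
     have hjS' : j ∉ S (j + 1) := by
       simp only [S, Finset.mem_filter, not_and, not_le]
       intro _
       omega
     have hss : S (j + 1) ⊂ S j := Finset.ssubset_iff.mpr ⟨j, hjS', Finset.insert_subset hjS (hSmono j)⟩
     have hlt : (S (j + 1)).card < (S j).card := Finset.card_lt_card hss
     have hcard1 : ((S (j + 1)).card : ℝ) + 1 ≤ (S j).card := by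
       have : (S (j + 1)).card + 1 ≤ (S j).card := hlt
       exact_mod_cast this
     have hh : |u'.im| / (μ * s) ≤ |u.im| / (μ * s) := div_le_div_of_nonneg_right hle hμs.le
     refine ⟨u', hSt', hΦnonneg _ _, ?_⟩
     simp only [Φ]
     linarith
   ·
     rcases hEoff j u hjE hSt with hRj | hFz
     · exact absurd hRj hR
     obtain ⟨u', hSt', hdrop⟩ := hF η f x₀ s hmax R Hs B hE j u hSt hFz hR
     have hh : |u'.im| / (μ * s) + 1 ≤ |u.im| / (μ * s) := by
       rw [← sub_nonneg]
       have hne : μ * s ≠ 0 := ne_of_gt hμs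
       have : |u.im| / (μ * s) - (|u'.im| / (μ * s) + 1) = (|u.im| - |u'.im| - μ * s) / (μ * s) := by
         field_simp
         ring
       rw [this]
       exact div_nonneg (by linarith) hμs.le
     refine ⟨u', hSt', hΦnonneg _ _, ?_⟩
     simp only [Φ]
     linarith

 have hS0 : ((S 0).card : ℝ) ≤ (Hs / s) ^ 2 + B + cE := by
   have : (S 0).card ≤ E.card := Finset.card_filter_le _ _
   have : ((S 0).card : ℝ) ≤ E.card := by exact_mod_cast this
   linarith
 have hΦ0 : Φ 0 u₀ ≤ 4 * hmax / s + (Hs / s) ^ 2 + B + c := by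
   have h1 : |u₀.im| / (μ * s) ≤ hmax / (μ * s) := div_le_div_of_nonneg_right hu₀ hμs.le
   have h2 := hbud s hmax hs hsh
   simp only [Φ]
   linarith
 obtain ⟨j, u, hj, hSt, hR⟩ :=
   descent_core (St := St η f x₀ s hmax R Hs B) (Ready := Ready η f x₀ s hmax R Hs B) (Φ := Φ)
     hStep hSt0 hΦ0 (allowance_nonneg hs hsh hc)
 obtain ⟨hnz, α, β, H, hα, hβ, hW⟩ := hL η f x₀ s hmax R Hs B hE j u hSt hR
 exact ⟨j, α, β, H, hj, hα, hβ, hnz, hW⟩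


theorem descentSigS_of_surplus_pieces (μ : ℝ) (hμ : 1 / 4 ≤ μ) (St Ready Frozen : StatePred)
   (hI : Init0Sig St) (hSur : SurplusSig 0 St Ready Frozen) (hF : FrozenStepSig μ St Ready Frozen)
   (hH : HoldStepSig St Ready) (hL : LandSig St Ready) : DescentSigS :=
 descentSigS_of_descentSigC
   (descentSigC_of_surplus_pieces μ 0 0 (by linarith) le_rfl (fun _ _ hs hsh => budget_of_quarter_le' hμ le_rfl hs hsh)
     St Ready Frozen hI hSur hF hH hL)


theorem descentSigS'_of_surplus_pieces (μ : ℝ) (hμ : 1 / 4 ≤ μ) (St Ready Frozen : StatePred)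
   (hI : Init0Sig St) (hSur : SurplusSig 1 St Ready Frozen) (hF : FrozenStepSig μ St Ready Frozen)
   (hH : HoldStepSig St Ready) (hL : LandSig St Ready) : DescentSigS' :=
 descentSigS'_of_descentSigC
   (descentSigC_of_surplus_pieces μ 1 1 (by linarith) zero_le_one (fun _ _ hs hsh => budget_of_quarter_le' hμ le_rfl hs hsh)
     St Ready Frozen hI hSur hF hH hL)


theorem surplusSig_mono {cE cE' : ℝ} (h : cE ≤ cE') (St Ready Frozen : StatePred) (hS : SurplusSig cE St Ready Frozen) :
   SurplusSig cE' St Ready Frozen := by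
 intro η f x₀ s hmax R Hs B hE
 obtain ⟨E, hcard, hoff⟩ := hS η f x₀ s hmax R Hs B hE
 exact ⟨E, by linarith, hoff⟩


private theorem law421T_of_surplus_pieces (μ : ℝ) (hμ : 1 / 4 ≤ μ) (St Ready Frozen : StatePred)
   (hI : Init0Sig St) (hSur : SurplusSig 0 St Ready Frozen) (hF : FrozenStepSig μ St Ready Frozen)
   (hH : HoldStepSig St Ready) (hL : LandSig St Ready) (hHer : AnalyticHereditySig) :
   Summit.RiemannHypothesis.RiemannHypothesis.Theses.EarlyAppointments.TiltedLandingLaw421 :=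
 law421T_ofS (descentSigS_of_surplus_pieces μ hμ St Ready Frozen hI hSur hF hH hL) hHer






section Lift
open scoped BigOperators



def SurplusLiftSig (cE : ℝ) (Λ : ℝ → ℝ → ℝ) (St Ready Frozen : StatePred) : Prop :=
 ∀ (η : ℝ) (f : ℂ → ℂ) (x₀ s hmax R Hs : ℝ) (B : ℕ), EngineHyps5 2 η f x₀ s hmax R Hs B →
   ∃ (E : Finset ℕ) (lam : ℕ → ℝ), (E.card : ℝ) ≤ (Hs / s) ^ 2 + B + cE ∧ (∀ j : ℕ, 0 ≤ lam j) ∧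
     (∑ e ∈ E, lam e) ≤ Λ s hmax ∧
     (∀ (j : ℕ) (u : ℂ), j ∉ E → St η f x₀ s hmax R Hs B j u →
       Ready η f x₀ s hmax R Hs B j u ∨ Frozen η f x₀ s hmax R Hs B j u) ∧
     (∀ (j : ℕ) (u : ℂ), j ∈ E → St η f x₀ s hmax R Hs B j u → ¬ Ready η f x₀ s hmax R Hs B j u →
       ∃ u' : ℂ, St η f x₀ s hmax R Hs B (j + 1) u' ∧ |u'.im| ≤ |u.im| + lam j)



theorem descentSigC_of_lift_pieces (μ cE c : ℝ) (Λ : ℝ → ℝ → ℝ) (hμ : 0 < μ) (hc : 0 ≤ c)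
   (hbud : ∀ s hmax : ℝ, 0 < s → 2 * s ≤ hmax → hmax / (μ * s) + cE + Λ s hmax / (μ * s) ≤ 4 * hmax / s + c)
   (St Ready Frozen : StatePred)
   (hI : Init0Sig St) (hSL : SurplusLiftSig cE Λ St Ready Frozen) (hF : FrozenStepSig μ St Ready Frozen)
   (hL : LandSig St Ready) : DescentSigC c := by
 intro η f x₀ s hmax R Hs B hE
 have hE' := hE
 obtain ⟨-, -, -, hs, hsh, -, -, -, -, -, -, -, -, -, -, -⟩ := hE'
 have hμs : 0 < μ * s := mul_pos hμ hs
 obtain ⟨E, lam, hEcard, hlam0, hlamsum, hEoff, hEon⟩ := hSL η f x₀ s hmax R Hs B hE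
 obtain ⟨u₀, hSt0, hu₀⟩ := hI η f x₀ s hmax R Hs B hE

 let S : ℕ → Finset ℕ := fun j => E.filter (fun e => j ≤ e)
 let w : ℕ → ℝ := fun e => 1 + lam e / (μ * s)
 let W : ℕ → ℝ := fun j => ∑ e ∈ S j, w e
 let Φ : ℕ → ℂ → ℝ := fun j u => |u.im| / (μ * s) + W j
 have hw0 : ∀ e, 0 ≤ w e := fun e => by
   have : 0 ≤ lam e / (μ * s) := div_nonneg (hlam0 e) hμs.le
   simp only [w]; linarith
 have hSins : ∀ j : ℕ, j ∈ E → S j = insert j (S (j + 1)) := by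
   intro j hj
   ext e
   simp only [S, Finset.mem_filter, Finset.mem_insert]
   constructor
   · rintro ⟨he, hle⟩
     by_cases h : e = j
     · exact Or.inl h
     · exact Or.inr ⟨he, by omega⟩
   · rintro (h | ⟨he, hle⟩)
     · subst h; exact ⟨hj, le_rfl⟩
     · exact ⟨he, by omega⟩
 have hSeq : ∀ j : ℕ, j ∉ E → S (j + 1) = S j := by
   intro j hj
   ext e
   simp only [S, Finset.mem_filter]
   constructor
   · rintro ⟨he, hle⟩; exact ⟨he, by omega⟩
   · rintro ⟨he, hle⟩
     have hne : j ≠ e := fun h => hj (h ▸ he)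
     exact ⟨he, by omega⟩
 have hWon : ∀ j : ℕ, j ∈ E → W j = w j + W (j + 1) := by
   intro j hj
   have hnot : j ∉ S (j + 1) := by
     simp only [S, Finset.mem_filter, not_and, not_le]
     intro _; omega
   simp only [W]
   rw [hSins j hj, Finset.sum_insert hnot]
 have hWoff : ∀ j : ℕ, j ∉ E → W (j + 1) = W j := by
   intro j hj
   simp only [W]
   rw [hSeq j hj]
 have hWnonneg : ∀ j, 0 ≤ W j := fun j => Finset.sum_nonneg (fun e _ => hw0 e)
 have hΦnonneg : ∀ (j : ℕ) (u : ℂ), 0 ≤ Φ j u := by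
   intro j u
   have : 0 ≤ |u.im| / (μ * s) := div_nonneg (abs_nonneg _) hμs.le
   have := hWnonneg j
   simp only [Φ]
   linarith

 have hStep : ∀ (j : ℕ) (u : ℂ), St η f x₀ s hmax R Hs B j u → ¬ Ready η f x₀ s hmax R Hs B j u →
     ∃ u' : ℂ, St η f x₀ s hmax R Hs B (j + 1) u' ∧ 0 ≤ Φ (j + 1) u' ∧ Φ (j + 1) u' + 1 ≤ Φ j u := by
   intro j u hSt hR
   by_cases hjE : j ∈ E
   ·
     obtain ⟨u', hSt', hle⟩ := hEon j u hjE hSt hR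
     have hWj := hWon j hjE
     have hh : |u'.im| / (μ * s) ≤ |u.im| / (μ * s) + lam j / (μ * s) := by
       rw [← add_div]
       exact div_le_div_of_nonneg_right hle hμs.le
     refine ⟨u', hSt', hΦnonneg _ _, ?_⟩
     simp only [Φ]
     simp only [w] at hWj
     linarith
   ·
     rcases hEoff j u hjE hSt with hRj | hFz
     · exact absurd hRj hR
     obtain ⟨u', hSt', hdrop⟩ := hF η f x₀ s hmax R Hs B hE j u hSt hFz hR
     have hh : |u'.im| / (μ * s) + 1 ≤ |u.im| / (μ * s) := by
       rw [← sub_nonneg]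
       have hne : μ * s ≠ 0 := ne_of_gt hμs
       have : |u.im| / (μ * s) - (|u'.im| / (μ * s) + 1) = (|u.im| - |u'.im| - μ * s) / (μ * s) := by
         field_simp
         ring
       rw [this]
       exact div_nonneg (by linarith) hμs.le
     have hWj := hWoff j hjE
     refine ⟨u', hSt', hΦnonneg _ _, ?_⟩
     simp only [Φ]
     linarith

 have hW0 : W 0 ≤ (Hs / s) ^ 2 + B + cE + Λ s hmax / (μ * s) := by
   have hsub : S 0 ⊆ E := Finset.filter_subset _ _
   have h1 : W 0 ≤ ∑ e ∈ E, w e := Finset.sum_le_sum_of_subset_of_nonneg hsub (fun e _ _ => hw0 e)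
   have h2 : ∑ e ∈ E, w e = (E.card : ℝ) + (∑ e ∈ E, lam e) / (μ * s) := by
     simp only [w, Finset.sum_add_distrib, Finset.sum_const, nsmul_eq_mul, mul_one, Finset.sum_div]
   have h3 : (∑ e ∈ E, lam e) / (μ * s) ≤ Λ s hmax / (μ * s) := div_le_div_of_nonneg_right hlamsum hμs.le
   linarith
 have hΦ0 : Φ 0 u₀ ≤ 4 * hmax / s + (Hs / s) ^ 2 + B + c := by
   have h1 : |u₀.im| / (μ * s) ≤ hmax / (μ * s) := div_le_div_of_nonneg_right hu₀ hμs.le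
   have h2 := hbud s hmax hs hsh
   simp only [Φ]
   linarith
 obtain ⟨j, u, hj, hSt, hR⟩ :=
   descent_core (St := St η f x₀ s hmax R Hs B) (Ready := Ready η f x₀ s hmax R Hs B) (Φ := Φ)
     hStep hSt0 hΦ0 (allowance_nonneg hs hsh hc)
 obtain ⟨hnz, α, β, H, hα, hβ, hW⟩ := hL η f x₀ s hmax R Hs B hE j u hSt hR
 exact ⟨j, α, β, H, hj, hα, hβ, hnz, hW⟩


def liftBudget (μ cE c : ℝ) : ℝ → ℝ → ℝ := fun s hmax => (4 * μ - 1) * hmax + (c - cE) * μ * s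


theorem liftBudget_holds (μ cE c : ℝ) (hμ : 0 < μ) (s hmax : ℝ) (hs : 0 < s) (_hsh : 2 * s ≤ hmax) :
   hmax / (μ * s) + cE + liftBudget μ cE c s hmax / (μ * s) ≤ 4 * hmax / s + c := by
 have hμs : μ * s ≠ 0 := ne_of_gt (mul_pos hμ hs)
 have hs' : s ≠ 0 := ne_of_gt hs
 have hμ' : μ ≠ 0 := ne_of_gt hμ
 apply le_of_eq
 simp only [liftBudget]
 field_simp
 ring



theorem descentSigS'_of_lift_pieces (μ : ℝ) (hμ : 1 / 4 ≤ μ) (St Ready Frozen : StatePred)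
   (hI : Init0Sig St) (hSL : SurplusLiftSig 0 (liftBudget μ 0 1) St Ready Frozen) (hF : FrozenStepSig μ St Ready Frozen)
   (hL : LandSig St Ready) : DescentSigS' :=
 descentSigS'_of_descentSigC
   (descentSigC_of_lift_pieces μ 0 1 (liftBudget μ 0 1) (by linarith) zero_le_one
     (fun s hmax hs hsh => liftBudget_holds μ 0 1 (by linarith) s hmax hs hsh) St Ready Frozen hI hSL hF hL)


theorem descentSigS_of_lift_pieces (μ : ℝ) (hμ : 1 / 4 ≤ μ) (St Ready Frozen : StatePred)
   (hI : Init0Sig St) (hSL : SurplusLiftSig 0 (liftBudget μ 0 0) St Ready Frozen) (hF : FrozenStepSig μ St Ready Frozen)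
   (hL : LandSig St Ready) : DescentSigS :=
 descentSigS_of_descentSigC
   (descentSigC_of_lift_pieces μ 0 0 (liftBudget μ 0 0) (by linarith) le_rfl
     (fun s hmax hs hsh => liftBudget_holds μ 0 0 (by linarith) s hmax hs hsh) St Ready Frozen hI hSL hF hL)















def SurplusLiftSigV (μ : ℝ) (St Ready Frozen : StatePred) : Prop :=
 ∀ (η : ℝ) (f : ℂ → ℂ) (x₀ s hmax R Hs : ℝ) (B : ℕ), EngineHyps5 2 η f x₀ s hmax R Hs B →
   ∃ (E : Finset ℕ) (lam : ℕ → ℝ), (∀ j : ℕ, 0 ≤ lam j) ∧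
     (E.card : ℝ) + (∑ e ∈ E, lam e) / (μ * s) ≤ (Hs / s) ^ 2 + B ∧
     (∀ (j : ℕ) (u : ℂ), j ∉ E → St η f x₀ s hmax R Hs B j u →
       Ready η f x₀ s hmax R Hs B j u ∨ Frozen η f x₀ s hmax R Hs B j u) ∧
     (∀ (j : ℕ) (u : ℂ), j ∈ E → St η f x₀ s hmax R Hs B j u → ¬ Ready η f x₀ s hmax R Hs B j u →
       ∃ u' : ℂ, St η f x₀ s hmax R Hs B (j + 1) u' ∧ |u'.im| ≤ |u.im| + lam j)



theorem descentSigC_of_liftV_pieces (μ c : ℝ) (hμ : 0 < μ) (hc : 0 ≤ c)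
   (hbud : ∀ s hmax : ℝ, 0 < s → 2 * s ≤ hmax → hmax / (μ * s) ≤ 4 * hmax / s + c)
   (St Ready Frozen : StatePred)
   (hI : Init0Sig St) (hSL : SurplusLiftSigV μ St Ready Frozen) (hF : FrozenStepSig μ St Ready Frozen)
   (hL : LandSig St Ready) : DescentSigC c := by
 intro η f x₀ s hmax R Hs B hE
 have hE' := hE
 obtain ⟨-, -, -, hs, hsh, -, -, -, -, -, -, -, -, -, -, -⟩ := hE'
 have hμs : 0 < μ * s := mul_pos hμ hs
 obtain ⟨E, lam, hlam0, hEsum, hEoff, hEon⟩ := hSL η f x₀ s hmax R Hs B hE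
 obtain ⟨u₀, hSt0, hu₀⟩ := hI η f x₀ s hmax R Hs B hE

 let S : ℕ → Finset ℕ := fun j => E.filter (fun e => j ≤ e)
 let w : ℕ → ℝ := fun e => 1 + lam e / (μ * s)
 let W : ℕ → ℝ := fun j => ∑ e ∈ S j, w e
 let Φ : ℕ → ℂ → ℝ := fun j u => |u.im| / (μ * s) + W j
 have hw0 : ∀ e, 0 ≤ w e := fun e => by
   have : 0 ≤ lam e / (μ * s) := div_nonneg (hlam0 e) hμs.le
   simp only [w]; linarith
 have hSins : ∀ j : ℕ, j ∈ E → S j = insert j (S (j + 1)) := by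
   intro j hj
   ext e
   simp only [S, Finset.mem_filter, Finset.mem_insert]
   constructor
   · rintro ⟨he, hle⟩
     by_cases h : e = j
     · exact Or.inl h
     · exact Or.inr ⟨he, by omega⟩
   · rintro (h | ⟨he, hle⟩)
     · subst h; exact ⟨hj, le_rfl⟩
     · exact ⟨he, by omega⟩
 have hSeq : ∀ j : ℕ, j ∉ E → S (j + 1) = S j := by
   intro j hj
   ext e
   simp only [S, Finset.mem_filter]
   constructor
   · rintro ⟨he, hle⟩; exact ⟨he, by omega⟩
   · rintro ⟨he, hle⟩
     have hne : j ≠ e := fun h => hj (h ▸ he)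
     exact ⟨he, by omega⟩
 have hWon : ∀ j : ℕ, j ∈ E → W j = w j + W (j + 1) := by
   intro j hj
   have hnot : j ∉ S (j + 1) := by
     simp only [S, Finset.mem_filter, not_and, not_le]
     intro _; omega
   simp only [W]
   rw [hSins j hj, Finset.sum_insert hnot]
 have hWoff : ∀ j : ℕ, j ∉ E → W (j + 1) = W j := by
   intro j hj
   simp only [W]
   rw [hSeq j hj]
 have hWnonneg : ∀ j, 0 ≤ W j := fun j => Finset.sum_nonneg (fun e _ => hw0 e)
 have hΦnonneg : ∀ (j : ℕ) (u : ℂ), 0 ≤ Φ j u := by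
   intro j u
   have : 0 ≤ |u.im| / (μ * s) := div_nonneg (abs_nonneg _) hμs.le
   have := hWnonneg j
   simp only [Φ]
   linarith

 have hStep : ∀ (j : ℕ) (u : ℂ), St η f x₀ s hmax R Hs B j u → ¬ Ready η f x₀ s hmax R Hs B j u →
     ∃ u' : ℂ, St η f x₀ s hmax R Hs B (j + 1) u' ∧ 0 ≤ Φ (j + 1) u' ∧ Φ (j + 1) u' + 1 ≤ Φ j u := by
   intro j u hSt hR
   by_cases hjE : j ∈ E
   ·
     obtain ⟨u', hSt', hle⟩ := hEon j u hjE hSt hR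
     have hWj := hWon j hjE
     have hh : |u'.im| / (μ * s) ≤ |u.im| / (μ * s) + lam j / (μ * s) := by
       rw [← add_div]
       exact div_le_div_of_nonneg_right hle hμs.le
     refine ⟨u', hSt', hΦnonneg _ _, ?_⟩
     simp only [Φ]
     simp only [w] at hWj
     linarith
   ·
     rcases hEoff j u hjE hSt with hRj | hFz
     · exact absurd hRj hR
     obtain ⟨u', hSt', hdrop⟩ := hF η f x₀ s hmax R Hs B hE j u hSt hFz hR
     have hh : |u'.im| / (μ * s) + 1 ≤ |u.im| / (μ * s) := by
       rw [← sub_nonneg]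
       have hne : μ * s ≠ 0 := ne_of_gt hμs
       have : |u.im| / (μ * s) - (|u'.im| / (μ * s) + 1) = (|u.im| - |u'.im| - μ * s) / (μ * s) := by
         field_simp
         ring
       rw [this]
       exact div_nonneg (by linarith) hμs.le
     have hWj := hWoff j hjE
     refine ⟨u', hSt', hΦnonneg _ _, ?_⟩
     simp only [Φ]
     linarith

 have hW0 : W 0 ≤ (Hs / s) ^ 2 + B := by
   have hsub : S 0 ⊆ E := Finset.filter_subset _ _
   have h1 : W 0 ≤ ∑ e ∈ E, w e := Finset.sum_le_sum_of_subset_of_nonneg hsub (fun e _ _ => hw0 e)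
   have h2 : ∑ e ∈ E, w e = (E.card : ℝ) + (∑ e ∈ E, lam e) / (μ * s) := by
     simp only [w, Finset.sum_add_distrib, Finset.sum_const, nsmul_eq_mul, mul_one, Finset.sum_div]
   linarith
 have hΦ0 : Φ 0 u₀ ≤ 4 * hmax / s + (Hs / s) ^ 2 + B + c := by
   have h1 : |u₀.im| / (μ * s) ≤ hmax / (μ * s) := div_le_div_of_nonneg_right hu₀ hμs.le
   have h2 := hbud s hmax hs hsh
   simp only [Φ]
   linarith
 obtain ⟨j, u, hj, hSt, hR⟩ :=
   descent_core (St := St η f x₀ s hmax R Hs B) (Ready := Ready η f x₀ s hmax R Hs B) (Φ := Φ)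
     hStep hSt0 hΦ0 (allowance_nonneg hs hsh hc)
 obtain ⟨hnz, α, β, H, hα, hβ, hW⟩ := hL η f x₀ s hmax R Hs B hE j u hSt hR
 exact ⟨j, α, β, H, hj, hα, hβ, hnz, hW⟩



theorem descentSigS_of_liftV_pieces (μ : ℝ) (hμ : 1 / 4 ≤ μ) (St Ready Frozen : StatePred)
   (hI : Init0Sig St) (hSL : SurplusLiftSigV μ St Ready Frozen) (hF : FrozenStepSig μ St Ready Frozen)
   (hL : LandSig St Ready) : DescentSigS :=
 descentSigS_of_descentSigC
   (descentSigC_of_liftV_pieces μ 0 (by linarith) le_rfl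
     (fun s hmax hs hsh => by
       have h1 : hmax / (μ * s) ≤ hmax / (1 / 4 * s) :=
         div_le_div_of_nonneg_left (by linarith) (by positivity) (mul_le_mul_of_nonneg_right hμ hs.le)
       have h2 : hmax / (1 / 4 * s) = 4 * hmax / s := by
         rw [div_eq_div_iff (by positivity) (ne_of_gt hs)]; ring
       linarith)
     St Ready Frozen hI hSL hF hL)


theorem descentSigS'_of_liftV_pieces (μ : ℝ) (hμ : 1 / 4 ≤ μ) (St Ready Frozen : StatePred)
   (hI : Init0Sig St) (hSL : SurplusLiftSigV μ St Ready Frozen) (hF : FrozenStepSig μ St Ready Frozen)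
   (hL : LandSig St Ready) : DescentSigS' :=
 descentSigS'_of_descentSigS (descentSigS_of_liftV_pieces μ hμ St Ready Frozen hI hSL hF hL)




end Lift




def StZero : StatePred := fun _η f _x₀ _s _hmax _R _Hs _B j u => iteratedDeriv j f ≠ 0 ∧ iteratedDeriv j f u = 0


def WindowReady : StatePred := fun _η f x₀ _s _hmax R _Hs _B j _u =>
 ∃ (α β H : ℝ), x₀ - (j + 3) * R / 2 ≤ α ∧ β ≤ x₀ + (j + 3) * R / 2 ∧ SignWindow (iteratedDeriv j f) α β H



def ClearBoxReady : StatePred := fun _η f x₀ _s _hmax R _Hs _B j _u =>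
 ∃ (α β H : ℝ), x₀ - (j + 3) * R / 2 ≤ α ∧ β ≤ x₀ + (j + 3) * R / 2 ∧ ShadowFreeWindow (iteratedDeriv j f) α β H


theorem init0Sig_stZero : Init0Sig StZero := by
 intro η f x₀ s hmax R Hs B hE
 obtain ⟨-, -, -, -, -, -, -, hHs, hstrip, -, ⟨w₀, hw0, -, -, hwh⟩, -⟩ := hE
 refine ⟨w₀, ⟨?_, ?_⟩, hwh⟩
 · intro hf0
   rw [iteratedDeriv_zero] at hf0
   have h := hstrip ((Hs + 1 : ℝ) * I) (by rw [hf0]; rfl)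
   have him : (((Hs + 1 : ℝ) : ℂ) * I).im = Hs + 1 := by simp
   rw [him, abs_of_nonneg (by linarith)] at h
   linarith
 · rw [iteratedDeriv_zero]; exact hw0


theorem landSig_windowReady (St : StatePred)
   (hSt : ∀ η f x₀ s hmax R Hs B j u, St η f x₀ s hmax R Hs B j u → iteratedDeriv j f ≠ 0) :
   LandSig St WindowReady := by
 intro η f x₀ s hmax R Hs B _ j u hS hR
 exact ⟨hSt η f x₀ s hmax R Hs B j u hS, hR⟩




theorem landSig_clearBoxReady (hSign : OffJensenSignSig) (hHer : AnalyticHereditySig) (St : StatePred)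
   (hSt : ∀ η f x₀ s hmax R Hs B j u, St η f x₀ s hmax R Hs B j u → iteratedDeriv j f ≠ 0) :
   LandSig St ClearBoxReady := by
 intro η f x₀ s hmax R Hs B hE j u hS hR
 obtain ⟨hdiff, hreal, hgrowth, -, -, -, -, hHs, hstrip, -⟩ := hE
 have hC0 : InClass f Hs := ⟨hdiff, hreal, hgrowth, hstrip⟩
 have hnz : iteratedDeriv j f ≠ 0 := hSt η f x₀ s hmax R Hs B j u hS
 obtain ⟨α, β, H, hα, hβ, hW⟩ := hR
 obtain ⟨hlt, hH, hgα, hgβ, hdα, hdβ, hTop, hL, hRt, hA, hz⟩ := hW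
 have hCj : InClass (iteratedDeriv j f) Hs := hHer f Hs j hHs hC0 hnz
 have hsome : ∃ v : ℂ, iteratedDeriv j f v = 0 := by
   obtain ⟨ρ, -, hρ, -⟩ := hz
   exact ⟨ρ, hρ⟩
 refine ⟨hnz, α, β, H, hα, hβ, hlt, hH, hgα, hgβ, hdα, hdβ, ?_, ?_, ?_, hA, hz⟩
 · exact fun x hx ↦ hSign _ Hs _ hCj hnz hsome (by rw [im_ofReal_add_mul_I]; exact hH) (hTop x hx)
 · exact fun y hy ↦ hSign _ Hs _ hCj hnz hsome (by rw [im_ofReal_add_mul_I]; exact hy.1) (hL y hy)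
 · exact fun y hy ↦ hSign _ Hs _ hCj hnz hsome (by rw [im_ofReal_add_mul_I]; exact hy.1) (hRt y hy)



private theorem law421T_of_three_pieces (μ : ℝ) (hμ : 1 / 4 ≤ μ) (St Frozen : StatePred)
   (hSt : ∀ η f x₀ s hmax R Hs B j u, St η f x₀ s hmax R Hs B j u → iteratedDeriv j f ≠ 0)
   (hI : Init0Sig St) (hSur : SurplusSig 0 St ClearBoxReady Frozen) (hF : FrozenStepSig μ St ClearBoxReady Frozen)
   (hH : HoldStepSig St ClearBoxReady) (hSign : OffJensenSignSig) (hHer : AnalyticHereditySig) :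
   Summit.RiemannHypothesis.RiemannHypothesis.Theses.EarlyAppointments.TiltedLandingLaw421 :=
 law421T_of_surplus_pieces μ hμ St ClearBoxReady Frozen hI hSur hF hH (landSig_clearBoxReady hSign hHer St hSt) hHer











end RhIdea6.G19.W07C11.Seam




























namespace RhIdea6.G19.W07C11.Seam

open Set Complex
open scoped ComplexConjugate
open RhIdea6.G17.W07C7 RhIdea6.G17.W07C7.Rev6 RhIdea6.G18.W07C8.Law421BirthS
open RhW07.C11.DescentSplit.C3





noncomputable def cStar : ℝ := 1 / 4


noncomputable def muF : ℝ := 1 / Real.pi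



def StWin : StatePred := fun _η f x₀ _s hmax R _Hs _B j u =>
 iteratedDeriv j f ≠ 0 ∧ iteratedDeriv j f u = 0 ∧ 0 < u.im ∧ |u.re - x₀| ≤ ((j : ℝ) + 2) * R / 2 ∧ u.im ≤ hmax


def FrozenS (c₀ μ : ℝ) : StatePred := fun _η f _x₀ s _hmax _R _Hs _B j u => FrozenDownAt c₀ (μ * s) (iteratedDeriv j f) u






def FrozenLocAt (c₀ d : ℝ) (g : ℂ → ℂ) (u : ℂ) : Prop :=
 ∃ (h : ℂ → ℂ) (c : ℂ) (θ : ℝ), PairFactor g h u.re u.im ∧ 0 ≤ θ ∧ 2 ≤ ‖c‖ * u.im ∧ θ ≤ c₀ * ‖c‖ ∧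
   (-1 / c).im ≤ -d ∧ ∀ z ∈ Metric.closedBall u (u.im / 2), h z ≠ 0 ∧ ‖deriv h z / h z - c‖ ≤ θ


def FrozenLocS (c₀ μ : ℝ) : StatePred := fun _η f _x₀ s _hmax _R _Hs _B j u => FrozenLocAt c₀ (μ * s) (iteratedDeriv j f) u


theorem frozenLocAt_of_frozenDownAt {c₀ d : ℝ} {g : ℂ → ℂ} {u : ℂ} (hu : 0 ≤ u.im) (hF : FrozenDownAt c₀ d g u) :
   FrozenLocAt c₀ d g u := by
 obtain ⟨h, c, θ, hPF, hθ, hcu, hθc, him, hball⟩ := hF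
 refine ⟨h, c, θ, hPF, hθ, hcu, hθc, him, fun z hz => hball z ?_⟩
 rw [Metric.mem_closedBall] at hz ⊢
 have h1 : dist z (u.re : ℂ) ≤ dist z u + dist u (u.re : ℂ) := dist_triangle _ _ _
 have h2 : dist u (u.re : ℂ) = |u.im| := by
   rw [Complex.dist_eq]
   have : u - (u.re : ℂ) = (u.im : ℂ) * I := by apply Complex.ext <;> simp
   rw [this, norm_mul, Complex.norm_I, mul_one, Complex.norm_real, Real.norm_eq_abs]
 rw [h2, abs_of_nonneg hu] at h1
 linarith


theorem frozenLocS_of_frozenS {c₀ μ : ℝ} {η : ℝ} {f : ℂ → ℂ} {x₀ s hmax R Hs : ℝ} {B j : ℕ} {u : ℂ}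
   (hSt : StWin η f x₀ s hmax R Hs B j u) (hF : FrozenS c₀ μ η f x₀ s hmax R Hs B j u) : FrozenLocS c₀ μ η f x₀ s hmax R Hs B j u :=
 frozenLocAt_of_frozenDownAt hSt.2.2.1.le hF


theorem init0Sig_stWin : Init0Sig StWin := by
 intro η f x₀ s hmax R Hs B hE
 obtain ⟨hdiff, hreal, -, hs, hsh, -, h3R, hHs, hstrip, -, ⟨w₀, hw0, hwim, hwre, hwh⟩, -⟩ := hE
 have hf : iteratedDeriv 0 f ≠ 0 := by
   intro hf0
   rw [iteratedDeriv_zero] at hf0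
   have h := hstrip ((Hs + 1 : ℝ) * I) (by rw [hf0]; rfl)
   have him : (((Hs + 1 : ℝ) : ℂ) * I).im = Hs + 1 := by simp
   rw [him, abs_of_nonneg (by linarith)] at h
   linarith
 have hR : |x₀ - x₀| ≤ (((0 : ℕ) : ℝ) + 2) * R / 2 := by
   rw [sub_self, abs_zero]; push_cast; nlinarith
 have hwabs : |w₀.im| ≤ hmax := hwh
 rcases lt_or_gt_of_ne hwim with hneg | hpos
 · refine ⟨conj w₀, ⟨hf, ?_, ?_, ?_, ?_⟩, ?_⟩
   · rw [iteratedDeriv_zero, Literature.Analysis.Complex.apply_conj_eq_conj hdiff hreal, hw0, map_zero]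
   · rw [Complex.conj_im]; linarith
   · rw [Complex.conj_re, hwre]; exact hR
   · rw [Complex.conj_im]; rw [abs_of_neg hneg] at hwabs; exact hwabs
   · rw [Complex.conj_im, abs_neg]; exact hwh
 · refine ⟨w₀, ⟨hf, ?_, hpos, ?_, ?_⟩, hwh⟩
   · rw [iteratedDeriv_zero]; exact hw0
   · rw [hwre]; exact hR
   · exact le_trans (le_abs_self _) hwh


theorem landSig_stWin : LandSig StWin WindowReady :=
 landSig_windowReady StWin (fun _ _ _ _ _ _ _ _ _ _ h => h.1)


theorem frozenDownAt_mono {c₀ c₀' d : ℝ} (h : c₀ ≤ c₀') {g : ℂ → ℂ} {u : ℂ} (hF : FrozenDownAt c₀ d g u) :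
   FrozenDownAt c₀' d g u := by
 obtain ⟨hh, c, θ, hPF, hθ, hcu, hθc, him, hball⟩ := hF
 exact ⟨hh, c, θ, hPF, hθ, hcu, le_trans hθc (mul_le_mul_of_nonneg_right h (norm_nonneg _)), him, hball⟩


theorem surplusSig_frozenS_mono {cE c₀ c₀' μ : ℝ} (h : c₀ ≤ c₀') (St Ready : StatePred)
   (hS : SurplusSig cE St Ready (FrozenS c₀ μ)) : SurplusSig cE St Ready (FrozenS c₀' μ) := by
 intro η f x₀ s hmax R Hs B hE
 obtain ⟨E, hcard, hoff⟩ := hS η f x₀ s hmax R Hs B hE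
 refine ⟨E, hcard, fun j u hjE hSt => ?_⟩
 rcases hoff j u hjE hSt with hR | hF
 · exact Or.inl hR
 · exact Or.inr (frozenDownAt_mono h hF)


theorem frozenStepSig_frozenS_mono {c₀ c₀' μ μ' : ℝ} (h : c₀ ≤ c₀') (St Ready : StatePred)
   (hF : FrozenStepSig μ' St Ready (FrozenS c₀' μ)) : FrozenStepSig μ' St Ready (FrozenS c₀ μ) := by
 intro η f x₀ s hmax R Hs B hE j u hSt hFz hR
 exact hF η f x₀ s hmax R Hs B hE j u hSt (frozenDownAt_mono h hFz) hR


theorem frozenLocAt_mono {c₀ c₀' d : ℝ} (h : c₀ ≤ c₀') {g : ℂ → ℂ} {u : ℂ} (hF : FrozenLocAt c₀ d g u) :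
   FrozenLocAt c₀' d g u := by
 obtain ⟨hh, c, θ, hPF, hθ, hcu, hθc, him, hball⟩ := hF
 exact ⟨hh, c, θ, hPF, hθ, hcu, le_trans hθc (mul_le_mul_of_nonneg_right h (norm_nonneg _)), him, hball⟩


theorem surplusSig_frozenLocS_mono {cE c₀ c₀' μ : ℝ} (h : c₀ ≤ c₀') (St Ready : StatePred)
   (hS : SurplusSig cE St Ready (FrozenLocS c₀ μ)) : SurplusSig cE St Ready (FrozenLocS c₀' μ) := by
 intro η f x₀ s hmax R Hs B hE
 obtain ⟨E, hcard, hoff⟩ := hS η f x₀ s hmax R Hs B hE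
 refine ⟨E, hcard, fun j u hjE hSt => ?_⟩
 rcases hoff j u hjE hSt with hR | hF
 · exact Or.inl hR
 · exact Or.inr (frozenLocAt_mono h hF)


theorem frozenStepSig_frozenLocS_mono {c₀ c₀' μ μ' : ℝ} (h : c₀ ≤ c₀') (St Ready : StatePred)
   (hF : FrozenStepSig μ' St Ready (FrozenLocS c₀' μ)) : FrozenStepSig μ' St Ready (FrozenLocS c₀ μ) := by
 intro η f x₀ s hmax R Hs B hE j u hSt hFz hR
 exact hF η f x₀ s hmax R Hs B hE j u hSt (frozenLocAt_mono h hFz) hR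


theorem surplusSig_frozenLocS_of_frozenS {cE c₀ μ : ℝ} (Ready : StatePred)
   (hS : SurplusSig cE StWin Ready (FrozenS c₀ μ)) : SurplusSig cE StWin Ready (FrozenLocS c₀ μ) := by
 intro η f x₀ s hmax R Hs B hE
 obtain ⟨E, hcard, hoff⟩ := hS η f x₀ s hmax R Hs B hE
 refine ⟨E, hcard, fun j u hjE hSt => ?_⟩
 rcases hoff j u hjE hSt with hR | hF
 · exact Or.inl hR
 · exact Or.inr (frozenLocS_of_frozenS hSt hF)





def StPair : StatePred := fun _η f x₀ _s hmax R _Hs _B j u => iteratedDeriv j f ≠ 0 ∧ PairAt f j x₀ R hmax u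


def ReadyBoxS : StatePred := fun _η f _x₀ _s _hmax R _Hs _B j u => ClearBoxReadyAt (R / 2) (iteratedDeriv j f) u

theorem surplusSig_of_pSurplusBox (c₀ μ : ℝ) (h : PSurplusBox c₀ μ) : SurplusSig 0 StPair ReadyBoxS (FrozenS c₀ μ) := by
 intro η f x₀ s hmax R Hs B hE
 obtain ⟨E, hcard, hoff⟩ := h η f x₀ s hmax R Hs B hE
 exact ⟨E, by linarith, fun j u hjE hSt => hoff j u hjE hSt.1 hSt.2⟩

theorem landSig_readyBoxS : LandSig StPair ReadyBoxS := by
 intro η f x₀ s hmax R Hs B _ j u hSt hR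
 exact ⟨hSt.1, descent_exit_of_clearBoxReady hSt.2 hR⟩


theorem windowReady_of_readyBoxS (η : ℝ) (f : ℂ → ℂ) (x₀ s hmax R Hs : ℝ) (B j : ℕ) (u : ℂ)
   (hSt : StPair η f x₀ s hmax R Hs B j u) (hR : ReadyBoxS η f x₀ s hmax R Hs B j u) : WindowReady η f x₀ s hmax R Hs B j u :=
 descent_exit_of_clearBoxReady hSt.2 hR











private theorem TiltedLandingLaw421_of_pieces :
   SurplusSig 0 StWin WindowReady (FrozenLocS cStar muF) → FrozenStepSig (1 / 4) StWin WindowReady (FrozenLocS cStar muF) →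
     HoldStepSig StWin WindowReady → AnalyticHereditySig →
       Summit.RiemannHypothesis.RiemannHypothesis.Theses.EarlyAppointments.TiltedLandingLaw421 :=
 fun hC hF hH hHer =>
   law421T_of_surplus_pieces (1 / 4) le_rfl StWin WindowReady (FrozenLocS cStar muF) init0Sig_stWin hC hF hH landSig_stWin hHer


theorem descentSigS_of_pieces :
   SurplusSig 0 StWin WindowReady (FrozenLocS cStar muF) → FrozenStepSig (1 / 4) StWin WindowReady (FrozenLocS cStar muF) →
     HoldStepSig StWin WindowReady → DescentSigS :=
 fun hC hF hH =>
   descentSigS_of_surplus_pieces (1 / 4) le_rfl StWin WindowReady (FrozenLocS cStar muF) init0Sig_stWin hC hF hH landSig_stWin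





























noncomputable def nStar : ℝ := 3



def StCol : StatePred := fun _η f x₀ s hmax R _Hs _B j u =>
 iteratedDeriv j f ≠ 0 ∧ iteratedDeriv j f u = 0 ∧ 0 < u.im ∧ |u.re - x₀| ≤ R / 2 + (j : ℝ) * (s / 4) ∧ u.im ≤ hmax



def FrozenLocAt' (N c₀ d dr : ℝ) (g : ℂ → ℂ) (u : ℂ) : Prop :=
 ∃ (h : ℂ → ℂ) (c : ℂ) (θ : ℝ), PairFactor g h u.re u.im ∧ 0 ≤ θ ∧ N ≤ ‖c‖ * u.im ∧ θ ≤ c₀ * ‖c‖ ∧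
   (-1 / c).im ≤ -d ∧ |(1 / c).re| ≤ dr ∧ ∀ z ∈ Metric.closedBall u (u.im / 2), h z ≠ 0 ∧ ‖deriv h z / h z - c‖ ≤ θ


def FrozenLocS' (c₀ μ : ℝ) : StatePred := fun _η f _x₀ s _hmax _R _Hs _B j u =>
 FrozenLocAt' nStar c₀ (μ * s) (s / 4) (iteratedDeriv j f) u


theorem frozenLocAt_of_frozenLocAt' {N c₀ d dr : ℝ} (hN : 2 ≤ N) {g : ℂ → ℂ} {u : ℂ} (hF : FrozenLocAt' N c₀ d dr g u) :
   FrozenLocAt c₀ d g u := by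
 obtain ⟨h, c, θ, hPF, hθ, hcu, hθc, him, -, hball⟩ := hF
 exact ⟨h, c, θ, hPF, hθ, le_trans hN hcu, hθc, him, hball⟩

theorem frozenLocS_of_frozenLocS' {c₀ μ : ℝ} {η : ℝ} {f : ℂ → ℂ} {x₀ s hmax R Hs : ℝ} {B j : ℕ} {u : ℂ}
   (hF : FrozenLocS' c₀ μ η f x₀ s hmax R Hs B j u) : FrozenLocS c₀ μ η f x₀ s hmax R Hs B j u :=
 frozenLocAt_of_frozenLocAt' (by norm_num [nStar]) hF


theorem frozenLocAt'_mono {N N' c₀ c₀' d d' dr dr' : ℝ} (hN : N' ≤ N) (hc : c₀ ≤ c₀') (hd : d' ≤ d) (hdr : dr ≤ dr')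
   {g : ℂ → ℂ} {u : ℂ} (hF : FrozenLocAt' N c₀ d dr g u) : FrozenLocAt' N' c₀' d' dr' g u := by
 obtain ⟨h, c, θ, hPF, hθ, hcu, hθc, him, hre, hball⟩ := hF
 exact ⟨h, c, θ, hPF, hθ, le_trans hN hcu, le_trans hθc (mul_le_mul_of_nonneg_right hc (norm_nonneg _)), by linarith, le_trans hre hdr, hball⟩



theorem init0Sig_stCol : Init0Sig StCol := by
 intro η f x₀ s hmax R Hs B hE
 obtain ⟨hdiff, hreal, -, hs, hsh, -, h3R, hHs, hstrip, -, ⟨w₀, hw0, hwim, hwre, hwh⟩, -⟩ := hE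
 have hf : iteratedDeriv 0 f ≠ 0 := by
   intro hf0
   rw [iteratedDeriv_zero] at hf0
   have h := hstrip ((Hs + 1 : ℝ) * I) (by rw [hf0]; rfl)
   have him : (((Hs + 1 : ℝ) : ℂ) * I).im = Hs + 1 := by simp
   rw [him, abs_of_nonneg (by linarith)] at h
   linarith
 have hR : |x₀ - x₀| ≤ R / 2 + ((0 : ℕ) : ℝ) * (s / 4) := by
   rw [sub_self, abs_zero]; push_cast; nlinarith
 have hwabs : |w₀.im| ≤ hmax := hwh
 rcases lt_or_gt_of_ne hwim with hneg | hpos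
 · refine ⟨conj w₀, ⟨hf, ?_, ?_, ?_, ?_⟩, ?_⟩
   · rw [iteratedDeriv_zero, Literature.Analysis.Complex.apply_conj_eq_conj hdiff hreal, hw0, map_zero]
   · rw [Complex.conj_im]; linarith
   · rw [Complex.conj_re, hwre]; exact hR
   · rw [Complex.conj_im]; rw [abs_of_neg hneg] at hwabs; exact hwabs
   · rw [Complex.conj_im, abs_neg]; exact hwh
 · refine ⟨w₀, ⟨hf, ?_, hpos, ?_, ?_⟩, hwh⟩
   · rw [iteratedDeriv_zero]; exact hw0
   · rw [hwre]; exact hR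
   · exact le_trans (le_abs_self _) hwh


theorem landSig_stCol : LandSig StCol WindowReady :=
 landSig_windowReady StCol (fun _ _ _ _ _ _ _ _ _ _ h => h.1)


theorem surplusLiftSig_frozenLocS'_mono {cE c₀ c₀' μ : ℝ} (h : c₀ ≤ c₀') (Λ : ℝ → ℝ → ℝ) (St Ready : StatePred)
   (hS : SurplusLiftSig cE Λ St Ready (FrozenLocS' c₀ μ)) : SurplusLiftSig cE Λ St Ready (FrozenLocS' c₀' μ) := by
 intro η f x₀ s hmax R Hs B hE
 obtain ⟨E, lam, hcard, hlam, hsum, hoff, hon⟩ := hS η f x₀ s hmax R Hs B hE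
 refine ⟨E, lam, hcard, hlam, hsum, fun j u hjE hSt => ?_, hon⟩
 rcases hoff j u hjE hSt with hR | hF
 · exact Or.inl hR
 · exact Or.inr (frozenLocAt'_mono le_rfl h le_rfl le_rfl hF)


theorem frozenStepSig_frozenLocS'_anti {c₀ c₀' μ ν : ℝ} (h : c₀ ≤ c₀') (St Ready : StatePred)
   (hF : FrozenStepSig ν St Ready (FrozenLocS' c₀' μ)) : FrozenStepSig ν St Ready (FrozenLocS' c₀ μ) := by
 intro η f x₀ s hmax R Hs B hE j u hSt hFr hR
 exact hF η f x₀ s hmax R Hs B hE j u hSt (frozenLocAt'_mono le_rfl h le_rfl le_rfl hFr) hR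


theorem surplusLiftSigV_frozenLocS'_mono {c₀ c₀' μ ν : ℝ} (h : c₀ ≤ c₀') (St Ready : StatePred)
   (hS : SurplusLiftSigV ν St Ready (FrozenLocS' c₀ μ)) : SurplusLiftSigV ν St Ready (FrozenLocS' c₀' μ) := by
 intro η f x₀ s hmax R Hs B hE
 obtain ⟨E, lam, hlam, hsum, hoff, hon⟩ := hS η f x₀ s hmax R Hs B hE
 refine ⟨E, lam, hlam, hsum, fun j u hjE hSt => ?_, hon⟩
 rcases hoff j u hjE hSt with hR | hF
 · exact Or.inl hR
 · exact Or.inr (frozenLocAt'_mono le_rfl h le_rfl le_rfl hF)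







private theorem TiltedLandingLaw421_of_piecesC :
   SurplusLiftSig 0 (liftBudget (1 / 4) 0 1) StCol WindowReady (FrozenLocS' cStar muF) →
     FrozenStepSig (1 / 4) StCol WindowReady (FrozenLocS' cStar muF) → AnalyticHereditySig →
       Summit.RiemannHypothesis.RiemannHypothesis.Theses.EarlyAppointments.TiltedLandingLaw421 :=
 fun hL hF hHer =>
   law421T_ofS' (descentSigS'_of_lift_pieces (1 / 4) le_rfl StCol WindowReady (FrozenLocS' cStar muF) init0Sig_stCol hL hF landSig_stCol) hHer



theorem descentSigS'_of_piecesC :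
   SurplusLiftSig 0 (liftBudget (1 / 4) 0 1) StCol WindowReady (FrozenLocS' cStar muF) →
     FrozenStepSig (1 / 4) StCol WindowReady (FrozenLocS' cStar muF) → DescentSigS' :=
 fun hL hF => descentSigS'_of_lift_pieces (1 / 4) le_rfl StCol WindowReady (FrozenLocS' cStar muF) init0Sig_stCol hL hF landSig_stCol




private theorem TiltedLandingLaw421_of_piecesV :
   SurplusLiftSigV (1 / 4) StCol WindowReady (FrozenLocS' cStar muF) →
     FrozenStepSig (1 / 4) StCol WindowReady (FrozenLocS' cStar muF) → AnalyticHereditySig →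
       Summit.RiemannHypothesis.RiemannHypothesis.Theses.EarlyAppointments.TiltedLandingLaw421 :=
 fun hL hF hHer =>
   law421T_ofS (descentSigS_of_liftV_pieces (1 / 4) le_rfl StCol WindowReady (FrozenLocS' cStar muF) init0Sig_stCol hL hF landSig_stCol) hHer


theorem descentSigS_of_piecesV :
   SurplusLiftSigV (1 / 4) StCol WindowReady (FrozenLocS' cStar muF) →
     FrozenStepSig (1 / 4) StCol WindowReady (FrozenLocS' cStar muF) → DescentSigS :=
 fun hL hF => descentSigS_of_liftV_pieces (1 / 4) le_rfl StCol WindowReady (FrozenLocS' cStar muF) init0Sig_stCol hL hF landSig_stCol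


















def SuccS (μ : ℝ) : StatePred := fun η f x₀ s hmax R Hs B j u =>
 ∃ u' : ℂ, StCol η f x₀ s hmax R Hs B (j + 1) u' ∧ |u'.im| + μ * s ≤ |u.im|


theorem frozenStepSig_succS (μ : ℝ) (Ready : StatePred) : FrozenStepSig μ StCol Ready (SuccS μ) :=
 fun _ _ _ _ _ _ _ _ _ _ _ _ hF _ => hF



theorem surplusLiftSig_succS_of_step {cE μ : ℝ} {Λ : ℝ → ℝ → ℝ} {Ready F : StatePred}
   (hS : SurplusLiftSig cE Λ StCol Ready F) (hF : FrozenStepSig μ StCol Ready F) : SurplusLiftSig cE Λ StCol Ready (SuccS μ) := by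
 intro η f x₀ s hmax R Hs B hE
 obtain ⟨E, lam, hcard, hlam, hsum, hoff, hon⟩ := hS η f x₀ s hmax R Hs B hE
 refine ⟨E, lam, hcard, hlam, hsum, fun j u hjE hSt => ?_, hon⟩
 rcases hoff j u hjE hSt with hR | hFz
 · exact Or.inl hR
 · by_cases hR : Ready η f x₀ s hmax R Hs B j u
   · exact Or.inl hR
   · exact Or.inr (hF η f x₀ s hmax R Hs B hE j u hSt hFz hR)


theorem surplusLiftSigV_succS_of_step {μ ν : ℝ} {Ready F : StatePred}
   (hS : SurplusLiftSigV ν StCol Ready F) (hF : FrozenStepSig μ StCol Ready F) : SurplusLiftSigV ν StCol Ready (SuccS μ) := by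
 intro η f x₀ s hmax R Hs B hE
 obtain ⟨E, lam, hlam, hsum, hoff, hon⟩ := hS η f x₀ s hmax R Hs B hE
 refine ⟨E, lam, hlam, hsum, fun j u hjE hSt => ?_, hon⟩
 rcases hoff j u hjE hSt with hR | hFz
 · exact Or.inl hR
 · by_cases hR : Ready η f x₀ s hmax R Hs B j u
   · exact Or.inl hR
   · exact Or.inr (hF η f x₀ s hmax R Hs B hE j u hSt hFz hR)

















private theorem TiltedLandingLaw421_of_piecesS :
   SurplusLiftSig 0 (liftBudget (1 / 4) 0 1) StCol WindowReady (SuccS (1 / 4)) → AnalyticHereditySig →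
     Summit.RiemannHypothesis.RiemannHypothesis.Theses.EarlyAppointments.TiltedLandingLaw421 :=
 fun hL hHer =>
   law421T_ofS' (descentSigS'_of_lift_pieces (1 / 4) le_rfl StCol WindowReady (SuccS (1 / 4)) init0Sig_stCol hL
     (frozenStepSig_succS (1 / 4) WindowReady) landSig_stCol) hHer

theorem descentSigS'_of_piecesS :
   SurplusLiftSig 0 (liftBudget (1 / 4) 0 1) StCol WindowReady (SuccS (1 / 4)) → DescentSigS' :=
 fun hL => descentSigS'_of_lift_pieces (1 / 4) le_rfl StCol WindowReady (SuccS (1 / 4)) init0Sig_stCol hL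
   (frozenStepSig_succS (1 / 4) WindowReady) landSig_stCol


private theorem TiltedLandingLaw421_of_piecesSV :
   SurplusLiftSigV (1 / 4) StCol WindowReady (SuccS (1 / 4)) → AnalyticHereditySig →
     Summit.RiemannHypothesis.RiemannHypothesis.Theses.EarlyAppointments.TiltedLandingLaw421 :=
 fun hL hHer =>
   law421T_ofS (descentSigS_of_liftV_pieces (1 / 4) le_rfl StCol WindowReady (SuccS (1 / 4)) init0Sig_stCol hL
     (frozenStepSig_succS (1 / 4) WindowReady) landSig_stCol) hHer

theorem descentSigS_of_piecesSV :
   SurplusLiftSigV (1 / 4) StCol WindowReady (SuccS (1 / 4)) → DescentSigS :=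
 fun hL => descentSigS_of_liftV_pieces (1 / 4) le_rfl StCol WindowReady (SuccS (1 / 4)) init0Sig_stCol hL
   (frozenStepSig_succS (1 / 4) WindowReady) landSig_stCol














end RhIdea6.G19.W07C11.Seam








namespace RhW07.C11.DescentSplit.C3


def SuccColAt (d σ : ℝ) (g : ℂ → ℂ) (u : ℂ) : Prop :=
 ∃ z₁ : ℂ, deriv g z₁ = 0 ∧ 0 < z₁.im ∧ |z₁.re - u.re| ≤ σ ∧ z₁.im ≤ u.im - d


theorem succColAt_successor {d σ : ℝ} {f : ℂ → ℂ} {j : ℕ} {u : ℂ} (hS : SuccColAt d σ (iteratedDeriv j f) u) :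
   ∃ z₁ : ℂ, iteratedDeriv (j + 1) f z₁ = 0 ∧ 0 < z₁.im ∧ |z₁.re - u.re| ≤ σ ∧ z₁.im ≤ u.im - d := by
 obtain ⟨z₁, h1, h2, h3, h4⟩ := hS
 exact ⟨z₁, by rw [iteratedDeriv_succ]; exact h1, h2, h3, h4⟩


theorem succCol_step {f : ℂ → ℂ} (hf : Differentiable ℂ f) {x₀ s hmax R μ σ : ℝ} (hμs : 0 ≤ μ * s) {j : ℕ} {u : ℂ}
   (hSt : iteratedDeriv j f ≠ 0 ∧ iteratedDeriv j f u = 0 ∧ 0 < u.im ∧ |u.re - x₀| ≤ R / 2 + (j : ℝ) * σ ∧ u.im ≤ hmax)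
   (hS : SuccColAt (μ * s) σ (iteratedDeriv j f) u) :
   ∃ u' : ℂ, (iteratedDeriv (j + 1) f ≠ 0 ∧ iteratedDeriv (j + 1) f u' = 0 ∧ 0 < u'.im ∧
     |u'.re - x₀| ≤ R / 2 + (((j + 1 : ℕ)) : ℝ) * σ ∧ u'.im ≤ hmax) ∧ |u'.im| + μ * s ≤ |u.im| := by
 obtain ⟨hne, hu0, huim, hure, huh⟩ := hSt
 obtain ⟨z₁, hz, him, hre, hle⟩ := succColAt_successor hS
 have hFd : Differentiable ℂ (iteratedDeriv j f) :=
   Literature.Analysis.Complex.differentiable_iteratedDeriv_of_entire hf j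
 have hne' : iteratedDeriv (j + 1) f ≠ 0 := by
   intro h0
   have hconst := is_const_of_deriv_eq_zero hFd (fun x ↦ by rw [← iteratedDeriv_succ, h0]; rfl)
   exact hne (funext fun x ↦ by rw [hconst x u, hu0]; rfl)
 refine ⟨z₁, ⟨hne', hz, him, ?_, by linarith⟩, ?_⟩
 · have h1 : |z₁.re - x₀| ≤ |z₁.re - u.re| + |u.re - x₀| := abs_sub_le _ _ _
   have h2 : (((j + 1 : ℕ)) : ℝ) * σ = (j : ℝ) * σ + σ := by push_cast; ring
   rw [h2]; linarith
 · rw [abs_of_pos him, abs_of_pos huim]; linarith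

end RhW07.C11.DescentSplit.C3

namespace RhIdea6.G19.W07C11.Seam
open RhIdea6.G17.W07C7 RhIdea6.G17.W07C7.Rev6 RhIdea6.G18.W07C8.Law421BirthS RhW07.C11.DescentSplit.C3


def SuccColQ (μ : ℝ) : StatePred := fun _η f _x₀ s _hmax _R _Hs _B j u => SuccColAt (μ * s) (s / 4) (iteratedDeriv j f) u


theorem frozenStepSig_succColQ {μ : ℝ} (hμ : 0 ≤ μ) (Ready : StatePred) : FrozenStepSig μ StCol Ready (SuccColQ μ) := by
 intro η f x₀ s hmax R Hs B hE j u hSt hS _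
 obtain ⟨hdiff, -, -, hs, -⟩ := hE
 exact succCol_step hdiff (mul_nonneg hμ hs.le) hSt hS


theorem succS_of_succColQ {μ : ℝ} (hμ : 0 ≤ μ) {η : ℝ} {f : ℂ → ℂ} {x₀ s hmax R Hs : ℝ} {B : ℕ}
   (hE : EngineHyps5 2 η f x₀ s hmax R Hs B) {j : ℕ} {u : ℂ} (hSt : StCol η f x₀ s hmax R Hs B j u)
   (hS : SuccColQ μ η f x₀ s hmax R Hs B j u) : SuccS μ η f x₀ s hmax R Hs B j u :=
 frozenStepSig_succColQ hμ (fun _ _ _ _ _ _ _ _ _ _ => False) η f x₀ s hmax R Hs B hE j u hSt hS (fun h => h)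


theorem surplusLiftSig_succS_of_succColQ {cE μ : ℝ} (hμ : 0 ≤ μ) {Λ : ℝ → ℝ → ℝ}
   (hS : SurplusLiftSig cE Λ StCol WindowReady (SuccColQ μ)) : SurplusLiftSig cE Λ StCol WindowReady (SuccS μ) :=
 surplusLiftSig_succS_of_step hS (frozenStepSig_succColQ hμ WindowReady)









end RhIdea6.G19.W07C11.Seam






namespace RhIdea6.G19.W07C11.Seam
open RhIdea6.G17.W07C7 RhIdea6.G17.W07C7.Rev6 RhIdea6.G18.W07C8.Law421BirthS


def SurplusLiftSigV' (μ cE : ℝ) (St Ready Frozen : StatePred) : Prop :=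
 ∀ (η : ℝ) (f : ℂ → ℂ) (x₀ s hmax R Hs : ℝ) (B : ℕ), EngineHyps5 2 η f x₀ s hmax R Hs B →
   ∃ (E : Finset ℕ) (lam : ℕ → ℝ), (∀ j : ℕ, 0 ≤ lam j) ∧
     (E.card : ℝ) + (∑ e ∈ E, lam e) / (μ * s) ≤ (Hs / s) ^ 2 + B + cE ∧
     (∀ (j : ℕ) (u : ℂ), j ∉ E → St η f x₀ s hmax R Hs B j u →
       Ready η f x₀ s hmax R Hs B j u ∨ Frozen η f x₀ s hmax R Hs B j u) ∧
     (∀ (j : ℕ) (u : ℂ), j ∈ E → St η f x₀ s hmax R Hs B j u → ¬ Ready η f x₀ s hmax R Hs B j u →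
       ∃ u' : ℂ, St η f x₀ s hmax R Hs B (j + 1) u' ∧ |u'.im| ≤ |u.im| + lam j)


theorem surplusLiftSigV'_of_V {μ cE : ℝ} (hcE : 0 ≤ cE) {St Ready Frozen : StatePred}
   (h : SurplusLiftSigV μ St Ready Frozen) : SurplusLiftSigV' μ cE St Ready Frozen := by
 intro η f x₀ s hmax R Hs B hE
 obtain ⟨E, lam, hlam0, hsum, hoff, hon⟩ := h η f x₀ s hmax R Hs B hE
 exact ⟨E, lam, hlam0, by linarith, hoff, hon⟩


theorem surplusLiftSigV'_of_fork_quarter {cE c : ℝ} {St Ready Frozen : StatePred}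
   (h : SurplusLiftSig cE (liftBudget (1 / 4) cE c) St Ready Frozen) : SurplusLiftSigV' (1 / 4) c St Ready Frozen := by
 intro η f x₀ s hmax R Hs B hE
 have hE' := hE
 obtain ⟨-, -, -, hs, -⟩ := hE'
 obtain ⟨E, lam, hcard, hlam0, hsum, hoff, hon⟩ := h η f x₀ s hmax R Hs B hE
 refine ⟨E, lam, hlam0, ?_, hoff, hon⟩
 have hΛ : liftBudget (1 / 4) cE c s hmax = (c - cE) * (1 / 4 * s) := by simp only [liftBudget]; ring
 have hμs : 0 < 1 / 4 * s := by positivity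
 have h1 : (∑ e ∈ E, lam e) / (1 / 4 * s) ≤ c - cE := by
   rw [div_le_iff₀ hμs]; rw [hΛ] at hsum; linarith
 linarith



theorem descentSigC_of_liftV'_pieces (μ cE c : ℝ) (hμ : 0 < μ) (hc : 0 ≤ c)
   (hbud : ∀ s hmax : ℝ, 0 < s → 2 * s ≤ hmax → hmax / (μ * s) + cE ≤ 4 * hmax / s + c)
   (St Ready Frozen : StatePred)
   (hI : Init0Sig St) (hSL : SurplusLiftSigV' μ cE St Ready Frozen) (hF : FrozenStepSig μ St Ready Frozen)
   (hL : LandSig St Ready) : DescentSigC c := by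
 intro η f x₀ s hmax R Hs B hE
 have hE' := hE
 obtain ⟨-, -, -, hs, hsh, -, -, -, -, -, -, -, -, -, -, -⟩ := hE'
 have hμs : 0 < μ * s := mul_pos hμ hs
 obtain ⟨E, lam, hlam0, hEsum, hEoff, hEon⟩ := hSL η f x₀ s hmax R Hs B hE
 obtain ⟨u₀, hSt0, hu₀⟩ := hI η f x₀ s hmax R Hs B hE

 let S : ℕ → Finset ℕ := fun j => E.filter (fun e => j ≤ e)
 let w : ℕ → ℝ := fun e => 1 + lam e / (μ * s)
 let W : ℕ → ℝ := fun j => ∑ e ∈ S j, w e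
 let Φ : ℕ → ℂ → ℝ := fun j u => |u.im| / (μ * s) + W j
 have hw0 : ∀ e, 0 ≤ w e := fun e => by
   have : 0 ≤ lam e / (μ * s) := div_nonneg (hlam0 e) hμs.le
   simp only [w]; linarith
 have hSins : ∀ j : ℕ, j ∈ E → S j = insert j (S (j + 1)) := by
   intro j hj
   ext e
   simp only [S, Finset.mem_filter, Finset.mem_insert]
   constructor
   · rintro ⟨he, hle⟩
     by_cases h : e = j
     · exact Or.inl h
     · exact Or.inr ⟨he, by omega⟩
   · rintro (h | ⟨he, hle⟩)
     · subst h; exact ⟨hj, le_rfl⟩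
     · exact ⟨he, by omega⟩
 have hSeq : ∀ j : ℕ, j ∉ E → S (j + 1) = S j := by
   intro j hj
   ext e
   simp only [S, Finset.mem_filter]
   constructor
   · rintro ⟨he, hle⟩; exact ⟨he, by omega⟩
   · rintro ⟨he, hle⟩
     have hne : j ≠ e := fun h => hj (h ▸ he)
     exact ⟨he, by omega⟩
 have hWon : ∀ j : ℕ, j ∈ E → W j = w j + W (j + 1) := by
   intro j hj
   have hnot : j ∉ S (j + 1) := by
     simp only [S, Finset.mem_filter, not_and, not_le]
     intro _; omega
   simp only [W]
   rw [hSins j hj, Finset.sum_insert hnot]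
 have hWoff : ∀ j : ℕ, j ∉ E → W (j + 1) = W j := by
   intro j hj
   simp only [W]
   rw [hSeq j hj]
 have hWnonneg : ∀ j, 0 ≤ W j := fun j => Finset.sum_nonneg (fun e _ => hw0 e)
 have hΦnonneg : ∀ (j : ℕ) (u : ℂ), 0 ≤ Φ j u := by
   intro j u
   have : 0 ≤ |u.im| / (μ * s) := div_nonneg (abs_nonneg _) hμs.le
   have := hWnonneg j
   simp only [Φ]
   linarith

 have hStep : ∀ (j : ℕ) (u : ℂ), St η f x₀ s hmax R Hs B j u → ¬ Ready η f x₀ s hmax R Hs B j u →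
     ∃ u' : ℂ, St η f x₀ s hmax R Hs B (j + 1) u' ∧ 0 ≤ Φ (j + 1) u' ∧ Φ (j + 1) u' + 1 ≤ Φ j u := by
   intro j u hSt hR
   by_cases hjE : j ∈ E
   ·
     obtain ⟨u', hSt', hle⟩ := hEon j u hjE hSt hR
     have hWj := hWon j hjE
     have hh : |u'.im| / (μ * s) ≤ |u.im| / (μ * s) + lam j / (μ * s) := by
       rw [← add_div]
       exact div_le_div_of_nonneg_right hle hμs.le
     refine ⟨u', hSt', hΦnonneg _ _, ?_⟩
     simp only [Φ]
     simp only [w] at hWj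
     linarith
   ·
     rcases hEoff j u hjE hSt with hRj | hFz
     · exact absurd hRj hR
     obtain ⟨u', hSt', hdrop⟩ := hF η f x₀ s hmax R Hs B hE j u hSt hFz hR
     have hh : |u'.im| / (μ * s) + 1 ≤ |u.im| / (μ * s) := by
       rw [← sub_nonneg]
       have hne : μ * s ≠ 0 := ne_of_gt hμs
       have : |u.im| / (μ * s) - (|u'.im| / (μ * s) + 1) = (|u.im| - |u'.im| - μ * s) / (μ * s) := by
         field_simp
         ring
       rw [this]
       exact div_nonneg (by linarith) hμs.le
     have hWj := hWoff j hjE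
     refine ⟨u', hSt', hΦnonneg _ _, ?_⟩
     simp only [Φ]
     linarith

 have hW0 : W 0 ≤ (Hs / s) ^ 2 + B + cE := by
   have hsub : S 0 ⊆ E := Finset.filter_subset _ _
   have h1 : W 0 ≤ ∑ e ∈ E, w e := Finset.sum_le_sum_of_subset_of_nonneg hsub (fun e _ _ => hw0 e)
   have h2 : ∑ e ∈ E, w e = (E.card : ℝ) + (∑ e ∈ E, lam e) / (μ * s) := by
     simp only [w, Finset.sum_add_distrib, Finset.sum_const, nsmul_eq_mul, mul_one, Finset.sum_div]
   linarith
 have hΦ0 : Φ 0 u₀ ≤ 4 * hmax / s + (Hs / s) ^ 2 + B + c := by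
   have h1 : |u₀.im| / (μ * s) ≤ hmax / (μ * s) := div_le_div_of_nonneg_right hu₀ hμs.le
   have h2 := hbud s hmax hs hsh
   simp only [Φ]
   linarith
 obtain ⟨j, u, hj, hSt, hR⟩ :=
   descent_core (St := St η f x₀ s hmax R Hs B) (Ready := Ready η f x₀ s hmax R Hs B) (Φ := Φ)
     hStep hSt0 hΦ0 (allowance_nonneg hs hsh hc)
 obtain ⟨hnz, α, β, H, hα, hβ, hW⟩ := hL η f x₀ s hmax R Hs B hE j u hSt hR
 exact ⟨j, α, β, H, hj, hα, hβ, hnz, hW⟩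


theorem descentSigS'_of_liftV'_pieces (μ : ℝ) (hμ : 1 / 4 ≤ μ) (St Ready Frozen : StatePred)
   (hI : Init0Sig St) (hSL : SurplusLiftSigV' μ 1 St Ready Frozen) (hF : FrozenStepSig μ St Ready Frozen)
   (hL : LandSig St Ready) : DescentSigS' :=
 descentSigS'_of_descentSigC
   (descentSigC_of_liftV'_pieces μ 1 1 (by linarith) zero_le_one
     (fun s hmax hs hsh => by
       have h1 : hmax / (μ * s) ≤ hmax / (1 / 4 * s) :=
         div_le_div_of_nonneg_left (by linarith) (by positivity) (mul_le_mul_of_nonneg_right hμ hs.le)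
       have h2 : hmax / (1 / 4 * s) = 4 * hmax / s := by
         rw [div_eq_div_iff (by positivity) (ne_of_gt hs)]; ring
       linarith)
     St Ready Frozen hI hSL hF hL)











private theorem TiltedLandingLaw421_of_piecesSV1 :
   SurplusLiftSigV' (1 / 4) 1 StCol WindowReady (SuccS (1 / 4)) → AnalyticHereditySig →
     Summit.RiemannHypothesis.RiemannHypothesis.Theses.EarlyAppointments.TiltedLandingLaw421 :=
 fun hL hHer =>
   law421T_ofS' (descentSigS'_of_liftV'_pieces (1 / 4) le_rfl StCol WindowReady (SuccS (1 / 4)) init0Sig_stCol hL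
     (frozenStepSig_succS (1 / 4) WindowReady) landSig_stCol) hHer

theorem descentSigS'_of_piecesSV1 :
   SurplusLiftSigV' (1 / 4) 1 StCol WindowReady (SuccS (1 / 4)) → DescentSigS' :=
 fun hL => descentSigS'_of_liftV'_pieces (1 / 4) le_rfl StCol WindowReady (SuccS (1 / 4)) init0Sig_stCol hL
   (frozenStepSig_succS (1 / 4) WindowReady) landSig_stCol








end RhIdea6.G19.W07C11.Seam


































namespace RhIdea6.G20.W07C12.Frac

open Set Complex
open RhIdea6.G17.W07C7 RhIdea6.G17.W07C7.Rev6 RhIdea6.G18.W07C8.Law421BirthS RhIdea6.G19.W07C11.Seam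


abbrev Purse : Type := ℝ → ℝ → ℝ → ℕ → ℝ




def FracCensusSig (P : Purse) (V : Potential) (St Ready : StatePred) : Prop :=
 ∀ (η : ℝ) (f : ℂ → ℂ) (x₀ s hmax R Hs : ℝ) (B : ℕ), EngineHyps5 2 η f x₀ s hmax R Hs B →
   ∃ charge : ℕ → ℝ, (∀ j : ℕ, 0 ≤ charge j) ∧ (∀ N : ℕ, ∑ j ∈ Finset.range N, charge j ≤ P s hmax Hs B) ∧
     ∀ (j : ℕ) (u : ℂ), St η f x₀ s hmax R Hs B j u → ¬ Ready η f x₀ s hmax R Hs B j u →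
       ∃ u' : ℂ, St η f x₀ s hmax R Hs B (j + 1) u' ∧
         V η f x₀ s hmax R Hs B (j + 1) u' + 1 ≤ V η f x₀ s hmax R Hs B j u + charge j


def InitVSig (c : ℝ) (P : Purse) (V : Potential) (St : StatePred) : Prop :=
 ∀ (η : ℝ) (f : ℂ → ℂ) (x₀ s hmax R Hs : ℝ) (B : ℕ), EngineHyps5 2 η f x₀ s hmax R Hs B →
   ∃ u : ℂ, St η f x₀ s hmax R Hs B 0 u ∧ V η f x₀ s hmax R Hs B 0 u + P s hmax Hs B ≤ 4 * hmax / s + (Hs / s) ^ 2 + B + c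


def VNonnegSig (V : Potential) (St : StatePred) : Prop :=
 ∀ (η : ℝ) (f : ℂ → ℂ) (x₀ s hmax R Hs : ℝ) (B : ℕ), EngineHyps5 2 η f x₀ s hmax R Hs B →
   ∀ (j : ℕ) (u : ℂ), St η f x₀ s hmax R Hs B j u → 0 ≤ V η f x₀ s hmax R Hs B j u



def LandLeSig (St Ready : StatePred) : Prop :=
 ∀ (η : ℝ) (f : ℂ → ℂ) (x₀ s hmax R Hs : ℝ) (B : ℕ), EngineHyps5 2 η f x₀ s hmax R Hs B →
   ∀ (j : ℕ) (u : ℂ), St η f x₀ s hmax R Hs B j u → Ready η f x₀ s hmax R Hs B j u →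
     ∃ j' : ℕ, j' ≤ j ∧ iteratedDeriv j' f ≠ 0 ∧ ∃ (α β H : ℝ), x₀ - (j' + 3) * R / 2 ≤ α ∧ β ≤ x₀ + (j' + 3) * R / 2 ∧
       SignWindow (iteratedDeriv j' f) α β H


theorem landLeSig_of_landSig {St Ready : StatePred} (h : LandSig St Ready) : LandLeSig St Ready := by
 intro η f x₀ s hmax R Hs B hE j u hSt hR
 obtain ⟨hnz, α, β, H, hα, hβ, hW⟩ := h η f x₀ s hmax R Hs B hE j u hSt hR
 exact ⟨j, le_rfl, hnz, α, β, H, hα, hβ, hW⟩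




theorem descentSigC_of_fracCensus (c : ℝ) (hc : 0 ≤ c) (P : Purse) (V : Potential) (St Ready : StatePred)
   (hV : VNonnegSig V St) (hI : InitVSig c P V St) (hC : FracCensusSig P V St Ready) (hL : LandLeSig St Ready) :
   DescentSigC c := by
 intro η f x₀ s hmax R Hs B hE
 have hE' := hE
 obtain ⟨-, -, -, hs, hsh, -⟩ := hE'
 obtain ⟨charge, hch0, hchP, hstep⟩ := hC η f x₀ s hmax R Hs B hE
 obtain ⟨u₀, hSt0, hV0⟩ := hI η f x₀ s hmax R Hs B hE

 let Φ : ℕ → ℂ → ℝ := fun j u => V η f x₀ s hmax R Hs B j u + (P s hmax Hs B - ∑ i ∈ Finset.range j, charge i)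
 have hStep : ∀ (j : ℕ) (u : ℂ), St η f x₀ s hmax R Hs B j u → ¬ Ready η f x₀ s hmax R Hs B j u →
     ∃ u' : ℂ, St η f x₀ s hmax R Hs B (j + 1) u' ∧ 0 ≤ Φ (j + 1) u' ∧ Φ (j + 1) u' + 1 ≤ Φ j u := by
   intro j u hSt hR
   obtain ⟨u', hSt', hle⟩ := hstep j u hSt hR
   have hsum : ∑ i ∈ Finset.range (j + 1), charge i = ∑ i ∈ Finset.range j, charge i + charge j :=
     Finset.sum_range_succ _ _
   have hV' : 0 ≤ V η f x₀ s hmax R Hs B (j + 1) u' := hV η f x₀ s hmax R Hs B hE (j + 1) u' hSt'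
   have hP' : ∑ i ∈ Finset.range (j + 1), charge i ≤ P s hmax Hs B := hchP (j + 1)
   refine ⟨u', hSt', ?_, ?_⟩
   · simp only [Φ]
     linarith
   · simp only [Φ]
     rw [hsum]
     linarith
 have hΦ0 : Φ 0 u₀ ≤ 4 * hmax / s + (Hs / s) ^ 2 + B + c := by
   simp only [Φ, Finset.range_zero, Finset.sum_empty, sub_zero]
   linarith
 obtain ⟨j, u, hj, hSt, hR⟩ :=
   descent_core (St := St η f x₀ s hmax R Hs B) (Ready := Ready η f x₀ s hmax R Hs B) (Φ := Φ)
     hStep hSt0 hΦ0 (allowance_nonneg hs hsh hc)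
 obtain ⟨j', hj', hnz, α, β, H, hα, hβ, hW⟩ := hL η f x₀ s hmax R Hs B hE j u hSt hR
 have hjj : (j' : ℝ) ≤ j := by exact_mod_cast hj'
 exact ⟨j', α, β, H, by linarith, hα, hβ, hnz, hW⟩


theorem fracCensus_mono_purse {P P' : Purse} (hP : ∀ s hmax Hs B, P s hmax Hs B ≤ P' s hmax Hs B) {V : Potential} {St Ready : StatePred}
   (h : FracCensusSig P V St Ready) : FracCensusSig P' V St Ready := by
 intro η f x₀ s hmax R Hs B hE
 obtain ⟨charge, hch0, hchP, hstep⟩ := h η f x₀ s hmax R Hs B hE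
 exact ⟨charge, hch0, fun N => (hchP N).trans (hP s hmax Hs B), hstep⟩


theorem fracCensus_mono_ready {Ready Ready' : StatePred}
   (hR : ∀ η f x₀ s hmax R Hs B j u, Ready η f x₀ s hmax R Hs B j u → Ready' η f x₀ s hmax R Hs B j u)
   {P : Purse} {V : Potential} {St : StatePred} (h : FracCensusSig P V St Ready) : FracCensusSig P V St Ready' := by
 intro η f x₀ s hmax R Hs B hE
 obtain ⟨charge, hch0, hchP, hstep⟩ := h η f x₀ s hmax R Hs B hE
 exact ⟨charge, hch0, hchP, fun j u hSt hR' => hstep j u hSt (fun hRj => hR' (hR _ _ _ _ _ _ _ _ _ _ hRj))⟩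




def CumReady (Ready : StatePred) : StatePred := fun η f x₀ s hmax R Hs B j u =>
 ∃ j' : ℕ, j' ≤ j ∧ Ready η f x₀ s hmax R Hs B j' u

theorem cumReady_of_ready {Ready : StatePred} {η : ℝ} {f : ℂ → ℂ} {x₀ s hmax R Hs : ℝ} {B j : ℕ} {u : ℂ}
   (h : Ready η f x₀ s hmax R Hs B j u) : CumReady Ready η f x₀ s hmax R Hs B j u :=
 ⟨j, le_rfl, h⟩


theorem ne_zero_of_signWindow {g : ℂ → ℂ} {α β H : ℝ} (h : SignWindow g α β H) : g ≠ 0 := by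
 intro hg
 apply h.2.2.1
 rw [hg]
 rfl


theorem landLeSig_cumReady (St : StatePred) : LandLeSig St (CumReady WindowReady) := by
 intro η f x₀ s hmax R Hs B _ j u _ hR
 obtain ⟨j', hj', α, β, H, hα, hβ, hW⟩ := hR
 exact ⟨j', hj', ne_zero_of_signWindow hW, α, β, H, hα, hβ, hW⟩


theorem fracCensus_cumReady_of {P : Purse} {V : Potential} {St Ready : StatePred} (h : FracCensusSig P V St Ready) :
   FracCensusSig P V St (CumReady Ready) :=
 fracCensus_mono_ready (fun _ _ _ _ _ _ _ _ _ _ hRj => cumReady_of_ready hRj) h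




noncomputable def VLin (μ : ℝ) : Potential := fun _η _f _x₀ s _hmax _R _Hs _B _j u => |u.im| / (μ * s)


noncomputable def PLin (cE : ℝ) : Purse := fun s _hmax Hs B => (Hs / s) ^ 2 + B + cE


noncomputable def VLQ : Potential := fun _η _f _x₀ s _hmax _R _Hs _B _j u => 4 * |u.im| / s + (|u.im| / s) ^ 2


noncomputable def PB (cB : ℝ) : Purse := fun _s _hmax _Hs B => (B : ℝ) + cB

theorem vNonneg_lin {μ : ℝ} (hμ : 0 < μ) (St : StatePred) : VNonnegSig (VLin μ) St := by
 intro η f x₀ s hmax R Hs B hE j u _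
 obtain ⟨-, -, -, hs, -⟩ := hE
 simp only [VLin]
 exact div_nonneg (abs_nonneg _) (mul_pos hμ hs).le

theorem vNonneg_LQ (St : StatePred) : VNonnegSig VLQ St := by
 intro η f x₀ s hmax R Hs B hE j u _
 obtain ⟨-, -, -, hs, -⟩ := hE
 simp only [VLQ]
 have h1 : 0 ≤ 4 * |u.im| / s := div_nonneg (by positivity) hs.le
 have h2 : 0 ≤ (|u.im| / s) ^ 2 := sq_nonneg _
 linarith


theorem initV_lin {μ cE c : ℝ} (hμ : 0 < μ)
   (hbud : ∀ s hmax : ℝ, 0 < s → 2 * s ≤ hmax → hmax / (μ * s) + cE ≤ 4 * hmax / s + c)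
   {St : StatePred} (hI : Init0Sig St) : InitVSig c (PLin cE) (VLin μ) St := by
 intro η f x₀ s hmax R Hs B hE
 have hE' := hE
 obtain ⟨-, -, -, hs, hsh, -⟩ := hE'
 obtain ⟨u, hSt, hu⟩ := hI η f x₀ s hmax R Hs B hE
 refine ⟨u, hSt, ?_⟩
 have hμs : 0 < μ * s := mul_pos hμ hs
 have h1 : |u.im| / (μ * s) ≤ hmax / (μ * s) := div_le_div_of_nonneg_right hu hμs.le
 have h2 := hbud s hmax hs hsh
 simp only [VLin, PLin]
 linarith


theorem initV_lin_quarter {μ cE c : ℝ} (hμ : 1 / 4 ≤ μ) (hcE : cE ≤ c) {St : StatePred} (hI : Init0Sig St) :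
   InitVSig c (PLin cE) (VLin μ) St :=
 initV_lin (by linarith) (fun _ _ hs hsh => budget_of_quarter_le' hμ hcE hs hsh) hI



theorem initV_LQ {cB c : ℝ} (hcc : cB ≤ c) {St : StatePred} (hI : Init0Sig St)
   (hZ : ∀ (η : ℝ) (f : ℂ → ℂ) (x₀ s hmax R Hs : ℝ) (B : ℕ) (u : ℂ), St η f x₀ s hmax R Hs B 0 u → f u = 0) :
   InitVSig c (PB cB) VLQ St := by
 intro η f x₀ s hmax R Hs B hE
 have hE' := hE
 obtain ⟨-, -, -, hs, hsh, -, -, hHs, hstrip, -⟩ := hE'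
 obtain ⟨u, hSt, hu⟩ := hI η f x₀ s hmax R Hs B hE
 refine ⟨u, hSt, ?_⟩
 have hfu : f u = 0 := hZ η f x₀ s hmax R Hs B u hSt
 have huH : |u.im| ≤ Hs := hstrip u hfu
 have h1 : 4 * |u.im| / s ≤ 4 * hmax / s := div_le_div_of_nonneg_right (by linarith) hs.le
 have h0 : 0 ≤ |u.im| / s := div_nonneg (abs_nonneg _) hs.le
 have hle : |u.im| / s ≤ Hs / s := div_le_div_of_nonneg_right huH hs.le
 have h2 : (|u.im| / s) ^ 2 ≤ (Hs / s) ^ 2 := sq_le_sq' (by linarith) hle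
 simp only [VLQ, PB]
 linarith


theorem stCol_level0_zero (η : ℝ) (f : ℂ → ℂ) (x₀ s hmax R Hs : ℝ) (B : ℕ) (u : ℂ)
   (h : StCol η f x₀ s hmax R Hs B 0 u) : f u = 0 := by
 have h2 := h.2.1
 rwa [iteratedDeriv_zero] at h2


theorem initV_LQ_stCol {cB c : ℝ} (hcc : cB ≤ c) : InitVSig c (PB cB) VLQ StCol :=
 initV_LQ hcc init0Sig_stCol stCol_level0_zero






theorem fracCensus_lin_of_liftV' {μ cE : ℝ} (hμ : 0 < μ) {St Ready Frozen : StatePred}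
   (hS : SurplusLiftSigV' μ cE St Ready Frozen) (hF : FrozenStepSig μ St Ready Frozen) :
   FracCensusSig (PLin cE) (VLin μ) St Ready := by
 intro η f x₀ s hmax R Hs B hE
 have hE' := hE
 obtain ⟨-, -, -, hs, -⟩ := hE'
 have hμs : 0 < μ * s := mul_pos hμ hs
 obtain ⟨E, lam, hlam0, hsum, hoff, hon⟩ := hS η f x₀ s hmax R Hs B hE
 have hw0 : ∀ j, 0 ≤ lam j / (μ * s) := fun j => div_nonneg (hlam0 j) hμs.le

 have hch0 : ∀ j : ℕ, 0 ≤ (if j ∈ E then 1 + lam j / (μ * s) else 0 : ℝ) := by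
   intro j
   by_cases hj : j ∈ E
   · rw [if_pos hj]
     linarith [hw0 j]
   · simp only [if_neg hj, le_refl]
 have hchP : ∀ N : ℕ, ∑ j ∈ Finset.range N, (if j ∈ E then 1 + lam j / (μ * s) else 0 : ℝ) ≤ PLin cE s hmax Hs B := by
   intro N
   have h1 : ∑ j ∈ Finset.range N, (if j ∈ E then 1 + lam j / (μ * s) else 0 : ℝ) =
       ∑ j ∈ (Finset.range N).filter (fun j => j ∈ E), (1 + lam j / (μ * s)) := by
     rw [Finset.sum_filter]
   have h2 : ∑ j ∈ (Finset.range N).filter (fun j => j ∈ E), (1 + lam j / (μ * s)) ≤ ∑ j ∈ E, (1 + lam j / (μ * s)) := by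
     apply Finset.sum_le_sum_of_subset_of_nonneg
     · intro j hj
       exact (Finset.mem_filter.mp hj).2
     · intro j _ _
       linarith [hw0 j]
   have h3 : ∑ j ∈ E, (1 + lam j / (μ * s)) = (E.card : ℝ) + (∑ e ∈ E, lam e) / (μ * s) := by
     rw [Finset.sum_add_distrib, Finset.sum_const, nsmul_eq_mul, mul_one, Finset.sum_div]
   simp only [PLin]
   linarith
 have hstep : ∀ (j : ℕ) (u : ℂ), St η f x₀ s hmax R Hs B j u → ¬ Ready η f x₀ s hmax R Hs B j u →
     ∃ u' : ℂ, St η f x₀ s hmax R Hs B (j + 1) u' ∧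
       VLin μ η f x₀ s hmax R Hs B (j + 1) u' + 1 ≤ VLin μ η f x₀ s hmax R Hs B j u + (if j ∈ E then 1 + lam j / (μ * s) else 0 : ℝ) := by
   intro j u hSt hR
   by_cases hjE : j ∈ E
   · obtain ⟨u', hSt', hle⟩ := hon j u hjE hSt hR
     refine ⟨u', hSt', ?_⟩
     have hh : |u'.im| / (μ * s) ≤ |u.im| / (μ * s) + lam j / (μ * s) := by
       rw [← add_div]
       exact div_le_div_of_nonneg_right hle hμs.le
     rw [if_pos hjE]
     simp only [VLin]
     linarith
   · rcases hoff j u hjE hSt with hRj | hFz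
     · exact absurd hRj hR
     obtain ⟨u', hSt', hdrop⟩ := hF η f x₀ s hmax R Hs B hE j u hSt hFz hR
     refine ⟨u', hSt', ?_⟩
     have hh : |u'.im| / (μ * s) + 1 ≤ |u.im| / (μ * s) := by
       rw [← sub_nonneg]
       have : |u.im| / (μ * s) - (|u'.im| / (μ * s) + 1) = (|u.im| - |u'.im| - μ * s) / (μ * s) := by
         field_simp
         ring
       rw [this]
       exact div_nonneg (by linarith) hμs.le
     rw [if_neg hjE]
     simp only [VLin]
     linarith
 exact ⟨fun j => if j ∈ E then 1 + lam j / (μ * s) else 0, hch0, hchP, hstep⟩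




theorem descentSigC_of_fracLin {μ cE c : ℝ} (hμ : 1 / 4 ≤ μ) (hcE : cE ≤ c) (hc : 0 ≤ c) {St Ready : StatePred}
   (hI : Init0Sig St) (hC : FracCensusSig (PLin cE) (VLin μ) St Ready) (hL : LandLeSig St Ready) : DescentSigC c :=
 descentSigC_of_fracCensus c hc (PLin cE) (VLin μ) St Ready (vNonneg_lin (by linarith) St) (initV_lin_quarter hμ hcE hI) hC hL


theorem descentSigS'_of_fracLin {μ : ℝ} (hμ : 1 / 4 ≤ μ) {St Ready : StatePred}
   (hI : Init0Sig St) (hC : FracCensusSig (PLin 1) (VLin μ) St Ready) (hL : LandLeSig St Ready) : DescentSigS' :=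
 descentSigS'_of_descentSigC (descentSigC_of_fracLin hμ le_rfl zero_le_one hI hC hL)


theorem descentSigS_of_fracLin {μ : ℝ} (hμ : 1 / 4 ≤ μ) {St Ready : StatePred}
   (hI : Init0Sig St) (hC : FracCensusSig (PLin 0) (VLin μ) St Ready) (hL : LandLeSig St Ready) : DescentSigS :=
 descentSigS_of_descentSigC (descentSigC_of_fracLin hμ le_rfl le_rfl hI hC hL)


theorem descentSigC_of_fracLQ {c : ℝ} (hc : 0 ≤ c) {Ready : StatePred}
   (hC : FracCensusSig (PB c) VLQ StCol Ready) (hL : LandLeSig StCol Ready) : DescentSigC c :=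
 descentSigC_of_fracCensus c hc (PB c) VLQ StCol Ready (vNonneg_LQ StCol) (initV_LQ_stCol le_rfl) hC hL


theorem descentSigS'_of_fracLQ {Ready : StatePred} (hC : FracCensusSig (PB 1) VLQ StCol Ready) (hL : LandLeSig StCol Ready) :
   DescentSigS' :=
 descentSigS'_of_descentSigC (descentSigC_of_fracLQ zero_le_one hC hL)


theorem descentSigS_of_fracLQ {Ready : StatePred} (hC : FracCensusSig (PB 0) VLQ StCol Ready) (hL : LandLeSig StCol Ready) :
   DescentSigS :=
 descentSigS_of_descentSigC (descentSigC_of_fracLQ le_rfl hC hL)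






def FracLin : Prop := FracCensusSig (PLin 1) (VLin (1 / 4)) StCol (CumReady WindowReady)




def FracLQ : Prop := FracCensusSig (PB 1) VLQ StCol (CumReady WindowReady)


def FracLin0 : Prop := FracCensusSig (PLin 0) (VLin (1 / 4)) StCol (CumReady WindowReady)
def FracLQ0 : Prop := FracCensusSig (PB 0) VLQ StCol (CumReady WindowReady)

theorem descentSigS'_of_fracLinSlot (h : FracLin) : DescentSigS' :=
 descentSigS'_of_fracLin le_rfl init0Sig_stCol h (landLeSig_cumReady StCol)

theorem descentSigS'_of_fracLQSlot (h : FracLQ) : DescentSigS' :=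
 descentSigS'_of_fracLQ h (landLeSig_cumReady StCol)

theorem descentSigS_of_fracLin0Slot (h : FracLin0) : DescentSigS :=
 descentSigS_of_fracLin le_rfl init0Sig_stCol h (landLeSig_cumReady StCol)

theorem descentSigS_of_fracLQ0Slot (h : FracLQ0) : DescentSigS :=
 descentSigS_of_fracLQ h (landLeSig_cumReady StCol)


theorem fracLin_of_liftSV1 (h : SurplusLiftSigV' (1 / 4) 1 StCol WindowReady (SuccS (1 / 4))) : FracLin :=
 fracCensus_cumReady_of (fracCensus_lin_of_liftV' (by norm_num) h (frozenStepSig_succS (1 / 4) WindowReady))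


theorem fracCensusLin_of_liftSV1 (h : SurplusLiftSigV' (1 / 4) 1 StCol WindowReady (SuccS (1 / 4))) :
   FracCensusSig (PLin 1) (VLin (1 / 4)) StCol WindowReady :=
 fracCensus_lin_of_liftV' (by norm_num) h (frozenStepSig_succS (1 / 4) WindowReady)



private theorem law421T_of_fracLin (h : FracLin) (hHer : AnalyticHereditySig) :
   Summit.RiemannHypothesis.RiemannHypothesis.Theses.EarlyAppointments.TiltedLandingLaw421 :=
 law421T_ofS' (descentSigS'_of_fracLinSlot h) hHer

private theorem law421T_of_fracLQ (h : FracLQ) (hHer : AnalyticHereditySig) :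
   Summit.RiemannHypothesis.RiemannHypothesis.Theses.EarlyAppointments.TiltedLandingLaw421 :=
 law421T_ofS' (descentSigS'_of_fracLQSlot h) hHer

private theorem law421T_of_fracLin0 (h : FracLin0) (hHer : AnalyticHereditySig) :
   Summit.RiemannHypothesis.RiemannHypothesis.Theses.EarlyAppointments.TiltedLandingLaw421 :=
 law421T_ofS' (descentSigS'_of_descentSigS (descentSigS_of_fracLin0Slot h)) hHer

private theorem law421T_of_fracLQ0 (h : FracLQ0) (hHer : AnalyticHereditySig) :
   Summit.RiemannHypothesis.RiemannHypothesis.Theses.EarlyAppointments.TiltedLandingLaw421 :=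
 law421T_ofS' (descentSigS'_of_descentSigS (descentSigS_of_fracLQ0Slot h)) hHer















end RhIdea6.G20.W07C12.Frac















namespace RhIdea6.G20.W07C12.StColP

open Set Complex
open RhIdea6.G17.W07C7 RhIdea6.G17.W07C7.Rev6 RhIdea6.G18.W07C8.Law421BirthS RhIdea6.G19.W07C11.Seam RhIdea6.G20.W07C12.Frac




def StCol' : StatePred := fun _η f x₀ s _hmax R Hs _B j u =>
 iteratedDeriv j f ≠ 0 ∧ iteratedDeriv j f u = 0 ∧ 0 < u.im ∧ |u.re - x₀| ≤ R / 2 + (j : ℝ) * (s / 4) ∧ u.im ≤ Hs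


def SuccS' (μ : ℝ) : StatePred := fun η f x₀ s hmax R Hs B j u =>
 ∃ u' : ℂ, StCol' η f x₀ s hmax R Hs B (j + 1) u' ∧ |u'.im| + μ * s ≤ |u.im|


theorem frozenStepSig_succS' (μ : ℝ) (Ready : StatePred) : FrozenStepSig μ StCol' Ready (SuccS' μ) :=
 fun _ _ _ _ _ _ _ _ _ _ _ _ hF _ => hF


theorem stColP_of_stCol {η : ℝ} {f : ℂ → ℂ} {x₀ s hmax R Hs : ℝ} {B j : ℕ} {u : ℂ}
   (hstripj : ∀ w : ℂ, iteratedDeriv j f w = 0 → |w.im| ≤ Hs) (h : StCol η f x₀ s hmax R Hs B j u) :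
   StCol' η f x₀ s hmax R Hs B j u :=
 ⟨h.1, h.2.1, h.2.2.1, h.2.2.2.1, le_trans (le_abs_self _) (hstripj u h.2.1)⟩


theorem stCol_of_stColP {η : ℝ} {f : ℂ → ℂ} {x₀ s hmax R Hs : ℝ} {B j : ℕ} {u : ℂ}
   (h : StCol' η f x₀ s hmax R Hs B j u) (hu : u.im ≤ hmax) : StCol η f x₀ s hmax R Hs B j u :=
 ⟨h.1, h.2.1, h.2.2.1, h.2.2.2.1, hu⟩



theorem init0Sig_stCol' : Init0Sig StCol' := by
 intro η f x₀ s hmax R Hs B hE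
 obtain ⟨hdiff, hreal, -, hs, hsh, -, h3R, hHs, hstrip, -, ⟨w₀, hw0, hwim, hwre, hwh⟩, -⟩ := hE
 have hf : iteratedDeriv 0 f ≠ 0 := by
   intro hf0
   rw [iteratedDeriv_zero] at hf0
   have h := hstrip ((Hs + 1 : ℝ) * I) (by rw [hf0]; rfl)
   have him : (((Hs + 1 : ℝ) : ℂ) * I).im = Hs + 1 := by simp
   rw [him, abs_of_nonneg (by linarith)] at h
   linarith
 have hR : |x₀ - x₀| ≤ R / 2 + ((0 : ℕ) : ℝ) * (s / 4) := by
   rw [sub_self, abs_zero]; push_cast; nlinarith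
 have hwabs : |w₀.im| ≤ hmax := hwh
 have hwHs : |w₀.im| ≤ Hs := hstrip w₀ hw0
 rcases lt_or_gt_of_ne hwim with hneg | hpos
 · refine ⟨conj w₀, ⟨hf, ?_, ?_, ?_, ?_⟩, ?_⟩
   · rw [iteratedDeriv_zero, Literature.Analysis.Complex.apply_conj_eq_conj hdiff hreal, hw0, map_zero]
   · rw [Complex.conj_im]; linarith
   · rw [Complex.conj_re, hwre]; exact hR
   · rw [Complex.conj_im]; rw [abs_of_neg hneg] at hwHs; exact hwHs
   · rw [Complex.conj_im, abs_neg]; exact hwh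
 · refine ⟨w₀, ⟨hf, ?_, hpos, ?_, ?_⟩, hwh⟩
   · rw [iteratedDeriv_zero]; exact hw0
   · rw [hwre]; exact hR
   · exact le_trans (le_abs_self _) hwHs


theorem landSig_stCol' : LandSig StCol' WindowReady :=
 landSig_windowReady StCol' (fun _ _ _ _ _ _ _ _ _ _ h => h.1)


theorem landLeSig_stCol' : LandLeSig StCol' (CumReady WindowReady) :=
 landLeSig_cumReady StCol'


theorem stColP_level0_zero (η : ℝ) (f : ℂ → ℂ) (x₀ s hmax R Hs : ℝ) (B : ℕ) (u : ℂ)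
   (h : StCol' η f x₀ s hmax R Hs B 0 u) : f u = 0 := by
 have h2 := h.2.1
 rwa [iteratedDeriv_zero] at h2





theorem descentSigS'_of_piecesSV1P (h : SurplusLiftSigV' (1 / 4) 1 StCol' WindowReady (SuccS' (1 / 4))) : DescentSigS' :=
 descentSigS'_of_liftV'_pieces (1 / 4) le_rfl StCol' WindowReady (SuccS' (1 / 4)) init0Sig_stCol' h
   (frozenStepSig_succS' (1 / 4) WindowReady) landSig_stCol'


theorem descentSigS'_of_piecesV'P {μ : ℝ} (hμ : 1 / 4 ≤ μ) (h : SurplusLiftSigV' μ 1 StCol' WindowReady (SuccS' μ)) : DescentSigS' :=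
 descentSigS'_of_liftV'_pieces μ hμ StCol' WindowReady (SuccS' μ) init0Sig_stCol' h (frozenStepSig_succS' μ WindowReady) landSig_stCol'

private theorem law421T_of_piecesSV1P (h : SurplusLiftSigV' (1 / 4) 1 StCol' WindowReady (SuccS' (1 / 4))) (hHer : AnalyticHereditySig) :
   Summit.RiemannHypothesis.RiemannHypothesis.Theses.EarlyAppointments.TiltedLandingLaw421 :=
 law421T_ofS' (descentSigS'_of_piecesSV1P h) hHer





theorem descent_core_stop {St : ℕ → ℂ → Prop} {Stop : ℕ → Prop} {Φ : ℕ → ℂ → ℝ} {A : ℝ}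
   (hS : ∀ (j : ℕ) (u : ℂ), St j u → (∀ j' : ℕ, j' ≤ j → ¬ Stop j') →
     ∃ u' : ℂ, St (j + 1) u' ∧ 0 ≤ Φ (j + 1) u' ∧ Φ (j + 1) u' + 1 ≤ Φ j u)
   {u₀ : ℂ} (h0 : St 0 u₀) (hΦ0 : Φ 0 u₀ ≤ A) (hA : 0 ≤ A) :
   ∃ j : ℕ, (j : ℝ) ≤ A ∧ Stop j := by
 obtain ⟨j, u, hj, -, j', hj', hStop⟩ :=
   descent_core (St := St) (Ready := fun j _ => ∃ j' : ℕ, j' ≤ j ∧ Stop j') (Φ := Φ)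
     (fun j u hSt hR => hS j u hSt (fun j' hj' hSj' => hR ⟨j', hj', hSj'⟩)) h0 hΦ0 hA
 have hjj : (j' : ℝ) ≤ j := by exact_mod_cast hj'
 exact ⟨j', by linarith, hStop⟩


theorem surplusLiftSigV'_mono_ready {μ cE : ℝ} {St Ready Ready' Frozen : StatePred}
   (hR : ∀ η f x₀ s hmax R Hs B j u, Ready η f x₀ s hmax R Hs B j u → Ready' η f x₀ s hmax R Hs B j u)
   (h : SurplusLiftSigV' μ cE St Ready Frozen) : SurplusLiftSigV' μ cE St Ready' Frozen := by
 intro η f x₀ s hmax R Hs B hE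
 obtain ⟨E, lam, hlam0, hsum, hoff, hon⟩ := h η f x₀ s hmax R Hs B hE
 refine ⟨E, lam, hlam0, hsum, ?_, ?_⟩
 · intro j u hj hSt
   rcases hoff j u hj hSt with hRj | hFz
   · exact Or.inl (hR _ _ _ _ _ _ _ _ _ _ hRj)
   · exact Or.inr hFz
 · intro j u hj hSt hR'
   exact hon j u hj hSt (fun hRj => hR' (hR _ _ _ _ _ _ _ _ _ _ hRj))




def SurplusLiftSigStop (μ cE : ℝ) : Prop := SurplusLiftSigV' μ cE StCol' (CumReady WindowReady) (SuccS' μ)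


theorem surplusLiftSigStop_of_plain {μ cE : ℝ} (h : SurplusLiftSigV' μ cE StCol' WindowReady (SuccS' μ)) : SurplusLiftSigStop μ cE :=
 surplusLiftSigV'_mono_ready (fun _ _ _ _ _ _ _ _ _ _ hRj => cumReady_of_ready hRj) h


theorem fracCensusLinP_of_stop {μ cE : ℝ} (hμ : 0 < μ) (h : SurplusLiftSigStop μ cE) :
   FracCensusSig (PLin cE) (VLin μ) StCol' (CumReady WindowReady) :=
 fracCensus_lin_of_liftV' hμ h (frozenStepSig_succS' μ (CumReady WindowReady))



theorem descentSigS'_of_stop {μ : ℝ} (hμ : 1 / 4 ≤ μ) (h : SurplusLiftSigStop μ 1) : DescentSigS' :=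
 descentSigS'_of_fracLin hμ init0Sig_stCol' (fracCensusLinP_of_stop (by linarith) h) (landLeSig_cumReady StCol')


theorem descentSigS_of_stop0 {μ : ℝ} (hμ : 1 / 4 ≤ μ) (h : SurplusLiftSigStop μ 0) : DescentSigS :=
 descentSigS_of_fracLin hμ init0Sig_stCol' (fracCensusLinP_of_stop (by linarith) h) (landLeSig_cumReady StCol')

private theorem law421T_of_stop (h : SurplusLiftSigStop (1 / 4) 1) (hHer : AnalyticHereditySig) :
   Summit.RiemannHypothesis.RiemannHypothesis.Theses.EarlyAppointments.TiltedLandingLaw421 :=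
 law421T_ofS' (descentSigS'_of_stop le_rfl h) hHer




def FracLinP : Prop := FracCensusSig (PLin 1) (VLin (1 / 4)) StCol' (CumReady WindowReady)


def FracLQP : Prop := FracCensusSig (PB 1) VLQ StCol' (CumReady WindowReady)

theorem descentSigS'_of_fracLinP (h : FracLinP) : DescentSigS' :=
 descentSigS'_of_fracLin le_rfl init0Sig_stCol' h (landLeSig_cumReady StCol')

theorem initV_LQ_stColP {cB c : ℝ} (hcc : cB ≤ c) : InitVSig c (PB cB) VLQ StCol' :=
 initV_LQ hcc init0Sig_stCol' stColP_level0_zero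

theorem descentSigS'_of_fracLQP (h : FracLQP) : DescentSigS' :=
 descentSigS'_of_descentSigC
   (descentSigC_of_fracCensus 1 zero_le_one (PB 1) VLQ StCol' (CumReady WindowReady) (vNonneg_LQ StCol') (initV_LQ_stColP le_rfl) h
     (landLeSig_cumReady StCol'))


theorem fracLinP_of_stop (h : SurplusLiftSigStop (1 / 4) 1) : FracLinP :=
 fracCensusLinP_of_stop (by norm_num) h

private theorem law421T_of_fracLinP (h : FracLinP) (hHer : AnalyticHereditySig) :
   Summit.RiemannHypothesis.RiemannHypothesis.Theses.EarlyAppointments.TiltedLandingLaw421 :=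
 law421T_ofS' (descentSigS'_of_fracLinP h) hHer

private theorem law421T_of_fracLQP (h : FracLQP) (hHer : AnalyticHereditySig) :
   Summit.RiemannHypothesis.RiemannHypothesis.Theses.EarlyAppointments.TiltedLandingLaw421 :=
 law421T_ofS' (descentSigS'_of_fracLQP h) hHer














end RhIdea6.G20.W07C12.StColP






































namespace RhW07.C12.FieldSplit

open Set Complex
open RhIdea6.G17.W07C7 RhIdea6.G17.W07C7.Annex RhIdea6.G17.W07C7.Rev6 RhIdea6.G18.W07C8.Law421BirthS RhIdea6.G19.W07C11.Seam
open RhIdea6.G20.W07C12.Frac RhIdea6.G20.W07C12.StColP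




def SuccOf (μ : ℝ) (St : StatePred) : StatePred := fun η f x₀ s hmax R Hs B j u =>
 ∃ u' : ℂ, St η f x₀ s hmax R Hs B (j + 1) u' ∧ |u'.im| + μ * s ≤ |u.im|

theorem succS_eq_succOf (μ : ℝ) : SuccS μ = SuccOf μ StCol := rfl
theorem succS'_eq_succOf (μ : ℝ) : SuccS' μ = SuccOf μ StCol' := rfl


theorem succOf_of_lower {μ : ℝ} {St : StatePred} {η : ℝ} {f : ℂ → ℂ} {x₀ s hmax R Hs : ℝ} {B j : ℕ} {u v : ℂ}
   (hv : SuccOf μ St η f x₀ s hmax R Hs B j v) (hle : |v.im| ≤ |u.im|) : SuccOf μ St η f x₀ s hmax R Hs B j u := by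
 obtain ⟨u', hS', hdrop⟩ := hv
 exact ⟨u', hS', le_trans hdrop hle⟩


def IsolatedPairDropG (μ : ℝ) (P St Ready : StatePred) : Prop :=
 ∀ (η : ℝ) (f : ℂ → ℂ) (x₀ s hmax R Hs : ℝ) (B : ℕ), EngineHyps5 2 η f x₀ s hmax R Hs B →
   ∀ (j : ℕ) (u : ℂ), St η f x₀ s hmax R Hs B j u → ¬ Ready η f x₀ s hmax R Hs B j u →
     P η f x₀ s hmax R Hs B j u → SuccOf μ St η f x₀ s hmax R Hs B j u



def DenseLevelCensusG (μ cE : ℝ) (P St Ready : StatePred) : Prop :=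
 ∀ (η : ℝ) (f : ℂ → ℂ) (x₀ s hmax R Hs : ℝ) (B : ℕ), EngineHyps5 2 η f x₀ s hmax R Hs B →
   ∃ (E : Finset ℕ) (lam : ℕ → ℝ), (∀ j : ℕ, 0 ≤ lam j) ∧
     (E.card : ℝ) + (∑ e ∈ E, lam e) / (μ * s) ≤ (Hs / s) ^ 2 + B + cE ∧
     (∀ (j : ℕ) (u : ℂ), j ∉ E → St η f x₀ s hmax R Hs B j u → ¬ Ready η f x₀ s hmax R Hs B j u →
       ∃ v : ℂ, St η f x₀ s hmax R Hs B j v ∧ ¬ Ready η f x₀ s hmax R Hs B j v ∧ |v.im| ≤ |u.im| ∧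
         P η f x₀ s hmax R Hs B j v) ∧
     (∀ (j : ℕ) (u : ℂ), j ∈ E → St η f x₀ s hmax R Hs B j u → ¬ Ready η f x₀ s hmax R Hs B j u →
       ∃ u' : ℂ, St η f x₀ s hmax R Hs B (j + 1) u' ∧ |u'.im| ≤ |u.im| + lam j)



theorem liftV'_of_fieldSplitG {μ cE : ℝ} {P St Ready : StatePred}
   (hα : IsolatedPairDropG μ P St Ready) (hβ : DenseLevelCensusG μ cE P St Ready) :
   SurplusLiftSigV' μ cE St Ready (SuccOf μ St) := by
 intro η f x₀ s hmax R Hs B hE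
 obtain ⟨E, lam, hlam0, hsum, hoff, hon⟩ := hβ η f x₀ s hmax R Hs B hE
 refine ⟨E, lam, hlam0, hsum, ?_, hon⟩
 intro j u hj hS
 by_cases hR : Ready η f x₀ s hmax R Hs B j u
 · exact Or.inl hR
 · obtain ⟨v, hSv, hRv, hle, hPv⟩ := hoff j u hj hS hR
   exact Or.inr (succOf_of_lower (hα η f x₀ s hmax R Hs B hE j v hSv hRv hPv) hle)


theorem isolatedPairDropG_anti {μ : ℝ} {P P' St Ready : StatePred}
   (hPP : ∀ η f x₀ s hmax R Hs B j u, P' η f x₀ s hmax R Hs B j u → P η f x₀ s hmax R Hs B j u)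
   (h : IsolatedPairDropG μ P St Ready) : IsolatedPairDropG μ P' St Ready :=
 fun η f x₀ s hmax R Hs B hE j u hS hR hP' => h η f x₀ s hmax R Hs B hE j u hS hR (hPP _ _ _ _ _ _ _ _ _ _ hP')


theorem denseLevelCensusG_mono {μ cE cE' : ℝ} (hc : cE ≤ cE') {P P' St Ready : StatePred}
   (hPP : ∀ η f x₀ s hmax R Hs B j u, P η f x₀ s hmax R Hs B j u → P' η f x₀ s hmax R Hs B j u)
   (h : DenseLevelCensusG μ cE P St Ready) : DenseLevelCensusG μ cE' P' St Ready := by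
 intro η f x₀ s hmax R Hs B hE
 obtain ⟨E, lam, hlam0, hsum, hoff, hon⟩ := h η f x₀ s hmax R Hs B hE
 refine ⟨E, lam, hlam0, by linarith, ?_, hon⟩
 intro j u hj hS hR
 obtain ⟨v, hSv, hRv, hle, hPv⟩ := hoff j u hj hS hR
 exact ⟨v, hSv, hRv, hle, hPP _ _ _ _ _ _ _ _ _ _ hPv⟩



theorem denseLevelCensusG_of_cover {μ cE : ℝ} (hcE : 0 ≤ cE) {P St Ready : StatePred}
   (hP : ∀ η f x₀ s hmax R Hs B j u, EngineHyps5 2 η f x₀ s hmax R Hs B → St η f x₀ s hmax R Hs B j u →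
     ¬ Ready η f x₀ s hmax R Hs B j u → P η f x₀ s hmax R Hs B j u) :
   DenseLevelCensusG μ cE P St Ready := by
 intro η f x₀ s hmax R Hs B hE
 refine ⟨∅, fun _ => 0, fun _ => le_rfl, ?_, ?_, ?_⟩
 · simp only [Finset.card_empty, Nat.cast_zero, Finset.sum_empty, zero_div, add_zero]
   positivity
 · intro j u _ hS hR
   exact ⟨u, hS, hR, le_rfl, hP _ _ _ _ _ _ _ _ _ _ hE hS hR⟩
 · intro j u hj
   simp at hj



theorem isolatedPairDropG_bot (μ : ℝ) (St Ready : StatePred) :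
   IsolatedPairDropG μ (fun _ _ _ _ _ _ _ _ _ _ => False) St Ready :=
 fun _ _ _ _ _ _ _ _ _ _ _ _ _ hP => hP.elim





def IsolatedPairDrop (P : StatePred) : Prop := IsolatedPairDropG (1 / 4) P StCol' (CumReady WindowReady)




def DenseLevelCensusStop (P : StatePred) : Prop := DenseLevelCensusG (1 / 4) 1 P StCol' (CumReady WindowReady)


theorem surplusLiftSigStop_of_fieldSplitG {μ cE : ℝ} {P : StatePred}
   (hα : IsolatedPairDropG μ P StCol' (CumReady WindowReady)) (hβ : DenseLevelCensusG μ cE P StCol' (CumReady WindowReady)) :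
   SurplusLiftSigStop μ cE :=
 liftV'_of_fieldSplitG hα hβ

theorem surplusLiftSigStop_of_fieldSplit {P : StatePred} (hα : IsolatedPairDrop P) (hβ : DenseLevelCensusStop P) :
   SurplusLiftSigStop (1 / 4) 1 :=
 surplusLiftSigStop_of_fieldSplitG hα hβ


theorem descentSigS'_of_fieldSplit {P : StatePred} (hα : IsolatedPairDrop P) (hβ : DenseLevelCensusStop P) : DescentSigS' :=
 descentSigS'_of_stop le_rfl (surplusLiftSigStop_of_fieldSplit hα hβ)


theorem descentSigS'_of_fieldSplitG {μ : ℝ} (hμ : 1 / 4 ≤ μ) {P : StatePred}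
   (hα : IsolatedPairDropG μ P StCol' (CumReady WindowReady)) (hβ : DenseLevelCensusG μ 1 P StCol' (CumReady WindowReady)) : DescentSigS' :=
 descentSigS'_of_stop hμ (surplusLiftSigStop_of_fieldSplitG hα hβ)


theorem descentSigS_of_fieldSplit0 {μ : ℝ} (hμ : 1 / 4 ≤ μ) {P : StatePred}
   (hα : IsolatedPairDropG μ P StCol' (CumReady WindowReady)) (hβ : DenseLevelCensusG μ 0 P StCol' (CumReady WindowReady)) : DescentSigS :=
 descentSigS_of_stop0 hμ (surplusLiftSigStop_of_fieldSplitG hα hβ)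


theorem fracLinP_of_fieldSplit {P : StatePred} (hα : IsolatedPairDrop P) (hβ : DenseLevelCensusStop P) : FracLinP :=
 fracLinP_of_stop (surplusLiftSigStop_of_fieldSplit hα hβ)


private theorem fieldSplit_law421T {P : StatePred} (hα : IsolatedPairDrop P) (hβ : DenseLevelCensusStop P) (hHer : AnalyticHereditySig) :
   Summit.RiemannHypothesis.RiemannHypothesis.Theses.EarlyAppointments.TiltedLandingLaw421 :=
 law421T_ofS' (descentSigS'_of_fieldSplit hα hβ) hHer




def IsLowest (St : StatePred) : StatePred := fun η f x₀ s hmax R Hs B j v =>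
 St η f x₀ s hmax R Hs B j v ∧ ∀ w : ℂ, St η f x₀ s hmax R Hs B j w → v.im ≤ w.im


def HasLowestSig (St : StatePred) : Prop :=
 ∀ (η : ℝ) (f : ℂ → ℂ) (x₀ s hmax R Hs : ℝ) (B : ℕ), EngineHyps5 2 η f x₀ s hmax R Hs B →
   ∀ (j : ℕ) (u : ℂ), St η f x₀ s hmax R Hs B j u → ∃ v : ℂ, IsLowest St η f x₀ s hmax R Hs B j v



def DenseLevelCensusLow (μ cE : ℝ) (P St Ready : StatePred) : Prop :=
 ∀ (η : ℝ) (f : ℂ → ℂ) (x₀ s hmax R Hs : ℝ) (B : ℕ), EngineHyps5 2 η f x₀ s hmax R Hs B →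
   ∃ (E : Finset ℕ) (lam : ℕ → ℝ), (∀ j : ℕ, 0 ≤ lam j) ∧
     (E.card : ℝ) + (∑ e ∈ E, lam e) / (μ * s) ≤ (Hs / s) ^ 2 + B + cE ∧
     (∀ (j : ℕ) (v : ℂ), j ∉ E → IsLowest St η f x₀ s hmax R Hs B j v → ¬ Ready η f x₀ s hmax R Hs B j v →
       P η f x₀ s hmax R Hs B j v) ∧
     (∀ (j : ℕ) (u : ℂ), j ∈ E → St η f x₀ s hmax R Hs B j u → ¬ Ready η f x₀ s hmax R Hs B j u →
       ∃ u' : ℂ, St η f x₀ s hmax R Hs B (j + 1) u' ∧ |u'.im| ≤ |u.im| + lam j)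

def DenseLevelCensusStopLow (P : StatePred) : Prop := DenseLevelCensusLow (1 / 4) 1 P StCol' (CumReady WindowReady)


theorem denseLevelCensusStop_of_low {μ cE : ℝ} {P : StatePred} (hL : HasLowestSig StCol')
   (h : DenseLevelCensusLow μ cE P StCol' (CumReady WindowReady)) : DenseLevelCensusG μ cE P StCol' (CumReady WindowReady) := by
 intro η f x₀ s hmax R Hs B hE
 obtain ⟨E, lam, hlam0, hsum, hoff, hon⟩ := h η f x₀ s hmax R Hs B hE
 refine ⟨E, lam, hlam0, hsum, ?_, hon⟩
 intro j u hj hS hR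
 obtain ⟨v, hSv, hmin⟩ := hL η f x₀ s hmax R Hs B hE j u hS
 have hRv : ¬ CumReady WindowReady η f x₀ s hmax R Hs B j v := hR
 refine ⟨v, hSv, hRv, ?_, hoff j v hj ⟨hSv, hmin⟩ hRv⟩
 rw [abs_of_pos hSv.2.2.1, abs_of_pos hS.2.2.1]
 exact hmin u hS

theorem descentSigS'_of_fieldSplitLow {P : StatePred} (hL : HasLowestSig StCol') (hα : IsolatedPairDrop P) (hβ : DenseLevelCensusStopLow P) :
   DescentSigS' :=
 descentSigS'_of_fieldSplit hα (denseLevelCensusStop_of_low hL hβ)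



theorem isolatedPairDrop_bot : IsolatedPairDrop (fun _ _ _ _ _ _ _ _ _ _ => False) := isolatedPairDropG_bot _ _ _

theorem denseLevelCensusStop_top : DenseLevelCensusStop (fun _ _ _ _ _ _ _ _ _ _ => True) :=
 denseLevelCensusG_of_cover zero_le_one (fun _ _ _ _ _ _ _ _ _ _ _ _ _ => trivial)

theorem isolatedPairDrop_anti {P P' : StatePred} (hPP : ∀ η f x₀ s hmax R Hs B j u, P' η f x₀ s hmax R Hs B j u → P η f x₀ s hmax R Hs B j u)
   (h : IsolatedPairDrop P) : IsolatedPairDrop P' :=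
 isolatedPairDropG_anti hPP h

theorem denseLevelCensusStop_mono {P P' : StatePred} (hPP : ∀ η f x₀ s hmax R Hs B j u, P η f x₀ s hmax R Hs B j u → P' η f x₀ s hmax R Hs B j u)
   (h : DenseLevelCensusStop P) : DenseLevelCensusStop P' :=
 denseLevelCensusG_mono le_rfl hPP h




noncomputable def cExt (f : ℂ → ℂ) (j : ℕ) (u : ℂ) : ℂ :=
 iteratedDeriv (j + 2) f u / (2 * iteratedDeriv (j + 1) f u) + I / (2 * (u.im : ℂ))


noncomputable def pairNewtonRoots (c : ℂ) (ε : ℝ) : ℂ × ℂ :=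
 let d : ℂ := (1 - c ^ 2 * (ε : ℂ) ^ 2) ^ ((1 : ℂ) / 2)
 ((-1 + d) / c, (-1 - d) / c)


noncomputable def pairNewtonRoot (c : ℂ) (ε : ℝ) : ℂ := by
 classical
 exact if ‖(pairNewtonRoots c ε).1 - (ε : ℂ) * I‖ ≤ ‖(pairNewtonRoots c ε).2 - (ε : ℂ) * I‖
   then (pairNewtonRoots c ε).1 else (pairNewtonRoots c ε).2


noncomputable def pairNewtonRootHi (c : ℂ) (ε : ℝ) : ℂ := by
 classical
 exact if (pairNewtonRoots c ε).2.im ≤ (pairNewtonRoots c ε).1.im then (pairNewtonRoots c ε).1 else (pairNewtonRoots c ε).2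


noncomputable def dP (f : ℂ → ℂ) (j : ℕ) (u : ℂ) : ℝ := u.im - (pairNewtonRoot (cExt f j u) u.im).im
noncomputable def dPHi (f : ℂ → ℂ) (j : ℕ) (u : ℂ) : ℝ := u.im - (pairNewtonRootHi (cExt f j u) u.im).im


noncomputable def dX (f : ℂ → ℂ) (j : ℕ) (u : ℂ) : ℝ := (pairNewtonRoot (cExt f j u) u.im).re


noncomputable def dMin (f : ℂ → ℂ) (j : ℕ) (u : ℂ) : ℝ :=
 sInf {d : ℝ | ∃ r : ℂ, iteratedDeriv j f r = 0 ∧ r ≠ u ∧ r ≠ (starRingEnd ℂ) u ∧ d = ‖u - r‖}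


noncomputable def iota (f : ℂ → ℂ) (j : ℕ) (u : ℂ) : ℝ := dMin f j u * ‖cExt f j u‖


def PSealC1 : StatePred := fun _η f _x₀ s _hmax _R _Hs _B j u =>
 (1 / 50 : ℝ) * s < (pairNewtonRoot (cExt f j u) u.im).im ∧
   ((3 ≤ iota f j u ∧ (7 / 25 : ℝ) * s ≤ dP f j u) ∨ (2 ≤ iota f j u ∧ (3 / 10 : ℝ) * s ≤ dP f j u))


def PSealC2 : StatePred := fun _η f _x₀ s _hmax _R _Hs _B j u =>
 (1 / 3 : ℝ) * s ≤ dPHi f j u ∧ (1 / 50 : ℝ) * s ≤ (pairNewtonRootHi (cExt f j u) u.im).im ∧ 2 ≤ iota f j u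


def PSealC3 : StatePred := fun _η f _x₀ s _hmax _R _Hs _B j u =>
 2 ≤ iota f j u ∧ (3 / 10 : ℝ) * s ≤ dP f j u ∧ dP f j u ≤ u.im - (1 / 20 : ℝ) * s ∧ |dX f j u| ≤ (1 / 5 : ℝ) * s


def PSealC6 : StatePred := fun _η f _x₀ s _hmax _R _Hs _B j u =>
 2 ≤ iota f j u ∧ (1 / 50 : ℝ) * s ≤ (pairNewtonRoot (cExt f j u) u.im).im ∧
   (7 / 25 : ℝ) * s + (1 / 10 : ℝ) * s / (‖cExt f j u‖ * s) ≤ dP f j u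


def PSealC4 : StatePred := fun _η f _x₀ s _hmax _R _Hs _B j u =>
 2 ≤ iota f j u ∧ (1 / 20 : ℝ) * s ≤ (pairNewtonRoot (cExt f j u) u.im).im ∧ |dX f j u| ≤ (1 / 5 : ℝ) * s ∧
   (7 / 25 : ℝ) * s + (7 / 50 : ℝ) * s / iota f j u ^ 2 ≤ dP f j u














def LemmaCountC1 : Prop :=
 ∀ (g : ℂ → ℂ) (Hs x₀ r : ℝ), InClass g Hs → g ≠ 0 → 0 ≤ r → nonRealCount (deriv g) x₀ r ≤ nonRealCount g x₀ (r + Hs)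


def LemmaCountC6 : Prop :=
 ∀ (η : ℝ) (f : ℂ → ℂ) (x₀ s hmax R Hs : ℝ) (B : ℕ), EngineHyps5 2 η f x₀ s hmax R Hs B →
   ∀ (j : ℕ) (r : ℝ), s ≤ r → r + s ≤ R / 2 →
     nonRealCount (iteratedDeriv (j + 1) f) x₀ r ≤ nonRealCount (iteratedDeriv j f) x₀ (r + s / 4)



def LemmaSlowLevelC3 : Prop :=
 ∀ (η : ℝ) (f : ℂ → ℂ) (x₀ s hmax R Hs : ℝ) (B : ℕ), EngineHyps5 2 η f x₀ s hmax R Hs B →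
   ∀ (j : ℕ) (r : ℝ), s ≤ r →
     (∀ i ≤ j, ∀ v : ℂ, StCol' η f x₀ s hmax R Hs B i v → ¬ WindowReady η f x₀ s hmax R Hs B i v) →
     (∃ u : ℂ, StCol' η f x₀ s hmax R Hs B j u ∧ (∀ v : ℂ, StCol' η f x₀ s hmax R Hs B j v → u.im ≤ v.im) ∧
       ¬ PSealC3 η f x₀ s hmax R Hs B j u) →
     (∑ᶠ z ∈ {z : ℂ | iteratedDeriv (j + 1) f z = 0 ∧ ‖z - x₀‖ ≤ r}, ((analyticOrderAt (iteratedDeriv (j + 1) f) z).toNat : ℝ)) + 1 ≤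
       ∑ᶠ z ∈ {z : ℂ | iteratedDeriv j f z = 0 ∧ ‖z - x₀‖ ≤ r + s / 4}, ((analyticOrderAt (iteratedDeriv j f) z).toNat : ℝ)


def LemmaSlowStepFieldC2 : Prop :=
 ∀ (h : ℂ → ℂ) (u u' : ℂ), DifferentiableAt ℂ h u' → h u' ≠ 0 → u' ≠ u →
   deriv (fun z => (z - u) * h z) u' = 0 → ‖deriv h u' / h u'‖ = 1 / ‖u' - u‖


def LemmaColumnBudgetC4 : Prop :=
 ∀ (η : ℝ) (f : ℂ → ℂ) (x₀ s hmax R Hs : ℝ) (B : ℕ), EngineHyps5 2 η f x₀ s hmax R Hs B → ColumnBudgetMult (B + 1) (deriv f) x₀ s (R / 2)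








end RhW07.C12.FieldSplit





namespace RhW07.C12.FieldSplit

open Set Complex
open RhIdea6.G17.W07C7 RhIdea6.G17.W07C7.Rev6 RhIdea6.G18.W07C8.Law421BirthS RhIdea6.G19.W07C11.Seam
open RhIdea6.G20.W07C12.Frac RhIdea6.G20.W07C12.StColP


theorem finite_zeros_closedBall_of_entire {g : ℂ → ℂ} (hg : Differentiable ℂ g) (hne : g ≠ 0) (c : ℂ) (ρ : ℝ) :
   {w : ℂ | w ∈ Metric.closedBall c ρ ∧ g w = 0}.Finite := by
 have hga : AnalyticOnNhd ℂ g (Metric.closedBall c ρ) := fun z _ => hg.analyticAt z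
 refine ((MeromorphicOn.divisor g (Metric.closedBall c ρ)).finiteSupport (isCompact_closedBall c ρ)).subset ?_
 rintro w ⟨hwK, hgw⟩
 rw [Function.mem_support, hga.meromorphicOn.divisor_apply hwK, (hga w hwK).meromorphicOrderAt_eq]
 have hntop : analyticOrderAt g w ≠ ⊤ := by
   intro htop
   have huniv : AnalyticOnNhd ℂ g Set.univ := fun z _ => hg.analyticAt z
   have hall := huniv.eqOn_zero_of_preconnected_of_eventuallyEq_zero isPreconnected_univ (Set.mem_univ w)
     (analyticOrderAt_eq_top.mp htop)
   exact hne (funext fun z => hall (Set.mem_univ z))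
 have hne0 : analyticOrderAt g w ≠ 0 := by
   rw [Ne, (hga w hwK).analyticOrderAt_eq_zero]; exact fun h => h hgw
 obtain ⟨n, hn⟩ := ENat.ne_top_iff_exists.mp hntop
 rw [← hn] at hne0 ⊢
 have hn0 : n ≠ 0 := fun h0 => hne0 (by simp [h0])
 simp [hn0]


theorem stColP_level_finite {η : ℝ} {f : ℂ → ℂ} {x₀ s hmax R Hs : ℝ} {B : ℕ} (hE : EngineHyps5 2 η f x₀ s hmax R Hs B) (j : ℕ) :
   {w : ℂ | StCol' η f x₀ s hmax R Hs B j w}.Finite := by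
 obtain ⟨hdiff, -⟩ := hE
 by_cases hg : iteratedDeriv j f = 0
 · have : {w : ℂ | StCol' η f x₀ s hmax R Hs B j w} = ∅ := by
     ext w
     simp only [Set.mem_setOf_eq, Set.mem_empty_iff_false, iff_false]
     exact fun hw => hw.1 hg
   rw [this]; exact Set.finite_empty
 · have hgd : Differentiable ℂ (iteratedDeriv j f) := Literature.Analysis.Complex.differentiable_iteratedDeriv_of_entire hdiff j
   refine (finite_zeros_closedBall_of_entire hgd hg (x₀ : ℂ) (R / 2 + (j : ℝ) * (s / 4) + Hs)).subset ?_
   intro w hw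
   obtain ⟨-, hw0, hwim, hwre, hwHs⟩ := hw
   refine ⟨?_, hw0⟩
   rw [Metric.mem_closedBall, dist_eq_norm]
   have h1 : ‖w - (x₀ : ℂ)‖ ≤ |(w - (x₀ : ℂ)).re| + |(w - (x₀ : ℂ)).im| := Complex.norm_le_abs_re_add_abs_im _
   have h2 : (w - (x₀ : ℂ)).re = w.re - x₀ := by simp
   have h3 : (w - (x₀ : ℂ)).im = w.im := by simp
   rw [h2, h3, abs_of_pos hwim] at h1
   linarith


theorem hasLowestSig_stCol' : HasLowestSig StCol' := by
 intro η f x₀ s hmax R Hs B hE j u hS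
 have hfin := stColP_level_finite hE j
 have hne : {w : ℂ | StCol' η f x₀ s hmax R Hs B j w}.Nonempty := ⟨u, hS⟩
 obtain ⟨v, hv, hmin⟩ := hfin.exists_minimalFor Complex.im _ hne
 refine ⟨v, hv, fun w hw => ?_⟩
 by_contra hlt
 rw [not_le] at hlt
 exact absurd (hmin hw hlt.le) (not_le.mpr hlt)


theorem denseLevelCensusStop_of_low' {P : StatePred} (h : DenseLevelCensusStopLow P) : DenseLevelCensusStop P :=
 denseLevelCensusStop_of_low hasLowestSig_stCol' h

theorem descentSigS'_of_fieldSplitLow' {P : StatePred} (hα : IsolatedPairDrop P) (hβ : DenseLevelCensusStopLow P) : DescentSigS' :=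
 descentSigS'_of_fieldSplitLow hasLowestSig_stCol' hα hβ




end RhW07.C12.FieldSplit





namespace RhW07.C12.FieldSplit

open Set Complex
open RhIdea6.G17.W07C7 RhIdea6.G17.W07C7.Rev6 RhIdea6.G18.W07C8.Law421BirthS RhIdea6.G19.W07C11.Seam
open RhIdea6.G20.W07C12.Frac RhIdea6.G20.W07C12.StColP


def IsolatedPairDropLowG (μ : ℝ) (P St Ready : StatePred) : Prop :=
 ∀ (η : ℝ) (f : ℂ → ℂ) (x₀ s hmax R Hs : ℝ) (B : ℕ), EngineHyps5 2 η f x₀ s hmax R Hs B →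
   ∀ (j : ℕ) (v : ℂ), IsLowest St η f x₀ s hmax R Hs B j v → ¬ Ready η f x₀ s hmax R Hs B j v →
     P η f x₀ s hmax R Hs B j v → SuccOf μ St η f x₀ s hmax R Hs B j v



def IsolatedPairDropLow (P : StatePred) : Prop := IsolatedPairDropLowG (1 / 4) P StCol' (CumReady WindowReady)


theorem isolatedPairDropLow_of {P : StatePred} (h : IsolatedPairDrop P) : IsolatedPairDropLow P :=
 fun η f x₀ s hmax R Hs B hE j v hv hR hP => h η f x₀ s hmax R Hs B hE j v hv.1 hR hP



theorem surplusLiftSigStop_of_fieldSplitLow {P : StatePred} (hα : IsolatedPairDropLow P) (hβ : DenseLevelCensusStopLow P) :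
   SurplusLiftSigStop (1 / 4) 1 := by
 intro η f x₀ s hmax R Hs B hE
 obtain ⟨E, lam, hlam0, hsum, hoff, hon⟩ := hβ η f x₀ s hmax R Hs B hE
 refine ⟨E, lam, hlam0, hsum, ?_, hon⟩
 intro j u hj hS
 by_cases hR : CumReady WindowReady η f x₀ s hmax R Hs B j u
 · exact Or.inl hR
 · obtain ⟨v, hv⟩ := hasLowestSig_stCol' η f x₀ s hmax R Hs B hE j u hS
   have hRv : ¬ CumReady WindowReady η f x₀ s hmax R Hs B j v := hR
   have hPv := hoff j v hj hv hRv
   obtain ⟨u', hS', hdrop⟩ := hα η f x₀ s hmax R Hs B hE j v hv hRv hPv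
   refine Or.inr ⟨u', hS', le_trans hdrop ?_⟩
   rw [abs_of_pos hv.1.2.2.1, abs_of_pos hS.2.2.1]
   exact hv.2 u hS


theorem descentSigS'_of_fieldSplitLowLow {P : StatePred} (hα : IsolatedPairDropLow P) (hβ : DenseLevelCensusStopLow P) : DescentSigS' :=
 descentSigS'_of_stop le_rfl (surplusLiftSigStop_of_fieldSplitLow hα hβ)

private theorem fieldSplitLow_law421T {P : StatePred} (hα : IsolatedPairDropLow P) (hβ : DenseLevelCensusStopLow P) (hHer : AnalyticHereditySig) :
   Summit.RiemannHypothesis.RiemannHypothesis.Theses.EarlyAppointments.TiltedLandingLaw421 :=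
 law421T_ofS' (descentSigS'_of_fieldSplitLowLow hα hβ) hHer











end RhW07.C12.FieldSplit




























namespace Summit.RiemannHypothesis.RiemannHypothesis.Cruxes.TiltedLandingLaw421.FieldSplitV1

set_option linter.dupNamespace false

open RhIdea6.G17.W07C7 RhIdea6.G17.W07C7.Rev6 RhIdea6.G18.W07C8.Law421BirthS RhIdea6.G19.W07C11.Seam
open RhIdea6.G20.W07C12.Frac RhIdea6.G20.W07C12.StColP RhW07.C12.FieldSplit


theorem stub_isolatedPairDropLow : IsolatedPairDropLow PSealC4 := by
 sorry



theorem stub_denseLevelCensusStopLow : DenseLevelCensusStopLow PSealC4 := by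
 sorry


theorem analyticHeredity_holds : AnalyticHereditySig := _root_.stub_analyticHeredity


theorem hasLowest_holds : HasLowestSig StCol' := hasLowestSig_stCol'





private theorem law421T_of_stubs (hα : IsolatedPairDropLow PSealC4) (hβ : DenseLevelCensusStopLow PSealC4) :
   Summit.RiemannHypothesis.RiemannHypothesis.Theses.EarlyAppointments.TiltedLandingLaw421 :=
 law421T_ofS' (descentSigS'_of_fieldSplitLowLow hα hβ) analyticHeredity_holds









theorem TiltedLandingLaw421_of :
   Summit.RiemannHypothesis.RiemannHypothesis.Theses.EarlyAppointments.TiltedLandingLaw421 :=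
 law421T_of_stubs stub_isolatedPairDropLow stub_denseLevelCensusStopLow






end Summit.RiemannHypothesis.RiemannHypothesis.Cruxes.TiltedLandingLaw421.FieldSplitV1
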